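import Mathlib
import Summits.Schanuel.Schanuel.Theses.RigidCore
import Literature.ModelTheory.ExponentialFields.DefinabilityParams
import Literature.ModelTheory.ExponentialFields.DecidableTheory
import Literature.NumberTheory.Transcendental.PeriodsWave0NesterenkoProofs
import Literature.NumberTheory.Transcendental.PeriodsWave0Proofs
import Literature.NumberTheory.Transcendental.LindemannWeierstrassProofs
import Literature.ModelTheory.ExponentialFields.DefinableClosure
import Literature.NumberTheory.Transcendental.ZilberFieldQuasiminimal
import Summits.Schanuel.Schanuel.Theorems.RigidCoreAclSubsetLogFreeCoreOfEac

/-!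
# Disproof of `AclSubsetLogFreeCore` — findings (crux stmt-Schanuel-0968, cdisprove gen 2–5)

Crux (A): `acl^{ℂ_exp}(∅) ⊆ C_EA` — every element of a FINITE `∅`-definable subset of
`(ℂ, +, ·, −, 0, 1, exp)` lies in the log-free core `C_EA = sInf {K | 2πi ∈ K, exp K ⊆ K,
K relatively algebraically closed in ℂ}` (`Summit.Schanuel.Schanuel.Theses.RigidCore.AclSubsetLogFreeCore`).

**Verdict of this file: NOT refuted; irrefutable (and unprovable) with present mathematics.**
Everything below is sorry-free EXCEPT the three statements of §6, which are recorded near-misses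
(open problems), each with its obstruction, the calibration §12 (a PAPER theorem whose Lean proof
needs a computable-analysis library), and the §14 quotation of the landed gen-5 theorem (sorry-free in
`Negative/StandardKernelTwist.lean`; quoted by `sorry` until that module is merged and importable).  Axioms: propext / Classical.choice / Quot.sound (+ the tree
theorems `nesterenko_holds`, `transcendental_rat_cexp_one`).

## Findings (index)

* §0 faithfulness: the Lean statement is the intended one (`crux_iff : (A) ↔ expAcl ⊆ logFreeCore`
  by `Iff.rfl`; the structure on `ℂ` is `Complex.exp`, unique instance; `⊤ ∈ coreFamily`,
  `logFreeCore ∈ coreFamily`, membership = `∀ K ∈ coreFamily` (`mem_logFreeCore_iff`)).  No junk.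
* §1 an `∅`-definability kit for `ℂ_exp` (`definableFun_cexp/add'/mul'/neg'/natCast'/intCast'`,
  `definableFun_reindex`, `definable_mem_of_definable₁`) and the classical definable sets:
  `ℤ` (`definable₁_int` — so `ℂ_exp` is not minimal), the kernel generators `{±2πi}`
  (`definable₁_kerGens`), and POINTWISE: `π ∈ dcl(∅)` (`pi_mem_expDcl`, KMO §2.5 sign-cancelling
  formula `PiFormula`), `e^π ∈ dcl(∅)`, `e ∈ dcl(∅)` (quantifier-free).
* §2 members of the family from relative algebraic closures (`relAlg`, `relAlg_closed`); Nesterenko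
  pushed to `ℂ`: `algebraicIndependent_pi_exp_pi`, `exp_pi_not_mem_Kpi` (`Kpi = ℚ(π)^{ralg} ∋ 2πi`).
* §3 **`C_EA = K_ω`**, the union of the explicit tower `stage 0 = ℚ(2πi)^{ralg}`,
  `stage (n+1) = ℚ(Kₙ ∪ exp Kₙ)^{ralg}` (`logFreeCore_eq_Komega`, `mem_logFreeCore_iff_exists_stage`
  — induction on stages is available to provers); **`C_EA` is countable** (`countable_logFreeCore`),
  `exists_not_mem_logFreeCore`, `exists_real_not_mem_logFreeCore`.
* §4 LOAD-BEARING HYPOTHESES (each a theorem `¬ <variant>`):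
  - finiteness of the definable set: `not_withoutFinite` (`ℂ` is `∅`-definable, `C_EA` countable);
  - parameter-freeness: `not_withParams_univ`, `not_withParams_real`, and already ONE real parameter
    is fatal `exists_not_withParams_singleton`; in general `WithParams P → P ⊆ C_EA`;
  - `exp`-closure of the core: `not_withoutExpClosed` (**Nesterenko**: `e^π ∈ dcl(∅)` escapes
    `ℚ(π)^{ralg}`), so any proof of (A) must use that `C_EA` is closed under `exp`;
  - both transcendental generators: `not_withoutPeriodAndExp` (`e ∈ dcl(∅)` is transcendental:
    `acl(∅)` is NOT the field-theoretic `ℚ̄`, unlike in `(ℂ, +, ·)`).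
* §5 `conj` is an `L_exp`-automorphism (`conjLEquiv`); `∅`-definable sets are `conj`-stable;
  **`dcl(∅) ⊆ ℝ`** (`expDcl_subset_range_ofReal`); elementary symmetric functions of a finite
  `∅`-definable set are `∅`-definable POINTS (`coeff_mem_expDcl`, via `definableFun_mvPolynomial_aeval`),
  whence the REFORMULATIONS **`(A) ⟺ dcl(∅) ⊆ C_EA ⟺ every ∅-definable REAL number is in C_EA`**
  (`crux_iff_expDcl`, `crux_iff_real`); `acl(∅)` is countable (`countable_expAcl`): no counting and
  no known automorphism separates the two sides.
  Also: the core is `conj`-stable (`conj_mem_logFreeCore` via `map_conjQ_mem_coreFamily`), and is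
  NOT pointwise definable: `2πi ∉ dcl(∅)`, `not_logFreeCore_subset_expDcl` (refuted misreading
  "C_EA consists of ∅-definable numbers"; only `C_EA ⊆ acl(∅)`, item 0972, can hold).
* §6 NEAR-MISSES (sorried, OPEN): dropping the period `2πi` (`not_withoutPeriod` needs `π ∉ EA(ℚ)`,
  ⟸ SC), dropping relative algebraic closedness (`not_withoutRelAlgClosed` needs an algebraic
  number outside the E-closure of `ℚ(2πi)`, ⟸ SC), and the crux itself (`not_crux`).
* §7 REFUTED NATURAL STRENGTHENING `not_branchIndiscernibility`: the branches `ln 2 + 2πik` are NOT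
  `∅`-indiscernible — `√2 ∈ dcl(∅)` (Kummer trick, `sqrtTwoSet`) makes the PARITY of `k`
  `∅`-definable (`branchParitySet ∋ ln 2`, `∌ ln 2 + 2πi`).  The slogan "ℂ_exp does not know which
  logarithm is real" is false read as indiscernibility; BI₂-type instance lemmas must be stated
  mod `4πi`.  (A) is untouched (parity classes are infinite).

* §8 TIGHTNESS `logFreeCore_subset_expAcl`: `acl(∅)` is an `exp`-closed subfield, relatively
  algebraically closed in `ℂ` (`expAclField`, `expAcl_relAlgClosed`), containing `2πi`, hence a
  member of the family: **`C_EA ⊆ acl(∅)`** — the route's support item 0972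
  `LogFreeCoreSubsetAcl` is PROVED here (`logFreeCoreSubsetAcl_holds`; candidate attached on the
  item for a prover to land) — and **(A) ⟺ `acl(∅) = C_EA`** (`crux_iff_eq`): the bound cannot be
  improved.  `not_crux_iff`: a refutation is exactly a pointwise `∅`-definable real outside every
  stage of `K_ω`.
* §9 (gen 3) **`acl` IS IDEMPOTENT** (general model theory, any `L`-structure: `modelAcl_modelAcl`,
  Marker Ex. 1.4.11, via elimination of one algebraic parameter by a counting formula) ⇒ the EXACT
  load-bearing status of parameter-freeness: **`withParams_iff : WithParams P ↔ (A) ∧ P ⊆ C_EA`** —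
  a parameter `p` is fatal iff `p ∉ C_EA`, free iff `p ∈ C_EA` (`withParams_pi_iff`,
  `withParams_int_iff`); **(A) ⟺ WithParams C_EA ⟺ `acl(C_EA) = C_EA`** (`crux_iff_modelAcl_logFreeCore_eq`):
  the crux says precisely that the log-free core is an `acl`-closed substructure of `ℂ_exp`.
* §10 (gen 3) REFUTED-UNDER-SC STRENGTHENING `CountableVariant` ("every COUNTABLE `∅`-definable set
  ⊆ C_EA"): it forces `ln 2 ∈ C_EA` and makes `C_EA` closed under ALL logarithms of its elements
  (`log_mem_logFreeCore_of_countableVariant`, via §8 tightness) — false under SC; so although under EAC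
  countable `∅`-definable sets lie in `ecl ∅`, "finite" cannot be weakened to "countable" in (A).
* §11 (gen 3) TARGETS = the stubs of the two registered lines (`Lines/eac-homogeneity-collapse.lean`,
  `Lines/eac-extends-core-automorphisms.lean`): no stub refutable today (reasons in the section
  docblock); `conj ∈ Aut_E(C₀)` in both presentations (`conjCore`, `isEIsoOn_conj_ecl_empty`, by
  functoriality of `ecl`) ⇒ the fixed field of `Aut_E(C₀)` is REAL and both residue stubs are
  equivalent to their real restrictions (`coreFixedLogFree_iff_real`, `coreFixedFieldLogFree_iff_real`).
* §12 (gen 3) CALIBRATION. Formal half (sorry-free): **(A) + `Def_∅(ℝ)` ⇒ `C_EA ∩ ℝ_{>0}` closed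
  under real `log`** (`log_mem_logFreeCore_of_real_definable`) ⇒ `ln 2, ln π, ln ln π ∈ K_ω`, SC-false:
  so (A) ∧ SC ⇒ `ℝ` not `∅`-definable in `ℂ_exp`.  Paper half (`sorry`d): **(A) ⇒ `ℝ` is not
  `∅`-definable in `ℂ_exp`** outright (parameter-free Koiran; via a non-computable `∅`-definable real
  vs. `C_EA ⊆` computable numbers) — any proof of (A) settles a 30-year-old open undefinability
  question; `Def_∅(ℝ)` is the only conceivable UNCONDITIONAL kill of (A), and it is Koiran-hard.

* §13 (gen 4) **THE HUB `ln 2 ∈ dcl(∅)`** — the single instance of (A) at the branch set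
  `T₂ = {z | e^z = 2}` already has both halves open, and everything feeds through it:
  - conjugation averaging (`log_two_mem_expDcl_of_finite_definable_subset`): a finite non-empty
    `∅`-definable `F ⊆ T₂` is `conj`-stable, so `ln 2 = ΣF/|F| ∈ dcl(∅)`; hence
    **`T₂ ∩ acl(∅) ≠ ∅ ⟺ ln 2 ∈ dcl(∅) ⟺ ln 2 ∈ acl(∅)`** (`branch_mem_expAcl_iff`) and
    **(A)|_{T₂} ⟺ (ln 2 ∈ dcl(∅) → ln 2 ∈ C_EA)** (`aclSubsetLogFreeCore_at_branches_iff`),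
    **(A) ⇒ ln 2 ∈ C_EA ∨ T₂ ∩ acl(∅) = ∅** (`logFree_or_branches_disjoint_acl_of_crux`);
  - ACCIDENTAL RELATIONS FEED THE HUB (ideate-2 F2/F3 made formal): for non-constant `R ∈ ℤ[X,W]`,
    `s_R = {x | e^x = 2 ∧ ∃w (e^w = 3 ∧ R(x,w) = 0)}` is `∅`-definable and — modulo the route's support
    `TwoLogsBranchRelationFinite` (Theorem L over Baker, hypothesis `hL`) — finite; so ONE relation
    `R(ln 2 + 2πij, ln 3 + 2πik) = 0` gives `ln 2 ∈ dcl(∅)` (`log_two_mem_expDcl_of_branchRelation`) and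
    **(A) ∧ L ⇒ ln 2 ∈ C_EA ∨ all-branch algebraic independence of `log 2`, `log 3`**
    (`logFree_or_allBranchIndep_of_crux`): SC-false ∨ open-transcendence — **(A) is not soft**; this is
    the `ℂ`-shadow of (A) FAILING in Bays–Kirby's `𝕄(F)` on such a relation (EAC + CCP + standard kernel
    + quasiminimal, so no Zilber-axiom/homogeneity argument alone proves (A));
  - KMO hinge (`root_two_mem_expDcl_of_log_two_mem_expDcl`): `ln 2 ∈ dcl(∅) ⇒ 2^{1/n} ∈ dcl(∅)`; with L,
    **`2^{1/3} ∉ dcl^{ℂ_exp}(∅)` ⇒ all-branch `log 2 ⊥ log 3`** (`allBranchIndep_of_root_two_not_mem_expDcl`);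
  - WHAT A REFUTATION MUST DO GIVEN EAC (`not_eac_or_exists_of_not`,
    `not_ecl_subset_logFreeCore_of_not_of_eac`, via the lead's landed `stub_aclSubsetEcl_of_eac`):
    **¬(A) ⇒ ¬EAC ∨ (some pointwise-definable exponentially-algebraic real is not log-free)** — i.e. a
    refutation either kills Zilber's EAC or proves `C₀ ⊄ C_EA`, and no explicit number is provably
    outside `K_ω` (landed `Negative/CoreAutWild` §4: `C₀ ≠ C_EA` is only SC-true).
  - AUTOMORPHISMS AND THE HUB (§13.8): `Aut(ℂ_exp)` fixes `dcl(∅)` pointwise, finite orbits on `acl(∅)`;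
    ONE automorphism moving `ln 2` denies the hub, settles (A)|_{T₂} vacuously and (mod L) proves
    all-branch `log 2 ⊥ log 3` (`allBranchIndep_of_equiv_apply_ne`); a refutation of (A) exhibits a real
    outside `C_EA` fixed by ALL of `Aut(ℂ_exp)` (`exists_fixed_real_not_mem_of_not`) — it would deny
    Zilber-homogeneity, which is why no kill is expected.
  - UNCONDITIONAL VERSION (§13.9, no Baker): for every `S ∈ ℤ[X]`, `{x | e^x = 2 ∧ e^{S(x)} = 3}` is
    FINITE (`finite_polyRelationSet`; Hermite–Lindemann only: `E(T) = S(c+dT) + S(c−dT) − 2 ln 3 ≠ 0`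
    by Taylor/Hasse coefficients at `c = ln 2` — even degree kills the leading coefficient, odd degree
    `≥ 3` makes `ln 2` rational, degree `≤ 1` needs `ln 3 = a ln 2 + b`, killed by HL and `2^p ≠ 3^q`);
    so **(A) ⇒ ln 2 ∈ C_EA ∨ ∀ S ∈ ℤ[X] ∀ j k, S(ln 2 + 2πij) ≠ ln 3 + 2πik** UNCONDITIONALLY
    (`logFree_or_noPolyRelation_of_crux`; open already at `ln 3 = m ln²2 + r`), and **one automorphism of
    `ℂ_exp` moving `ln 2` ⇒ `ln 3 + 2πik ∉ ℤ[ln 2 + 2πij]`** (`noPolyRelation_of_equiv_apply_ne`) — an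
    unconditional symmetry ⇒ transcendence transfer about two logarithms, beyond Baker's linear forms.
  Landing: `Negative/LogTwoHub.lean` (p74942 ACCEPTED) + `Negative/LogTwoBranchRelations.lean` +
  `Negative/LogTwoPolynomialRelations.lean` (gen 4).
  PAPER REMARKS (gen 4, not formalised): (α) the RATIONAL-FUNCTION extension of §13.9 — for `S = P/Q ∈ ℚ(X)`
  with a pole `β` (algebraic), `E = 0` evaluated at `T = (β − c)/d` gives `P(β) Q(2c − β) = 0`, so either
  `P, Q` share the root `β` (excluded in lowest terms) or `2c − β` is a root of `Q`, making `2 ln 2`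
  algebraic — so `{x | e^x = 2 ∧ Q(x) ≠ 0 ∧ e^{P(x)/Q(x)} = 3}` is finite for all `P/Q ∈ ℚ(X)` as well; (β) (A) is NOT forced by the bare axioms "ACF₀ + E a surjective homomorphism with
  kernel `2πiℤ`": by transfinite recursion on a Hamel basis (stage `α < 𝔠` meets `< 𝔠` constraints) there
  is such an `E = exp ∘ f` (`f` a `ℚ`-linear bijection, `f = f₁` on a countable relatively algebraically
  closed `K* ∋ 2πi` of infinite transcendence degree with `exp (f₁ K*) ⊆ K*` and no `E`-fixed point in `K*`)
  having EXACTLY ONE fixed point `z₀ ∉ K* ⊇ EA_E(2πi)`; then `{z₀} = {z | E z = z}` is `∅`-definable and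
  not `E`-log-free — any proof of (A) must use `Complex.exp` beyond these axioms (continuity, or
  SC/EAC/CCP); (γ) under Zilber's conjecture (A) follows from L1 `acl^𝔹(∅) = EA^𝔹(SK)`, itself
  plausible via the thumbtack lemma (finitely many Kummer branches, each realised infinitely often in
  `B₀`) + homogeneity over strong substructures — so an unconditional kill of (A) would refute ZC.

* §14 (gen 5) **THE STANDARD-KERNEL AXIOMS DO NOT FORCE (A)** — formal version of remark (β), by a
  construction with no transfinite bookkeeping (linear algebra over `ℚ` + Nesterenko).  Write `(A)[E]`
  for the crux with `Complex.exp` replaced by an abstract E-ring exponential `E` on the complex FIELD in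
  both of its occurrences (the structure in which `∅`-definability is taken, and the `E`-closure of the
  core); `(A)[Complex.exp]` IS the crux (`aclSubsetCore_complexExp_iff`, `Iff.rfl`).  THEOREM
  (`exists_stdKernelExp_not_aclSubsetCore`, landed `Negative/StandardKernelTwist*.lean`): there is an
  exponential `E = exp ∘ Φ` (`Φ` a `ℚ`-linear automorphism of `ℂ` with `Φ(2πi) = 2πi`, `Φ(e^π) = ln 2`,
  `Φ(e^{2π}) = ln 3`, `Φ(ℚ(π)^{ralg}) ⊆ 𝓛 := {z | e^z ∈ ℚ(π)^{ralg}}`) which is a homomorphism ONTO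
  `ℂ*` with kernel EXACTLY `2πiℤ`, equal to `exp` on `ℚ·2πi` (so `ℤ, ℚ, {±2πi}, π, μ_∞` are `∅`-definable
  in `(ℂ, E)` by the same formulas), and `(A)[E]` is FALSE: the quantifier-free formula
  `E(x) = 2 ∧ E(x·x) = 3` defines `{e^π}` (`twoThreeSet_eq`: solutions are `e^π + 2πik`, and `k ≠ 0`
  would put `e^π` in `ℚ(π)`), while `ℚ(π)^{ralg} ∋ 2πi` is `E`-closed and relatively algebraically
  closed and misses `e^π` (Nesterenko).  In `ℂ_exp` the SAME formula defines `∅`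
  (`twoThreeSet_complexExp_eq_empty`: `ln 2 ∉ ℚ`, `ln² 2 < ln 3`).  Reading: (A) is not a theorem of
  "ACF₀ + surjective exponential with kernel `2πiℤ` (+ standard torsion)"; any proof must use
  `Complex.exp` beyond these axioms — Schanuel-type transcendence (no ACCIDENTAL RELATIONS:
  `E(e^π) = 2, E(e^{2π}) = 3` is one, `td = 1 < 2`), EAC/Zilber axioms, or continuity (`E` is
  discontinuous, re-wired along a Hamel basis).  This is the (A)-level companion of the barrier
  `AxiomsDoNotForceSchanuel`: the standard-kernel axioms force neither SC nor the "symmetry" statement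
  (A), and (A) FAILS precisely through an accidental relation — (A) has arithmetic content, it is not
  "the part of Zilber's picture that does not contain SC" for free.

* §15 (gen 5) **THE KUMMER LADDER** (landed `Negative/KummerLadder.lean`, p80526): rung `n` := the class
  `T₂(n) = {ln 2 + 2πink : k ∈ ℤ}` of branches of `log 2` with index divisible by `n` is `∅`-definable.
  `definable₁_branchClass_iff`: **rung `n` ⟺ `2^{1/n} = e^{(ln 2)/n} ∈ dcl(∅)`**; rungs 1, 2 HOLD (`√2 ∈ dcl`,
  = the refuted branch indiscernibility §7); the hub `ln 2 ∈ dcl(∅)` implies every rung (§13.2); rung 3 ⟺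
  `2^{1/3} ∈ dcl^{ℂ_exp}(∅)` is EXACTLY the open question of Kirby–Macintyre–Onshuus (their conjecture
  `KMOTheoremTwoComplex`, and ZC, say NO for every `n ≥ 3`).  So the definability side of a refutation through
  the hub must climb rung 3 against KMO; conversely a proof that rung 3 fails (KMO₂(ℂ) at `2^{1/3}`) denies the
  hub and settles (A)|_{T₂} (§13.4).  Also: the power map `(z,k) ↦ z^k` on `ℂ* × ℤ` and `μ_∞` are `∅`-definable
  (`definable_zpowGraph`, `definable₁_rootsOfUnity`).

LANDED (importable library, namespace `Summit.Schanuel.Schanuel.Theorems.AclSubsetLogFreeCore.Negative`,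
directory `Summits/Schanuel/Schanuel/Theorems/AclSubsetLogFreeCore/Negative/`): `LogFreeCoreObjects`
(p69952), `ExpAclDefinability` (p70065), `LogFreeCoreCountable` (p70067),
`AclSubsetLogFreeCoreIffReal` (p70131), `BranchParity` (p70560), `ExpAclField` (p70945) — the
sorry-free content of §0–§5, §7, §8 of this workfile (all ACCEPTED); gen 3: `AclIdempotent` (p71506,
§9), `CoreAutConj` (p71586, §11), `CountableVariant` (p71641, §10) — all ACCEPTED — and
`RealDefinableCalibration` (p71852, §12 formal half).  Drefute (gen 2): `CoreAutRigidity` (p72270), `CoreAutWild`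
(rigidity dichotomy for the residue stub).  gen 4 (§13): `LogTwoHub` (p74942 ACCEPTED),
`LogTwoBranchRelations` (p76265 ACCEPTED), `LogTwoPolynomialRelations` (§13.9, p77154 ACCEPTED).  gen 5 (§14):
`StandardKernelTwistLinear` / `StandardKernelTwistBases` / `StandardKernelTwist` (proposed; ids in NOTES).

## Why (A) resists (for the provers)

A counterexample is a pointwise `∅`-definable REAL number outside `C_EA` (§5).  (i) Definability
side: the reals known to be `∅`-definable in `ℂ_exp` are the real-abelian algebraic numbers (KMO 2012
Thm 1) and sign-symmetric `EA`-expressions in `π` — all inside `C_EA`; a definable branch of `log 2`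
or the setwise definability of `ℝ` (Koiran's / KMO's open questions) would be needed, and Zilber's
conjecture `ℂ_exp ≅ 𝔹` forbids both and IMPLIES (A).  (ii) Transcendence side: no specific number
is known to lie outside the countable field `C_EA = K_ω` beyond what Nesterenko gives at stage 0
(`ln 2 ∉ C_EA` is itself ⟸ SC).  Both halves of any refutation are open; conversely every proof
must use finiteness, parameter-freeness and `exp`-closure (§4), i.e. must see the difference
between `ℂ_exp` and `(ℂ_exp, one real parameter)`, where (A) is false.
(iii) gen 3 sharpenings: the admissible parameters are EXACTLY the subsets of `C_EA` (§9), so a proof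
may freely name `π`, `2πi`, `e`, algebraic numbers, but nothing else; finiteness must be used beyond
countability (§10: the countable set of all branches of `log 2` is `∅`-definable, and "countable
definable ⊆ C_EA" is SC-false); and any proof of (A) proves `ℝ` is not `∅`-definable in `ℂ_exp` (§12),
an open problem since 1993 — so (A) cannot be cheap.  (iv) For the registered EAC lines: the residue
`Fix(Aut_E(C₀)) ⊆ C_EA` concerns real elements only (§11); beyond `conj` no automorphism of the
countable core `C₀ = ecl ∅` is known, and producing one that moves `ln 2` is already `π ⊥ ln 2`.
Literature checked this cycle: Wilkie, *Analytic continuation and Zilber's quasiminimality conjecture*,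
Model Theory 3 (2024) 701 (arXiv:2306.14562) — quasiminimality of `ℂ_exp` (hence non-definability of
`ℝ`) is still a STRATEGY; unconditional knowledge: Boxall's countable-or-cocountable for projections
`{w | ∃ z̄, P(w, z̄) = 0}` of exponential-term zero sets (op. cit. "Further remarks").
(v) gen 4: the hub.  Every presently conceivable mechanism against or for (A) passes through
`ln 2 ∈ dcl^{ℂ_exp}(∅)` (§13): `Def_∅(ℝ)` gives it (§12), an accidental algebraic relation between
branches of `log 2` and `log 3` gives it (§13.5, modulo Theorem L), and it gives `2^{1/3} ∈ dcl(∅)`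
(§13.6); (A) converts it into the SC-false `ln 2 ∈ C_EA`.  Affirming the hub is Koiran-hard, denying it
is automorphism-hard (Zilber), and the conclusion `ln 2 ∉ C_EA` is SC-hard: the instance (A)|_{T₂} is
already irrefutable and unprovable.  And a refutation compatible with EAC must prove `C₀ ⊄ C_EA` (§13.7).
Literature checked gen 4 (zbMATH; searchd/OpenAlex/S2/arXiv degraded): Kirby, Fund. Math. 232 (2016) 79
(arXiv:1407.1068: `ℚ` not ∀-definable in `𝔹` — nothing for `ℂ_exp`); Gallinaro–Kirby, Forum Math.
Sigma 12 (2024) e123 (quasiminimality of complex POWERS, not of `exp`); Kirby, Selecta 25 (2019)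
(blurred exp quasiminimal); EAC progress: Gallinaro Selecta 29 (2023), Aslanyan–Kirby–Mantova IMRN 2023,
Aslanyan–Gallinaro arXiv:2409.12860 (2024 survey), Capuano JLMS 113 (2026) — none proves EAC for `ℂ`,
none defines a non-EA real in `ℂ_exp`, none constructs an automorphism of `ℂ_exp` or of `ecl ∅` beyond
`conj` (Nathanson arXiv:2209.01027 remains the only entry).  Verdict unchanged: NOT refuted, irrefutable today.
(vi) gen 5: the algebraic skeleton of `ℂ_exp` visible in (A) — field `ℂ`, `E` a surjective character
with kernel `2πiℤ`, standard torsion — admits a model `(ℂ, E)` in which (A) FAILS (§14), the failure being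
caused by an accidental relation `E(e^π) = 2, E(e^{2π}) = 3`.  So a proof of (A) must invoke an axiom that
excludes accidental relations at least between the two points `x, x²` of one `E`-orbit pattern — in
`ℂ_exp` this is exactly the unconditional finiteness/emptiness of `{x | e^x = 2 ∧ e^{x²} = 3}` (§13.9,
§14 `twoThreeSet_complexExp_eq_empty`), i.e. Hermite–Lindemann-level input; the general pattern behind
(A) is "no finite accidental configuration is isolated by the kernel", which is SC-flavoured, not
symmetry-flavoured.  Verdict unchanged: NOT refuted.
-/

noncomputable section

set_option linter.dupNamespace false

open FirstOrder FirstOrder.Language Set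
open Literature.ModelTheory.ExponentialFields

namespace Summit.Schanuel.Schanuel.Cruxes.AclSubsetLogFreeCore.Disproof

/-! ## §0 The objects of the crux, named -/

/-- The family whose infimum is the log-free core: relatively algebraically closed, `exp`-closed
intermediate fields of `ℂ/ℚ` containing `2πi` (verbatim the crux's set-builder). -/
def coreFamily : Set (IntermediateField ℚ ℂ) :=
  {K | (2 * ↑Real.pi * Complex.I : ℂ) ∈ K ∧ (∀ w ∈ K, Complex.exp w ∈ K) ∧
    ∀ w : ℂ, IsAlgebraic K w → w ∈ K}

/-- The log-free core `C_EA` (verbatim the crux's `sInf`). -/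
def logFreeCore : IntermediateField ℚ ℂ := sInf coreFamily

/-- `acl^{ℂ_exp}(∅)`: union of the finite `∅`-definable subsets of `(ℂ, +, ·, −, 0, 1, exp)`
(verbatim the crux's hypothesis). -/
def expAcl : Set ℂ :=
  {a | ∃ s : Set ℂ, s.Finite ∧ Set.Definable₁ (∅ : Set ℂ) Language.expRing s ∧ a ∈ s}

/-- `dcl^{ℂ_exp}(∅)`: the pointwise `∅`-definable complex numbers. -/
def expDcl : Set ℂ := {a | Set.Definable₁ (∅ : Set ℂ) Language.expRing ({a} : Set ℂ)}

/-- The crux is literally `expAcl ⊆ logFreeCore`. -/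
theorem crux_iff :
    Summit.Schanuel.Schanuel.Theses.RigidCore.AclSubsetLogFreeCore ↔
      expAcl ⊆ (logFreeCore : Set ℂ) := Iff.rfl

theorem expDcl_subset_expAcl : expDcl ⊆ expAcl :=
  fun a ha => ⟨{a}, Set.finite_singleton a, ha, rfl⟩

theorem mem_logFreeCore_iff {x : ℂ} : x ∈ logFreeCore ↔ ∀ K ∈ coreFamily, x ∈ K :=
  IntermediateField.mem_sInf

/-- `⊤ = ℂ` is a member of the family (so the `sInf` is a genuine intersection). -/
theorem top_mem_coreFamily : (⊤ : IntermediateField ℚ ℂ) ∈ coreFamily :=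
  ⟨trivial, fun _ _ => trivial, fun _ _ => trivial⟩

/-- Algebraicity passes up along `F ≤ E` (no instance gymnastics: map the polynomial). -/
theorem isAlgebraic_of_le {F E : IntermediateField ℚ ℂ} (h : F ≤ E) {w : ℂ}
    (hw : IsAlgebraic F w) : IsAlgebraic E w := by
  obtain ⟨p, hp0, hpw⟩ := hw
  refine ⟨p.map (IntermediateField.inclusion h).toRingHom, ?_, ?_⟩
  · exact (Polynomial.map_ne_zero_iff (IntermediateField.inclusion h).injective).2 hp0
  · rw [Polynomial.aeval_def, Polynomial.eval₂_map]
    rw [Polynomial.aeval_def] at hpw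
    have hcomp : (algebraMap E ℂ).comp (IntermediateField.inclusion h).toRingHom =
        algebraMap F ℂ := by
      ext x; rfl
    rw [hcomp]; exact hpw

/-- The core is itself a member of the family (the three conditions are intersection-stable). -/
theorem logFreeCore_mem_coreFamily : logFreeCore ∈ coreFamily := by
  refine ⟨mem_logFreeCore_iff.2 fun K hK => hK.1, fun w hw => ?_, fun w hw => ?_⟩
  · exact mem_logFreeCore_iff.2 fun K hK => hK.2.1 w (mem_logFreeCore_iff.1 hw K hK)
  · exact mem_logFreeCore_iff.2 fun K hK => hK.2.2 w (isAlgebraic_of_le (sInf_le hK) hw)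

theorem logFreeCore_le_of_mem {K : IntermediateField ℚ ℂ} (hK : K ∈ coreFamily) :
    logFreeCore ≤ K := sInf_le hK

/-! ## §1 A kit for `∅`-definability in `ℂ_exp` -/

section Kit

variable {α β : Type*} {A : Set ℂ}

@[simp] theorem expRing_exp_apply (x : ℂ) : (ExponentialRing.exp x : ℂ) = Complex.exp x := rfl

/-- Re-indexing the arguments of a definable function keeps it definable (no finiteness needed). -/
theorem definableFun_reindex {g : (α → ℂ) → ℂ} (hg : A.DefinableFun Language.expRing g)
    (ι : α → β) : A.DefinableFun Language.expRing (fun w : β → ℂ => g (w ∘ ι)) := by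
  have h := hg.preimage_comp (Option.map ι)
  unfold Set.DefinableFun
  convert h using 1
  ext v
  simp only [Function.tupleGraph, mem_setOf_eq, mem_preimage]
  exact Iff.rfl

theorem definableFun_cexp {g : (α → ℂ) → ℂ} (hg : A.DefinableFun Language.expRing g) :
    A.DefinableFun Language.expRing (fun v => Complex.exp (g v)) := by
  have h := ((Set.DefinableFun.fun_symbol (L := Language.expRing) (M := ℂ)
    (expRingFunc.exp : Language.expRing.Functions 1)).of_empty (A := A)).comp
    (g := fun v (_ : Fin 1) => g v) (fun _ => hg)
  simpa using h

theorem definableFun_add' {g h : (α → ℂ) → ℂ} (hg : A.DefinableFun Language.expRing g)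
    (hh : A.DefinableFun Language.expRing h) :
    A.DefinableFun Language.expRing (fun v => g v + h v) := by
  have hF : A.DefinableMap Language.expRing (fun v => ![g v, h v]) := by
    intro i; fin_cases i <;> simpa
  have := ((Set.DefinableFun.fun_symbol (L := Language.expRing) (M := ℂ)
    (expRingFunc.add : Language.expRing.Functions 2)).of_empty (A := A)).comp hF
  simpa using this

theorem definableFun_mul' {g h : (α → ℂ) → ℂ} (hg : A.DefinableFun Language.expRing g)
    (hh : A.DefinableFun Language.expRing h) :
    A.DefinableFun Language.expRing (fun v => g v * h v) := by
  have hF : A.DefinableMap Language.expRing (fun v => ![g v, h v]) := by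
    intro i; fin_cases i <;> simpa
  have := ((Set.DefinableFun.fun_symbol (L := Language.expRing) (M := ℂ)
    (expRingFunc.mul : Language.expRing.Functions 2)).of_empty (A := A)).comp hF
  simpa using this

theorem definableFun_neg' {g : (α → ℂ) → ℂ} (hg : A.DefinableFun Language.expRing g) :
    A.DefinableFun Language.expRing (fun v => -g v) := by
  have h := ((Set.DefinableFun.fun_symbol (L := Language.expRing) (M := ℂ)
    (expRingFunc.neg : Language.expRing.Functions 1)).of_empty (A := A)).comp
    (g := fun v (_ : Fin 1) => g v) (fun _ => hg)
  simpa using h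

theorem definableFun_zero' : A.DefinableFun Language.expRing (fun _ : α → ℂ => (0 : ℂ)) := by
  have h := ((Set.DefinableFun.fun_symbol (L := Language.expRing) (M := ℂ)
    (expRingFunc.zero : Language.expRing.Functions 0)).of_empty (A := A)).comp
    (g := fun (_ : α → ℂ) (i : Fin 0) => (i.elim0 : ℂ)) (fun i => i.elim0)
  simpa using h

theorem definableFun_one' : A.DefinableFun Language.expRing (fun _ : α → ℂ => (1 : ℂ)) := by
  have h := ((Set.DefinableFun.fun_symbol (L := Language.expRing) (M := ℂ)
    (expRingFunc.one : Language.expRing.Functions 0)).of_empty (A := A)).comp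
    (g := fun (_ : α → ℂ) (i : Fin 0) => (i.elim0 : ℂ)) (fun i => i.elim0)
  simpa using h

theorem definableFun_natCast' (n : ℕ) :
    A.DefinableFun Language.expRing (fun _ : α → ℂ => (n : ℂ)) := by
  induction n with
  | zero => simpa using (definableFun_zero' (A := A) (α := α))
  | succ n ih => simpa [Nat.cast_succ] using definableFun_add' ih definableFun_one'

theorem definableFun_intCast' (n : ℤ) :
    A.DefinableFun Language.expRing (fun _ : α → ℂ => (n : ℂ)) := by
  cases n with
  | ofNat n => simpa using (definableFun_natCast' (A := A) (α := α) n)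
  | negSucc n =>
    simpa [Int.cast_negSucc] using definableFun_neg' (definableFun_natCast' (A := A) (α := α) (n + 1))

/-- Atom `g v ∈ s` for an `A`-definable set `s ⊆ ℂ` and an `A`-definable function `g`. -/
theorem definable_mem_of_definable₁ {s : Set ℂ} (hs : A.Definable₁ Language.expRing s)
    {g : (α → ℂ) → ℂ} (hg : A.DefinableFun Language.expRing g) :
    A.Definable Language.expRing {v : α → ℂ | g v ∈ s} := by
  have hF : A.DefinableMap Language.expRing (fun v (_ : Fin 1) => g v) := fun _ => hg
  exact hs.preimage_map hF

/-! ### `ℤ`, the kernel generators `±2πi`, `π`, `e`, `e^π` -/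

/-- KMO's parameter-free definition of `ℤ` in an exponential field with standard kernel:
`m ∈ ℤ ⟺ ∀ z (e^z = 1 → e^{mz} = 1)`. -/
def IsIntC (m : ℂ) : Prop := ∀ z : ℂ, Complex.exp z = 1 → Complex.exp (m * z) = 1

theorem two_pi_I_ne_zero' : (2 * ↑Real.pi * Complex.I : ℂ) ≠ 0 := by
  simp [Real.pi_ne_zero, Complex.I_ne_zero]

theorem isIntC_iff {m : ℂ} : IsIntC m ↔ ∃ n : ℤ, m = n := by
  constructor
  · intro h
    have h1 := h (2 * Real.pi * Complex.I) Complex.exp_two_pi_mul_I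
    obtain ⟨n, hn⟩ := Complex.exp_eq_one_iff.1 h1
    exact ⟨n, mul_right_cancel₀ two_pi_I_ne_zero' hn⟩
  · rintro ⟨n, rfl⟩ z hz
    obtain ⟨k, rfl⟩ := Complex.exp_eq_one_iff.1 hz
    have : (n : ℂ) * (k * (2 * Real.pi * Complex.I)) =
        ((n * k : ℤ) : ℂ) * (2 * Real.pi * Complex.I) := by
      push_cast; ring
    rw [this]
    exact Complex.exp_int_mul_two_pi_mul_I (n * k)

theorem definable_isIntC {g : (α → ℂ) → ℂ} (hg : A.DefinableFun Language.expRing g) :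
    A.Definable Language.expRing {v : α → ℂ | IsIntC (g v)} := by
  unfold IsIntC
  refine definable_setOf_forall_params (definable_setOf_imp_params ?_ ?_)
  · exact definable_setOf_eq_params (definableFun_cexp (definableFun_proj_params _))
      definableFun_one'
  · exact definable_setOf_eq_params
      (definableFun_cexp (definableFun_mul' (definableFun_reindex hg Sum.inl)
        (definableFun_proj_params _))) definableFun_one'

/-- `t` generates the kernel: `e^t = 1 ∧ ∀ w (e^w = 1 → ∃ m ∈ ℤ, w = m t)`. -/
def IsKerGen (t : ℂ) : Prop :=
  Complex.exp t = 1 ∧ ∀ w : ℂ, Complex.exp w = 1 → ∃ m : ℂ, IsIntC m ∧ w = m * t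

theorem isKerGen_iff {t : ℂ} :
    IsKerGen t ↔ t = 2 * Real.pi * Complex.I ∨ t = -(2 * Real.pi * Complex.I) := by
  constructor
  · rintro ⟨ht, h⟩
    obtain ⟨n, rfl⟩ := Complex.exp_eq_one_iff.1 ht
    obtain ⟨m, hm, hmt⟩ := h (2 * Real.pi * Complex.I) Complex.exp_two_pi_mul_I
    obtain ⟨k, rfl⟩ := isIntC_iff.1 hm
    have hk : ((k * n : ℤ) : ℂ) = 1 := by
      have h2 : (1 - (k : ℂ) * n) * (2 * Real.pi * Complex.I) = 0 := by
        linear_combination hmt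
      rcases mul_eq_zero.1 h2 with h2 | h2
      · push_cast; linear_combination -h2
      · exact absurd h2 two_pi_I_ne_zero'
    have hk' : k * n = 1 := by exact_mod_cast hk
    rcases Int.eq_one_or_neg_one_of_mul_eq_one' hk' with ⟨-, rfl⟩ | ⟨-, rfl⟩
    · left; simp
    · right; simp
  · rintro (rfl | rfl)
    · refine ⟨Complex.exp_two_pi_mul_I, fun w hw => ?_⟩
      obtain ⟨k, rfl⟩ := Complex.exp_eq_one_iff.1 hw
      exact ⟨k, isIntC_iff.2 ⟨k, rfl⟩, rfl⟩
    · refine ⟨?_, fun w hw => ?_⟩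
      · rw [Complex.exp_neg]; simp [Complex.exp_two_pi_mul_I]
      obtain ⟨k, rfl⟩ := Complex.exp_eq_one_iff.1 hw
      exact ⟨-k, by simpa using isIntC_iff.2 ⟨-k, rfl⟩, by ring⟩

theorem definable_isKerGen {g : (α → ℂ) → ℂ} (hg : A.DefinableFun Language.expRing g) :
    A.Definable Language.expRing {v : α → ℂ | IsKerGen (g v)} := by
  unfold IsKerGen
  refine definable_setOf_and_params ?_ ?_
  · exact definable_setOf_eq_params (definableFun_cexp hg) definableFun_one'
  · refine definable_setOf_forall_params (definable_setOf_imp_params ?_ ?_)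
    · exact definable_setOf_eq_params (definableFun_cexp (definableFun_proj_params _))
        definableFun_one'
    · refine definable_setOf_exists_params (definable_setOf_and_params ?_ ?_)
      · exact definable_isIntC (definableFun_proj_params _)
      · exact definable_setOf_eq_params (definableFun_proj_params _)
          (definableFun_mul' (definableFun_proj_params _)
            (definableFun_reindex hg (Sum.inl ∘ Sum.inl)))

/-- `ℤ ⊆ ℂ` is `∅`-definable in `ℂ_exp` (so `ℂ_exp` is not minimal: an infinite, co-infinite
`∅`-definable set). -/
theorem definable₁_int :
    Set.Definable₁ (∅ : Set ℂ) Language.expRing (Set.range (Int.cast : ℤ → ℂ)) := by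
  have h := definable_isIntC (A := (∅ : Set ℂ)) (definableFun_proj_params (α := Fin 1) 0)
  have e : {x : Fin 1 → ℂ | x 0 ∈ Set.range (Int.cast : ℤ → ℂ)} = {v | IsIntC (v 0)} := by
    ext v; simp [isIntC_iff, eq_comm]
  unfold Set.Definable₁; rw [e]; exact h

/-- `{2πi, −2πi}` is a finite `∅`-definable set. -/
theorem definable₁_kerGens :
    Set.Definable₁ (∅ : Set ℂ) Language.expRing
      ({2 * ↑Real.pi * Complex.I, -(2 * ↑Real.pi * Complex.I)} : Set ℂ) := by
  have h := definable_isKerGen (A := (∅ : Set ℂ)) (definableFun_proj_params (α := Fin 1) 0)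
  have e : {x : Fin 1 → ℂ | x 0 ∈ ({2 * ↑Real.pi * Complex.I, -(2 * ↑Real.pi * Complex.I)} :
      Set ℂ)} = {v | IsKerGen (v 0)} := by
    ext v; simp [isKerGen_iff]
  unfold Set.Definable₁; rw [e]; exact h

theorem two_pi_I_mem_expAcl : (2 * ↑Real.pi * Complex.I : ℂ) ∈ expAcl :=
  ⟨_, (Set.finite_singleton _).insert _, definable₁_kerGens, by simp⟩

/-- KMO §2.5: `π` is POINTWISE `∅`-definable: `x = π ⟺ ∃ t (t generates the kernel ∧
∃ s (4s = t ∧ 2 e^s x = t))` (the sign ambiguities of `t = ±2πi` and `e^{t/4} = ±i` cancel). -/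
def PiFormula (x : ℂ) : Prop :=
  ∃ t : ℂ, IsKerGen t ∧ ∃ s : ℂ, s + s + s + s = t ∧ Complex.exp s * x + Complex.exp s * x = t

theorem exp_pi_div_two_I : Complex.exp (↑(Real.pi / 2) * Complex.I) = Complex.I := by
  rw [Complex.exp_mul_I, ← Complex.ofReal_cos, ← Complex.ofReal_sin]
  simp

theorem exp_neg_pi_div_two_I : Complex.exp (-(↑(Real.pi / 2) * Complex.I)) = -Complex.I := by
  rw [Complex.exp_neg, exp_pi_div_two_I]; simp [Complex.inv_I]

theorem piFormula_iff {x : ℂ} : PiFormula x ↔ x = Real.pi := by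
  constructor
  · rintro ⟨t, ht, s, hs, hx⟩
    rcases isKerGen_iff.1 ht with rfl | rfl
    · have hs' : s = ↑(Real.pi / 2) * Complex.I := by
        push_cast; linear_combination hs / 4
      subst hs'
      rw [exp_pi_div_two_I] at hx
      have : Complex.I * (2 * x - 2 * Real.pi) = 0 := by linear_combination hx
      rcases mul_eq_zero.1 this with h | h
      · exact absurd h Complex.I_ne_zero
      · linear_combination h / 2
    · have hs' : s = -(↑(Real.pi / 2) * Complex.I) := by
        push_cast; linear_combination hs / 4
      subst hs'
      rw [exp_neg_pi_div_two_I] at hx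
      have : Complex.I * (2 * Real.pi - 2 * x) = 0 := by linear_combination hx
      rcases mul_eq_zero.1 this with h | h
      · exact absurd h Complex.I_ne_zero
      · linear_combination -h / 2
  · rintro rfl
    refine ⟨2 * Real.pi * Complex.I, isKerGen_iff.2 (Or.inl rfl), ↑(Real.pi / 2) * Complex.I,
      by push_cast; ring, ?_⟩
    rw [exp_pi_div_two_I]; ring

theorem definable_piFormula {g : (α → ℂ) → ℂ} (hg : A.DefinableFun Language.expRing g) :
    A.Definable Language.expRing {v : α → ℂ | PiFormula (g v)} := by
  unfold PiFormula
  refine definable_setOf_exists_params (definable_setOf_and_params ?_ ?_)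
  · exact definable_isKerGen (definableFun_proj_params _)
  · refine definable_setOf_exists_params (definable_setOf_and_params ?_ ?_)
    · exact definable_setOf_eq_params
        (definableFun_add' (definableFun_add' (definableFun_add' (definableFun_proj_params _)
          (definableFun_proj_params _)) (definableFun_proj_params _))
          (definableFun_proj_params _))
        (definableFun_proj_params _)
    · exact definable_setOf_eq_params
        (definableFun_add'
          (definableFun_mul' (definableFun_cexp (definableFun_proj_params _))
            (definableFun_reindex hg (Sum.inl ∘ Sum.inl)))
          (definableFun_mul' (definableFun_cexp (definableFun_proj_params _))
            (definableFun_reindex hg (Sum.inl ∘ Sum.inl))))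
        (definableFun_proj_params _)

/-- `π ∈ dcl^{ℂ_exp}(∅)`. -/
theorem pi_mem_expDcl : (Real.pi : ℂ) ∈ expDcl := by
  have h := definable_piFormula (A := (∅ : Set ℂ)) (definableFun_proj_params (α := Fin 1) 0)
  have e : {x : Fin 1 → ℂ | x 0 ∈ ({(Real.pi : ℂ)} : Set ℂ)} = {v | PiFormula (v 0)} := by
    ext v; simp [piFormula_iff]
  show Set.Definable₁ _ _ _
  unfold Set.Definable₁; rw [e]; exact h

/-- `e^π ∈ dcl^{ℂ_exp}(∅)` (`x = e^π ⟺ ∃ y (y = π ∧ x = e^y)`). -/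
theorem exp_pi_mem_expDcl : Complex.exp Real.pi ∈ expDcl := by
  have h : (∅ : Set ℂ).Definable Language.expRing
      {v : Fin 1 → ℂ | ∃ y, PiFormula y ∧ v 0 = Complex.exp y} := by
    refine definable_setOf_exists_params (definable_setOf_and_params ?_ ?_)
    · exact definable_piFormula (definableFun_proj_params _)
    · exact definable_setOf_eq_params (definableFun_proj_params _)
        (definableFun_cexp (definableFun_proj_params _))
  have e : {x : Fin 1 → ℂ | x 0 ∈ ({Complex.exp Real.pi} : Set ℂ)} =
      {v : Fin 1 → ℂ | ∃ y, PiFormula y ∧ v 0 = Complex.exp y} := by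
    ext v; simp [piFormula_iff]
  show Set.Definable₁ _ _ _
  unfold Set.Definable₁; rw [e]; exact h

/-- `e ∈ dcl^{ℂ_exp}(∅)` by the quantifier-free formula `x = exp 1`. -/
theorem e_mem_expDcl : Complex.exp 1 ∈ expDcl := by
  have h : (∅ : Set ℂ).Definable Language.expRing {v : Fin 1 → ℂ | v 0 = Complex.exp 1} :=
    definable_setOf_eq_params (definableFun_proj_params _) (definableFun_cexp definableFun_one')
  have e : {x : Fin 1 → ℂ | x 0 ∈ ({Complex.exp 1} : Set ℂ)} =
      {v : Fin 1 → ℂ | v 0 = Complex.exp 1} := by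
    ext v; simp
  show Set.Definable₁ _ _ _
  unfold Set.Definable₁; rw [e]; exact h

theorem pi_mem_expAcl : (Real.pi : ℂ) ∈ expAcl := expDcl_subset_expAcl pi_mem_expDcl
theorem exp_pi_mem_expAcl : Complex.exp Real.pi ∈ expAcl := expDcl_subset_expAcl exp_pi_mem_expDcl
theorem e_mem_expAcl : Complex.exp 1 ∈ expAcl := expDcl_subset_expAcl e_mem_expDcl

end Kit

/-! ## §2 Members of the family built from relative algebraic closures; Nesterenko -/

/-- The relative algebraic closure of an intermediate field `F` inside `ℂ`, as an intermediate
field over `ℚ`. -/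
def relAlg (F : IntermediateField ℚ ℂ) : IntermediateField ℚ ℂ :=
  (algebraicClosure F ℂ).restrictScalars ℚ

theorem mem_relAlg_iff {F : IntermediateField ℚ ℂ} {x : ℂ} : x ∈ relAlg F ↔ IsAlgebraic F x := by
  simp [relAlg, IntermediateField.mem_restrictScalars, mem_algebraicClosure_iff]

theorem le_relAlg (F : IntermediateField ℚ ℂ) : F ≤ relAlg F :=
  fun x hx => mem_relAlg_iff.2 (isAlgebraic_algebraMap (⟨x, hx⟩ : F))

/-- `relAlg F` is relatively algebraically closed in `ℂ`. -/
theorem relAlg_closed (F : IntermediateField ℚ ℂ) :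
    ∀ w : ℂ, IsAlgebraic (relAlg F) w → w ∈ relAlg F := by
  intro w hw
  rw [mem_relAlg_iff]
  have hw' : IsAlgebraic (algebraicClosure F ℂ) w := hw
  exact (isIntegral_trans w hw'.isIntegral).isAlgebraic

theorem I_isAlgebraic : IsAlgebraic ℚ Complex.I := by
  refine ⟨Polynomial.X ^ 2 + 1, ?_, by simp⟩
  exact (Polynomial.monic_X_pow_add_C (1 : ℚ) two_ne_zero).ne_zero

/-- The relative algebraic closure of `ℚ(π)`: contains `2πi`, is relatively algebraically closed,
is NOT `exp`-closed — and misses `e^π` by Nesterenko. -/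
def Kpi : IntermediateField ℚ ℂ := relAlg (IntermediateField.adjoin ℚ {(Real.pi : ℂ)})

theorem pi_mem_Kpi : (Real.pi : ℂ) ∈ Kpi :=
  le_relAlg _ (IntermediateField.mem_adjoin_simple_self ℚ _)

theorem two_pi_I_mem_Kpi : (2 * ↑Real.pi * Complex.I : ℂ) ∈ Kpi := by
  refine mul_mem (mul_mem ?_ pi_mem_Kpi) ?_
  · have h2 := Kpi.algebraMap_mem (2 : ℚ)
    simp only [map_ofNat] at h2
    exact h2
  · exact mem_relAlg_iff.2
      (I_isAlgebraic.tower_top (L := IntermediateField.adjoin ℚ {(Real.pi : ℂ)}))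

/-- Nesterenko 1996 (tree theorem `nesterenko_holds`: `π, e^π, Γ(1/4)` algebraically independent)
restricted to `π, e^π` and pushed into `ℂ`. -/
theorem algebraicIndependent_pi_exp_pi :
    AlgebraicIndependent ℚ ![(Real.pi : ℂ), Complex.exp Real.pi] := by
  have h3 : AlgebraicIndependent ℚ ![Real.pi, Real.exp Real.pi, Real.Gamma (1 / 4)] :=
    Literature.NumberTheory.Transcendental.nesterenko_holds
  have h2 : AlgebraicIndependent ℚ ![Real.pi, Real.exp Real.pi] := by
    have := h3.comp Fin.castSucc (Fin.castSucc_injective 2)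
    convert this using 1
    ext i; fin_cases i <;> rfl
  have hf : Function.Injective ((Complex.ofRealHom).toRatAlgHom) := fun a b h =>
    Complex.ofReal_injective (by simpa using h)
  have hmap := h2.map' (f := (Complex.ofRealHom).toRatAlgHom) hf
  convert hmap using 1
  ext i; fin_cases i <;> simp [Complex.ofReal_exp]

theorem exp_pi_not_isAlgebraic_adjoin_pi :
    ¬ IsAlgebraic (IntermediateField.adjoin ℚ {(Real.pi : ℂ)}) (Complex.exp Real.pi) := by
  rw [IntermediateField.isAlgebraic_adjoin_iff]
  have h := algebraicIndependent_pi_exp_pi.transcendental_adjoin (s := {0}) (i := 1) (by simp)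
  have hs : ((![(Real.pi : ℂ), Complex.exp Real.pi]) '' ({0} : Set (Fin 2))) = {(Real.pi : ℂ)} := by
    simp
  rw [hs] at h
  simpa [Transcendental] using h

theorem exp_pi_not_mem_Kpi : Complex.exp Real.pi ∉ Kpi := by
  rw [Kpi, mem_relAlg_iff]; exact exp_pi_not_isAlgebraic_adjoin_pi


/-! ## §3 The core is the least member of an explicit countable tower: `C_EA` is countable -/

/-- Stage `0` = relative algebraic closure of `ℚ(2πi)`; stage `n+1` = relative algebraic closure
of `ℚ(Kₙ ∪ exp Kₙ)`. -/
def stage : ℕ → IntermediateField ℚ ℂ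
  | 0 => relAlg (IntermediateField.adjoin ℚ {(2 * ↑Real.pi * Complex.I : ℂ)})
  | n + 1 => relAlg (IntermediateField.adjoin ℚ ((stage n : Set ℂ) ∪ Complex.exp '' (stage n)))

theorem stage_le_succ (n : ℕ) : stage n ≤ stage (n + 1) := fun _ hx =>
  le_relAlg _ (IntermediateField.subset_adjoin ℚ _ (Or.inl hx))

theorem monotone_stage : Monotone stage := monotone_nat_of_le_succ stage_le_succ

theorem exp_mem_stage_succ {n : ℕ} {x : ℂ} (hx : x ∈ stage n) :
    Complex.exp x ∈ stage (n + 1) :=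
  le_relAlg _ (IntermediateField.subset_adjoin ℚ _ (Or.inr ⟨x, hx, rfl⟩))

theorem stage_closed (n : ℕ) : ∀ w : ℂ, IsAlgebraic (stage n) w → w ∈ stage n := by
  cases n with
  | zero => exact relAlg_closed _
  | succ n => exact relAlg_closed _

theorem two_pi_I_mem_stage_zero : (2 * ↑Real.pi * Complex.I : ℂ) ∈ stage 0 :=
  le_relAlg _ (IntermediateField.mem_adjoin_simple_self ℚ _)

/-- `K_ω := ⋃ₙ Kₙ`. -/
def Komega : IntermediateField ℚ ℂ := ⨆ n, stage n

theorem coe_Komega : (Komega : Set ℂ) = ⋃ n, (stage n : Set ℂ) :=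
  IntermediateField.coe_iSup_of_directed monotone_stage.directed_le

theorem mem_Komega_iff {x : ℂ} : x ∈ Komega ↔ ∃ n, x ∈ stage n := by
  have h := Set.ext_iff.1 coe_Komega x
  simpa using h

theorem stage_le_Komega (n : ℕ) : stage n ≤ Komega := fun _ hx => mem_Komega_iff.2 ⟨n, hx⟩

/-- `K_ω` is relatively algebraically closed: a polynomial over `K_ω` has its finitely many
coefficients in one stage. -/
theorem Komega_closed : ∀ w : ℂ, IsAlgebraic Komega w → w ∈ Komega := by
  intro w hw
  obtain ⟨p, hp0, hpw⟩ := hw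
  have hc : ∀ j, ∃ n, ((p.coeff j : Komega) : ℂ) ∈ stage n := fun j =>
    mem_Komega_iff.1 (p.coeff j).2
  choose nf hnf using hc
  set N := p.support.sup nf with hN
  have hcoeff : ∀ j, ((p.coeff j : Komega) : ℂ) ∈ stage N := by
    intro j
    by_cases hj : j ∈ p.support
    · exact monotone_stage (Finset.le_sup hj) (hnf j)
    · have : p.coeff j = 0 := by simpa [Polynomial.mem_support_iff] using hj
      rw [this]; exact zero_mem _
  -- the polynomial, pushed to `ℂ`, lifts to `stage N`
  set p' : Polynomial ℂ := p.map (algebraMap Komega ℂ) with hp'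
  have hlift : p' ∈ Polynomial.lifts (algebraMap (stage N) ℂ) := by
    rw [Polynomial.lifts_iff_coeff_lifts]
    intro j
    rw [hp', Polynomial.coeff_map]
    exact ⟨⟨_, hcoeff j⟩, rfl⟩
  obtain ⟨q, hqmap, hqdeg⟩ := Polynomial.exists_degree_eq_of_mem_lifts hlift
  have hp'0 : p' ≠ 0 := by
    rw [hp']
    exact (Polynomial.map_ne_zero_iff (FaithfulSMul.algebraMap_injective Komega ℂ)).2 hp0
  have hq0 : q ≠ 0 := by
    intro h
    rw [h, Polynomial.degree_zero] at hqdeg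
    exact hp'0 (Polynomial.degree_eq_bot.1 hqdeg.symm)
  have hqw : Polynomial.aeval w q = 0 := by
    rw [Polynomial.aeval_def, ← Polynomial.eval_map, hqmap, hp', Polynomial.eval_map,
      ← Polynomial.aeval_def]
    exact hpw
  exact stage_le_Komega N (stage_closed N w ⟨q, hq0, hqw⟩)

/-- `K_ω` is a member of the family. -/
theorem Komega_mem_coreFamily : Komega ∈ coreFamily :=
  ⟨stage_le_Komega 0 two_pi_I_mem_stage_zero,
    fun w hw => by
      obtain ⟨n, hn⟩ := mem_Komega_iff.1 hw
      exact stage_le_Komega (n + 1) (exp_mem_stage_succ hn),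
    Komega_closed⟩

theorem logFreeCore_le_Komega : logFreeCore ≤ Komega := logFreeCore_le_of_mem Komega_mem_coreFamily

/-- Conversely every stage lies in every member of the family, so `C_EA = K_ω` (the core has an
explicit construction by stages; induction on stages is available to provers). -/
theorem stage_le_of_mem {K : IntermediateField ℚ ℂ} (hK : K ∈ coreFamily) (n : ℕ) : stage n ≤ K := by
  induction n with
  | zero =>
    intro x hx
    have hx' : IsAlgebraic (IntermediateField.adjoin ℚ {(2 * ↑Real.pi * Complex.I : ℂ)}) x :=
      mem_relAlg_iff.1 hx
    refine hK.2.2 x (isAlgebraic_of_le ?_ hx')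
    exact IntermediateField.adjoin_le_iff.2 (Set.singleton_subset_iff.2 hK.1)
  | succ n ih =>
    intro x hx
    have hx' : IsAlgebraic
        (IntermediateField.adjoin ℚ ((stage n : Set ℂ) ∪ Complex.exp '' (stage n))) x :=
      mem_relAlg_iff.1 hx
    refine hK.2.2 x (isAlgebraic_of_le ?_ hx')
    refine IntermediateField.adjoin_le_iff.2 (Set.union_subset ih ?_)
    rintro _ ⟨y, hy, rfl⟩
    exact hK.2.1 y (ih hy)

theorem Komega_le_of_mem {K : IntermediateField ℚ ℂ} (hK : K ∈ coreFamily) : Komega ≤ K :=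
  fun x hx => by
    obtain ⟨n, hn⟩ := mem_Komega_iff.1 hx
    exact stage_le_of_mem hK n hn

theorem logFreeCore_eq_Komega : logFreeCore = Komega :=
  le_antisymm logFreeCore_le_Komega (le_sInf fun _ hK => Komega_le_of_mem hK)

theorem mem_logFreeCore_iff_exists_stage {x : ℂ} : x ∈ logFreeCore ↔ ∃ n, x ∈ stage n := by
  rw [logFreeCore_eq_Komega, mem_Komega_iff]

/-! ### Countability -/

theorem countable_adjoin {S : Set ℂ} (hS : S.Countable) :
    ((IntermediateField.adjoin ℚ S : IntermediateField ℚ ℂ) : Set ℂ).Countable := by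
  have h := IntermediateField.lift_cardinalMk_adjoin_le ℚ S
  simp only [Cardinal.lift_id, Cardinal.mkRat] at h
  have hS' : Cardinal.mk S ≤ Cardinal.aleph0 := Cardinal.mk_le_aleph0_iff.2 hS.to_subtype
  have : Cardinal.mk (IntermediateField.adjoin ℚ S) ≤ Cardinal.aleph0 := by
    refine h.trans ?_
    simp [hS']
  exact Set.countable_coe_iff.1 (Cardinal.mk_le_aleph0_iff.1 this)

theorem countable_relAlg {F : IntermediateField ℚ ℂ} (hF : (F : Set ℂ).Countable) :
    (relAlg F : Set ℂ).Countable := by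
  have hF' : Cardinal.mk F ≤ Cardinal.aleph0 := Cardinal.mk_le_aleph0_iff.2 hF.to_subtype
  have h := Algebra.IsAlgebraic.cardinalMk_le_max F (algebraicClosure F ℂ)
  have : Cardinal.mk (algebraicClosure F ℂ) ≤ Cardinal.aleph0 := h.trans (by simp [hF'])
  have hc : ((algebraicClosure F ℂ : IntermediateField F ℂ) : Set ℂ).Countable :=
    Set.countable_coe_iff.1 (Cardinal.mk_le_aleph0_iff.1 this)
  exact hc

theorem countable_stage (n : ℕ) : (stage n : Set ℂ).Countable := by
  induction n with
  | zero => exact countable_relAlg (countable_adjoin (Set.countable_singleton _))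
  | succ n ih => exact countable_relAlg (countable_adjoin (ih.union (ih.image _)))

theorem countable_Komega : (Komega : Set ℂ).Countable := by
  rw [coe_Komega]; exact Set.countable_iUnion countable_stage

/-- **The log-free core is countable.** -/
theorem countable_logFreeCore : (logFreeCore : Set ℂ).Countable :=
  countable_Komega.mono logFreeCore_le_Komega

theorem not_countable_univ_complex : ¬ (Set.univ : Set ℂ).Countable := fun h => by
  have h1 := Cardinal.mk_le_aleph0_iff.2 (Set.countable_univ_iff.1 h)
  rw [Cardinal.mk_complex] at h1
  exact Cardinal.aleph0_lt_continuum.not_ge h1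

/-- Hence most complex numbers are outside the core … -/
theorem exists_not_mem_logFreeCore : ∃ a : ℂ, a ∉ logFreeCore := by
  by_contra! h
  exact not_countable_univ_complex (countable_logFreeCore.mono fun a _ => h a)

/-- … and so are most REAL numbers. -/
theorem exists_real_not_mem_logFreeCore : ∃ r : ℝ, (r : ℂ) ∉ logFreeCore := by
  by_contra! h
  have himg : ((fun r : ℝ => (r : ℂ)) '' Set.univ).Countable :=
    countable_logFreeCore.mono (by rintro _ ⟨r, -, rfl⟩; exact h r)
  have huniv : (Set.univ : Set ℝ).Countable :=
    Set.countable_of_injective_of_countable_image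
      (fun a _ b _ hab => Complex.ofReal_injective hab) himg
  exact Cardinal.not_countable_real huniv

/-! ## §4 Load-bearing hypotheses of (A), as theorems -/

/-- (A) with the FINITENESS of the definable set dropped. -/
def WithoutFinite : Prop :=
  ∀ a : ℂ, (∃ s : Set ℂ, Set.Definable₁ (∅ : Set ℂ) Language.expRing s ∧ a ∈ s) → a ∈ logFreeCore

/-- Any proof of (A) must use finiteness: `ℂ` itself is `∅`-definable and `C_EA` is countable. -/
theorem not_withoutFinite : ¬ WithoutFinite := by
  obtain ⟨a, ha⟩ := exists_not_mem_logFreeCore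
  intro h
  refine ha (h a ⟨Set.univ, ?_, Set.mem_univ a⟩)
  show (∅ : Set ℂ).Definable Language.expRing _
  simp

/-- (A) with PARAMETERS from `P ⊆ ℂ` allowed in the defining formulas. -/
def WithParams (P : Set ℂ) : Prop :=
  ∀ a : ℂ, (∃ s : Set ℂ, s.Finite ∧ Set.Definable₁ P Language.expRing s ∧ a ∈ s) → a ∈ logFreeCore

/-- With parameters from `P` the statement says at least `P ⊆ C_EA` (singletons `{p}` are
`P`-definable) … -/
theorem subset_of_withParams {P : Set ℂ} (h : WithParams P) : P ⊆ logFreeCore := fun p hp =>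
  h p ⟨{p}, Set.finite_singleton p, Set.Definable.singleton_of_mem Language.expRing hp, rfl⟩

/-- … so parameters from all of `ℂ` break it, -/
theorem not_withParams_univ : ¬ WithParams Set.univ := fun h => by
  obtain ⟨a, ha⟩ := exists_not_mem_logFreeCore
  exact ha (subset_of_withParams h (Set.mem_univ a))

/-- real parameters break it, -/
theorem not_withParams_real : ¬ WithParams (Set.range ((↑) : ℝ → ℂ)) := fun h => by
  obtain ⟨r, hr⟩ := exists_real_not_mem_logFreeCore
  exact hr (subset_of_withParams h ⟨r, rfl⟩)

/-- and already ONE (real) parameter breaks it: parameter-freeness is load-bearing. -/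
theorem exists_not_withParams_singleton : ∃ r : ℝ, ¬ WithParams {(r : ℂ)} := by
  obtain ⟨r, hr⟩ := exists_real_not_mem_logFreeCore
  exact ⟨r, fun h => hr (subset_of_withParams h rfl)⟩

/-- The family with `exp`-CLOSURE dropped: relatively algebraically closed fields containing `2πi`. -/
def coreFamilyNoExp : Set (IntermediateField ℚ ℂ) :=
  {K | (2 * ↑Real.pi * Complex.I : ℂ) ∈ K ∧ ∀ w : ℂ, IsAlgebraic K w → w ∈ K}

/-- (A) with `exp`-closure of the core dropped (core replaced by `ℚ(2πi)^{ralg} = ℚ(π)^{ralg}`). -/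
def WithoutExpClosed : Prop := ∀ a : ℂ, a ∈ expAcl → a ∈ sInf coreFamilyNoExp

theorem Kpi_mem_coreFamilyNoExp : Kpi ∈ coreFamilyNoExp := ⟨two_pi_I_mem_Kpi, relAlg_closed _⟩

/-- **Any proof of (A) must use the `exp`-closure of `C_EA`** (Nesterenko): `e^π ∈ dcl(∅)` but
`e^π ∉ ℚ(π)^{ralg} ∋ 2πi`. -/
theorem not_withoutExpClosed : ¬ WithoutExpClosed := fun h => by
  have h1 := IntermediateField.mem_sInf.1 (h _ exp_pi_mem_expAcl) Kpi Kpi_mem_coreFamilyNoExp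
  exact exp_pi_not_mem_Kpi h1

/-- (A) with BOTH transcendental inputs of the core dropped (no `2πi`, no `exp`): the core becomes
`ℚ̄ ∩ ℂ`, i.e. "acl(∅) consists of algebraic numbers" (true in the pure field `(ℂ, +, ·)`). -/
def WithoutPeriodAndExp : Prop := ∀ a : ℂ, a ∈ expAcl → IsAlgebraic ℚ a

/-- Refuted by `e = exp 1 ∈ dcl(∅)` (quantifier-free!) and Hermite (tree `transcendental_exp_one_holds`). -/
theorem not_withoutPeriodAndExp : ¬ WithoutPeriodAndExp := fun h =>
  Literature.NumberTheory.Transcendental.transcendental_rat_cexp_one (h _ e_mem_expAcl)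


/-! ## §5 Conjugation; (A) is a statement about `∅`-definable REAL numbers -/

/-- Complex conjugation is an automorphism of the `L_exp`-structure `ℂ` (the only non-trivial one
presently known). -/
def conjLEquiv : Language.expRing.Equiv ℂ ℂ where
  toFun := starRingEnd ℂ
  invFun := starRingEnd ℂ
  left_inv := Complex.conj_conj
  right_inv := Complex.conj_conj
  map_fun' := fun {n} f x => by
    cases f
    · simp
    · simp
    · simp
    · simp
    · simp
    · simp [Complex.exp_conj]
  map_rel' := fun {n} r x => by cases r

@[simp] theorem conjLEquiv_apply (z : ℂ) : conjLEquiv z = (starRingEnd ℂ) z := rfl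

/-- `∅`-definable sets (of tuples) are stable under conjugation. -/
theorem conj_comp_mem_of_definable {α : Type*} {s : Set (α → ℂ)}
    (hs : (∅ : Set ℂ).Definable Language.expRing s) {v : α → ℂ} (hv : v ∈ s) :
    (starRingEnd ℂ) ∘ v ∈ s := by
  obtain ⟨φ, rfl⟩ := Set.empty_definable_iff.1 hs
  have h := FirstOrder.Language.StrongHomClass.realize_formula conjLEquiv φ (v := v)
  exact h.2 hv

theorem conj_mem_of_definable₁ {s : Set ℂ} (hs : Set.Definable₁ (∅ : Set ℂ) Language.expRing s)
    {a : ℂ} (ha : a ∈ s) : (starRingEnd ℂ) a ∈ s :=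
  conj_comp_mem_of_definable hs (v := fun _ : Fin 1 => a) ha

theorem conj_mem_expAcl {a : ℂ} (ha : a ∈ expAcl) : (starRingEnd ℂ) a ∈ expAcl := by
  obtain ⟨s, hs, hdef, has⟩ := ha
  exact ⟨s, hs, hdef, conj_mem_of_definable₁ hdef has⟩

/-- Pointwise `∅`-definable numbers are fixed by conjugation, -/
theorem conj_eq_of_mem_expDcl {a : ℂ} (ha : a ∈ expDcl) : (starRingEnd ℂ) a = a :=
  conj_mem_of_definable₁ ha rfl

/-- i.e. `dcl^{ℂ_exp}(∅) ⊆ ℝ`. -/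
theorem expDcl_subset_range_ofReal : expDcl ⊆ Set.range ((↑) : ℝ → ℂ) := fun _ ha =>
  Complex.conj_eq_iff_real.1 (conj_eq_of_mem_expDcl ha) |>.imp fun _ h => h.symm

/-! ### Symmetric functions: `acl(∅)` is algebraic over `dcl(∅)` with `∅`-DEFINABLE coefficients -/

/-- Polynomial maps with integer coefficients are `∅`-definable functions. -/
theorem definableFun_mvPolynomial_aeval {n : ℕ} (Q : MvPolynomial (Fin n) ℤ) :
    (∅ : Set ℂ).DefinableFun Language.expRing (fun x : Fin n → ℂ => MvPolynomial.aeval x Q) := by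
  induction Q using MvPolynomial.induction_on with
  | C a => simpa using definableFun_intCast' (A := (∅ : Set ℂ)) (α := Fin n) a
  | add p q hp hq => simpa using definableFun_add' hp hq
  | mul_X p i hp => simpa using definableFun_mul' hp (definableFun_proj_params i)

/-- The universal root polynomial `∏ᵢ (X − xᵢ)` over `ℤ[x₀,…,x_{n−1}]`. -/
def univRootPoly (n : ℕ) : Polynomial (MvPolynomial (Fin n) ℤ) :=
  ∏ i, (Polynomial.X - Polynomial.C (MvPolynomial.X i))

theorem map_univRootPoly {n : ℕ} (x : Fin n → ℂ) :
    (univRootPoly n).map (MvPolynomial.aeval x).toRingHom =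
      ∏ i, (Polynomial.X - Polynomial.C (x i)) := by
  simp [univRootPoly, Polynomial.map_prod]

theorem coeff_rootPoly_eq_aeval {n : ℕ} (x : Fin n → ℂ) (j : ℕ) :
    (∏ i, (Polynomial.X - Polynomial.C (x i))).coeff j =
      MvPolynomial.aeval x ((univRootPoly n).coeff j) := by
  rw [← map_univRootPoly, Polynomial.coeff_map]; rfl

theorem definableFun_coeff_rootPoly (n j : ℕ) :
    (∅ : Set ℂ).DefinableFun Language.expRing
      (fun x : Fin n → ℂ => (∏ i, (Polynomial.X - Polynomial.C (x i))).coeff j) := by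
  simp_rw [coeff_rootPoly_eq_aeval]; exact definableFun_mvPolynomial_aeval _

/-- For an `∅`-definable `s`, the set of `j`-th coefficients of `∏ (X − xᵢ)` over injective
`n`-tuples from `s` is `∅`-definable. -/
theorem definable₁_coeffSet {s : Set ℂ} (hs : Set.Definable₁ (∅ : Set ℂ) Language.expRing s)
    (n j : ℕ) :
    Set.Definable₁ (∅ : Set ℂ) Language.expRing
      {c : ℂ | ∃ x : Fin n → ℂ, Function.Injective x ∧ (∀ i, x i ∈ s) ∧
        c = (∏ i, (Polynomial.X - Polynomial.C (x i))).coeff j} := by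
  set S : Set (Fin 1 ⊕ Fin n → ℂ) :=
    {w | Function.Injective (fun i => w (Sum.inr i)) ∧ (∀ i, w (Sum.inr i) ∈ s) ∧
      w (Sum.inl 0) = (∏ i, (Polynomial.X - Polynomial.C (w (Sum.inr i)))).coeff j} with hSdef
  have hS : (∅ : Set ℂ).Definable Language.expRing S := by
    refine definable_setOf_and_params ?_ (definable_setOf_and_params ?_ ?_)
    · have : {w : Fin 1 ⊕ Fin n → ℂ | Function.Injective (fun i => w (Sum.inr i))} =
          ⋂ i, ⋂ k, {w | w (Sum.inr i) = w (Sum.inr k) → i = k} := by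
        ext w; simp [Function.Injective, Set.mem_iInter]
      rw [this]
      refine Set.definable_iInter_of_finite fun i => Set.definable_iInter_of_finite fun k => ?_
      refine definable_setOf_imp_params (definable_setOf_eq_params (definableFun_proj_params _)
        (definableFun_proj_params _)) ?_
      by_cases hik : i = k <;> simp [hik]
    · have : {w : Fin 1 ⊕ Fin n → ℂ | ∀ i, w (Sum.inr i) ∈ s} = ⋂ i, {w | w (Sum.inr i) ∈ s} := by
        ext w; simp
      rw [this]
      exact Set.definable_iInter_of_finite fun i =>
        definable_mem_of_definable₁ hs (definableFun_proj_params _)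
    · exact definable_setOf_eq_params (definableFun_proj_params _)
        (definableFun_reindex (definableFun_coeff_rootPoly n j) Sum.inr)
  have h := hS.exists_of_finite
  unfold Set.Definable₁
  convert h using 1
  ext v
  simp only [hSdef, Set.mem_setOf_eq, Sum.elim_inr, Sum.elim_inl]

theorem prod_X_sub_C_eq_of_injective {s : Set ℂ} (hs : s.Finite) {x : Fin hs.toFinset.card → ℂ}
    (hx : Function.Injective x) (hxs : ∀ i, x i ∈ s) :
    ∏ i, (Polynomial.X - Polynomial.C (x i)) =
      ∏ y ∈ hs.toFinset, (Polynomial.X - Polynomial.C y) := by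
  have himg : Finset.univ.image x = hs.toFinset := by
    apply Finset.eq_of_subset_of_card_le
    · intro y hy
      obtain ⟨i, -, rfl⟩ := Finset.mem_image.1 hy
      exact hs.mem_toFinset.2 (hxs i)
    · rw [Finset.card_image_of_injective _ hx]; simp
  calc ∏ i, (Polynomial.X - Polynomial.C (x i))
      = ∏ y ∈ Finset.univ.image x, (Polynomial.X - Polynomial.C y) := by
        rw [Finset.prod_image fun i _ k _ h => hx h]
    _ = ∏ y ∈ hs.toFinset, (Polynomial.X - Polynomial.C y) := by rw [himg]

/-- **The coefficients of the root polynomial of a finite `∅`-definable set are `∅`-definable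
points** (elementary symmetric functions, Marker Ex. 1.4.10-type folklore). -/
theorem coeff_mem_expDcl {s : Set ℂ} (hs : s.Finite)
    (hdef : Set.Definable₁ (∅ : Set ℂ) Language.expRing s) (j : ℕ) :
    (∏ y ∈ hs.toFinset, (Polynomial.X - Polynomial.C y)).coeff j ∈ expDcl := by
  have hD := definable₁_coeffSet hdef hs.toFinset.card j
  have hinj : Function.Injective
      (fun i : Fin hs.toFinset.card => ((hs.toFinset.equivFin.symm i : hs.toFinset) : ℂ)) :=
    Subtype.val_injective.comp (Equiv.injective _)
  have hmem : ∀ i : Fin hs.toFinset.card,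
      ((hs.toFinset.equivFin.symm i : hs.toFinset) : ℂ) ∈ s :=
    fun i => hs.mem_toFinset.1 (hs.toFinset.equivFin.symm i).2
  have heq : {c : ℂ | ∃ x : Fin hs.toFinset.card → ℂ, Function.Injective x ∧ (∀ i, x i ∈ s) ∧
      c = (∏ i, (Polynomial.X - Polynomial.C (x i))).coeff j} =
      {(∏ y ∈ hs.toFinset, (Polynomial.X - Polynomial.C y)).coeff j} := by
    ext c
    simp only [Set.mem_setOf_eq, Set.mem_singleton_iff]
    constructor
    · rintro ⟨x, hx, hxs, rfl⟩
      rw [prod_X_sub_C_eq_of_injective hs hx hxs]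
    · rintro rfl
      exact ⟨_, hinj, hmem, by rw [prod_X_sub_C_eq_of_injective hs hinj hmem]⟩
  show Set.Definable₁ _ _ _
  rw [← heq]; exact hD

/-- **Reduction of (A) to `dcl`**: if every pointwise `∅`-definable number lies in `C_EA`, so
does every element of a finite `∅`-definable set (it is a root of a monic polynomial whose
coefficients are `∅`-definable points, and `C_EA` is relatively algebraically closed). -/
theorem expAcl_subset_of_expDcl_subset (h : expDcl ⊆ (logFreeCore : Set ℂ)) :
    expAcl ⊆ (logFreeCore : Set ℂ) := by
  rintro a ⟨s, hs, hdef, ha⟩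
  set p : Polynomial ℂ := ∏ y ∈ hs.toFinset, (Polynomial.X - Polynomial.C y) with hp
  have hmonic : p.Monic :=
    Polynomial.monic_prod_of_monic _ _ fun y _ => Polynomial.monic_X_sub_C y
  have hpa : p.eval a = 0 := by
    rw [hp, Polynomial.eval_prod]
    exact Finset.prod_eq_zero (hs.mem_toFinset.2 ha) (by simp)
  have hcoef : ∀ j, p.coeff j ∈ logFreeCore := fun j => h (coeff_mem_expDcl hs hdef j)
  have hlift : p ∈ Polynomial.lifts (algebraMap logFreeCore ℂ) := by
    rw [Polynomial.lifts_iff_coeff_lifts]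
    intro j
    exact ⟨⟨_, hcoef j⟩, rfl⟩
  obtain ⟨q, hqmap, -, hqmonic⟩ := Polynomial.lifts_and_degree_eq_and_monic hlift hmonic
  have hqa : Polynomial.aeval a q = 0 := by
    rw [Polynomial.aeval_def, ← Polynomial.eval_map, hqmap]; exact hpa
  exact logFreeCore_mem_coreFamily.2.2 a ⟨q, hqmonic.ne_zero, hqa⟩

/-- **(A) ⟺ `dcl^{ℂ_exp}(∅) ⊆ C_EA`.** -/
theorem crux_iff_expDcl :
    Summit.Schanuel.Schanuel.Theses.RigidCore.AclSubsetLogFreeCore ↔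
      expDcl ⊆ (logFreeCore : Set ℂ) :=
  ⟨fun h => expDcl_subset_expAcl.trans h, expAcl_subset_of_expDcl_subset⟩

/-- **(A) ⟺ every `∅`-definable REAL number of `ℂ_exp` lies in `C_EA`.** The crux is a
statement about the countable set `dcl^{ℂ_exp}(∅) ⊆ ℝ` of pointwise-definable reals. -/
theorem crux_iff_real :
    Summit.Schanuel.Schanuel.Theses.RigidCore.AclSubsetLogFreeCore ↔
      ∀ r : ℝ, (r : ℂ) ∈ expDcl → (r : ℂ) ∈ logFreeCore := by
  rw [crux_iff_expDcl]
  constructor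
  · exact fun h r hr => h hr
  · intro h a ha
    obtain ⟨r, rfl⟩ := expDcl_subset_range_ofReal ha
    exact h r ha

/-- The symbol set of `L_exp` is countable (six function symbols, no relations). -/
instance countable_expRing_symbols : Countable Language.expRing.Symbols := by
  unfold FirstOrder.Language.Symbols
  infer_instance

/-- `acl(∅)` is countable too (countably many formulas, each contributing one finite set): no
counting argument can separate the two sides of (A). -/
theorem countable_expAcl : expAcl.Countable := by
  let T : Language.expRing.Formula (Fin 1) → Set ℂ := fun φ =>
    {b | ∃ s : Set ℂ, s.Finite ∧ {x : Fin 1 → ℂ | x 0 ∈ s} = setOf φ.Realize ∧ b ∈ s}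
  have hsub : expAcl ⊆ ⋃ φ, T φ := by
    rintro a ⟨s, hs, hdef, ha⟩
    obtain ⟨φ, hφ⟩ := Set.empty_definable_iff.1 hdef
    exact Set.mem_iUnion.2 ⟨φ, s, hs, hφ, ha⟩
  have hT : ∀ φ, (T φ).Countable := by
    intro φ
    by_cases hex : ∃ s : Set ℂ, s.Finite ∧ {x : Fin 1 → ℂ | x 0 ∈ s} = setOf φ.Realize
    · obtain ⟨s, hs, hseq⟩ := hex
      refine hs.countable.mono ?_
      rintro b ⟨s', -, hs'eq, hb⟩
      have hb' : (fun _ : Fin 1 => b) ∈ {x : Fin 1 → ℂ | x 0 ∈ s'} := hb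
      rw [hs'eq, ← hseq] at hb'
      exact hb'
    · refine Set.countable_empty.mono ?_
      rintro b ⟨s', hs', hs'eq, -⟩
      exact (hex ⟨s', hs', hs'eq⟩).elim
  exact (Set.countable_iUnion hT).mono hsub

/-! ### The core is `conj`-stable; the core is NOT pointwise definable -/

/-- Conjugation as a `ℚ`-algebra endomorphism of `ℂ`. -/
def conjQ : ℂ →ₐ[ℚ] ℂ := (starRingEnd ℂ).toRatAlgHom

@[simp] theorem conjQ_apply (z : ℂ) : conjQ z = (starRingEnd ℂ) z := rfl

/-- The conjugate of a member of the family is a member of the family. -/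
theorem map_conjQ_mem_coreFamily {K : IntermediateField ℚ ℂ} (hK : K ∈ coreFamily) :
    K.map conjQ ∈ coreFamily := by
  refine ⟨?_, ?_, ?_⟩
  · refine (IntermediateField.mem_map _).2 ⟨-(2 * ↑Real.pi * Complex.I), neg_mem hK.1, ?_⟩
    simp [Complex.conj_ofReal, map_ofNat]
  · rintro w hw
    obtain ⟨k, hk, rfl⟩ := (IntermediateField.mem_map _).1 hw
    exact (IntermediateField.mem_map _).2 ⟨Complex.exp k, hK.2.1 k hk, by simp [← Complex.exp_conj]⟩
  · intro w hw
    obtain ⟨p, hp0, hpw⟩ := hw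
    set p₁ : Polynomial ℂ := p.map (algebraMap (K.map conjQ) ℂ) with hp₁
    set p' : Polynomial ℂ := p₁.map (starRingEnd ℂ) with hp'
    have hlift : p' ∈ Polynomial.lifts (algebraMap K ℂ) := by
      rw [Polynomial.lifts_iff_coeff_lifts]
      intro j
      rw [hp', Polynomial.coeff_map, hp₁, Polynomial.coeff_map]
      obtain ⟨k, hk, hkeq⟩ := (IntermediateField.mem_map _).1 (p.coeff j).2
      refine ⟨⟨k, hk⟩, ?_⟩
      have : ((p.coeff j : K.map conjQ) : ℂ) = (starRingEnd ℂ) k := by rw [← hkeq]; rfl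
      change (k : ℂ) = (starRingEnd ℂ) ((p.coeff j : K.map conjQ) : ℂ)
      rw [this, Complex.conj_conj]
    obtain ⟨q, hqmap, hqdeg⟩ := Polynomial.exists_degree_eq_of_mem_lifts hlift
    have hp'0 : p' ≠ 0 := by
      rw [hp']
      refine (Polynomial.map_ne_zero_iff (starRingEnd ℂ).injective).2 ?_
      rw [hp₁]
      exact (Polynomial.map_ne_zero_iff (FaithfulSMul.algebraMap_injective _ _)).2 hp0
    have hq0 : q ≠ 0 := by
      rintro rfl
      rw [Polynomial.degree_zero] at hqdeg
      exact hp'0 (Polynomial.degree_eq_bot.1 hqdeg.symm)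
    have hqw : Polynomial.aeval ((starRingEnd ℂ) w) q = 0 := by
      rw [Polynomial.aeval_def, ← Polynomial.eval_map, hqmap, hp', Polynomial.eval_map,
        Polynomial.eval₂_hom, hp₁, Polynomial.eval_map, ← Polynomial.aeval_def, hpw, map_zero]
    have hmem : (starRingEnd ℂ) w ∈ K := hK.2.2 _ ⟨q, hq0, hqw⟩
    exact (IntermediateField.mem_map _).2 ⟨_, hmem, by simp⟩

/-- **`C_EA` is `conj`-stable** — the whole presently known automorphism group of `ℂ_exp` fixes
both sides of (A) setwise. -/
theorem conj_mem_logFreeCore {a : ℂ} (ha : a ∈ logFreeCore) : (starRingEnd ℂ) a ∈ logFreeCore := by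
  refine mem_logFreeCore_iff.2 fun K hK => ?_
  have h := mem_logFreeCore_iff.1 ha (K.map conjQ) (map_conjQ_mem_coreFamily hK)
  obtain ⟨k, hk, hka⟩ := (IntermediateField.mem_map _).1 h
  rw [← hka]
  simpa using hk

theorem two_pi_I_mem_logFreeCore : (2 * ↑Real.pi * Complex.I : ℂ) ∈ logFreeCore :=
  logFreeCore_mem_coreFamily.1

/-- `2πi` is NOT pointwise `∅`-definable (it is not real), although `{±2πi}` is `∅`-definable. -/
theorem two_pi_I_not_mem_expDcl : (2 * ↑Real.pi * Complex.I : ℂ) ∉ expDcl := fun h => by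
  obtain ⟨r, hr⟩ := expDcl_subset_range_ofReal h
  have := congrArg Complex.im hr
  simp [Real.pi_ne_zero] at this

/-- REFUTED MISREADING of the route's slogan: the core is NOT made of pointwise-definable numbers
(`C_EA ⊄ dcl(∅)`); only `C_EA ⊆ acl(∅)` (support item 0972) can hold. -/
theorem not_logFreeCore_subset_expDcl : ¬ ((logFreeCore : Set ℂ) ⊆ expDcl) := fun h =>
  two_pi_I_not_mem_expDcl (h two_pi_I_mem_logFreeCore)

/-! ## §6 Near-misses (OPEN both ways) — recorded as `sorry`d statements with the obstruction -/

/-- (A) with the PERIOD dropped from the core: core replaced by the `EA`-closure `E₀` of `ℚ`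
(smallest `exp`-closed relatively algebraically closed subfield). -/
def WithoutPeriod : Prop :=
  ∀ a : ℂ, a ∈ expAcl →
    a ∈ sInf {K : IntermediateField ℚ ℂ | (∀ w ∈ K, Complex.exp w ∈ K) ∧
      ∀ w : ℂ, IsAlgebraic K w → w ∈ K}

/-- NEAR-MISS. Refuting `WithoutPeriod` needs an element of `acl(∅)` provably outside `E₀`; the
candidates `π, 2πi ∈ acl(∅)` would need `π ∉ E₀ ∋ e, e^e, e^{√2}, …`, i.e. at least that `π` is
not algebraic over `ℚ(e)` — OPEN (a consequence of Schanuel's conjecture; Kirby 2010 / FPEF §9: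
under SC the free EA-field on `∅` embeds onto `E₀` with trivial kernel). Conversely nothing proves
`WithoutPeriod`. So whether the period `2πi` is load-bearing in (A) is itself open. -/
theorem not_withoutPeriod : ¬ WithoutPeriod := by
  sorry

/-- (A) with RELATIVE ALGEBRAIC CLOSEDNESS dropped: core replaced by the `E`-closure of `ℚ(2πi)`
(smallest `exp`-closed subfield containing `2πi`; it contains `ℚ^{ab}` by Kronecker–Weber since
`e^{2πi/n} ∈` it). -/
def WithoutRelAlgClosed : Prop :=
  ∀ a : ℂ, a ∈ expAcl →
    a ∈ sInf {K : IntermediateField ℚ ℂ | (2 * ↑Real.pi * Complex.I : ℂ) ∈ K ∧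
      ∀ w ∈ K, Complex.exp w ∈ K}

/-- NEAR-MISS. `acl(∅) ⊇ ℚ̄` (roots of integer polynomials are finite `∅`-definable sets), so a
refutation needs an algebraic number provably outside the `E`-closure `E(2πi)` of `ℚ(2πi)`, e.g.
`2^{1/3} ∉ ℚ(2πi, e, e^{−4π²}, e^{1/(2πi)}, e^e, …)`: already the first stage contains `e^{π²}`-type
numbers whose transcendence is OPEN (four-exponentials territory). True under SC (then
`E(2πi) ∩ ℚ̄ = ℚ^{ab}`), unprovable today. -/
theorem not_withoutRelAlgClosed : ¬ WithoutRelAlgClosed := by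
  sorry

/-- NEAR-MISS (the crux itself). A refutation of (A) needs `a ∈ dcl^{ℂ_exp}(∅) ∩ ℝ`
(`crux_iff_real`) with `a ∉ C_EA`, and BOTH halves are open: (i) no real number outside
`ℚ^{abℝ} ∪ {EA-expressions in π that are sign-symmetric}` is known to be `∅`-definable in `ℂ_exp`
(a definable branch of `log 2`, or `ℝ` setwise definable — Koiran/KMO's open questions — would
be needed; Zilber's conjecture forbids it and implies (A)); (ii) no specific real number is known
to lie outside the countable field `C_EA = K_ω` (`logFreeCore_eq_Komega`) except by the very
transcendence statements (A) is meant to feed (`ln 2 ∉ C_EA` ⟸ SC). The only unconditional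
separation tools — cardinality (§3, §5 `countable_expAcl`) and the automorphism `conj` (§5) —
fix both sides. -/
theorem not_crux : ¬ Summit.Schanuel.Schanuel.Theses.RigidCore.AclSubsetLogFreeCore := by
  sorry

/-- What a refutation must produce, exactly (sorry-free): a pointwise `∅`-definable REAL number
outside the countable field `K_ω`. -/
theorem not_crux_iff :
    ¬ Summit.Schanuel.Schanuel.Theses.RigidCore.AclSubsetLogFreeCore ↔
      ∃ r : ℝ, (r : ℂ) ∈ expDcl ∧ ∀ n, (r : ℂ) ∉ stage n := by
  rw [crux_iff_real]
  push Not
  simp only [mem_logFreeCore_iff_exists_stage, not_exists]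


/-! ## §7 A refuted natural strengthening: `∅`-indiscernibility of the branches of `log 2` -/

section Parity

variable {α : Type*} {A : Set ℂ}

/-- `√2` is pointwise `∅`-definable (KMO's Kummer trick): `y = e^u + e^{-u}` with `8u` a kernel
generator (`u = ±πi/4`). -/
def sqrtTwoSet : Set ℂ :=
  {y | ∃ t : ℂ, IsKerGen t ∧ ∃ u : ℂ,
    ((u + u) + (u + u)) + ((u + u) + (u + u)) = t ∧ y = Complex.exp u + Complex.exp (-u)}

theorem exp_add_exp_neg_pi_div_four (u : ℂ) (hu : u = ↑(Real.pi / 4) * Complex.I ∨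
    u = -(↑(Real.pi / 4) * Complex.I)) :
    Complex.exp u + Complex.exp (-u) = (Real.sqrt 2 : ℂ) := by
  have key : Complex.exp (↑(Real.pi / 4) * Complex.I) + Complex.exp (-(↑(Real.pi / 4) * Complex.I)) =
      (Real.sqrt 2 : ℂ) := by
    have h := Complex.two_cos (↑(Real.pi / 4) : ℂ)
    rw [neg_mul] at h
    rw [← h, ← Complex.ofReal_cos, Real.cos_pi_div_four]
    push_cast; ring
  rcases hu with rfl | rfl
  · exact key
  · rw [neg_neg, add_comm]; exact key

theorem mem_sqrtTwoSet_iff {y : ℂ} : y ∈ sqrtTwoSet ↔ y = (Real.sqrt 2 : ℂ) := by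
  constructor
  · rintro ⟨t, ht, u, hu, rfl⟩
    refine exp_add_exp_neg_pi_div_four u ?_
    rcases isKerGen_iff.1 ht with rfl | rfl
    · left; push_cast; linear_combination hu / 8
    · right; push_cast; linear_combination hu / 8
  · rintro rfl
    refine ⟨2 * Real.pi * Complex.I, isKerGen_iff.2 (Or.inl rfl), ↑(Real.pi / 4) * Complex.I,
      by push_cast; ring, (exp_add_exp_neg_pi_div_four _ (Or.inl rfl)).symm⟩

theorem definable_sqrtTwoSet {g : (α → ℂ) → ℂ} (hg : A.DefinableFun Language.expRing g) :
    A.Definable Language.expRing {v : α → ℂ | g v ∈ sqrtTwoSet} := by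
  simp only [sqrtTwoSet, Set.mem_setOf_eq]
  refine definable_setOf_exists_params (definable_setOf_and_params ?_ ?_)
  · exact definable_isKerGen (definableFun_proj_params _)
  · refine definable_setOf_exists_params (definable_setOf_and_params ?_ ?_)
    · have hu : A.DefinableFun Language.expRing
          (fun w : (α ⊕ Unit) ⊕ Unit → ℂ => w (Sum.inr ())) := definableFun_proj_params _
      have h2 := definableFun_add' hu hu
      have h4 := definableFun_add' h2 h2
      exact definable_setOf_eq_params (definableFun_add' h4 h4) (definableFun_proj_params _)
    · exact definable_setOf_eq_params (definableFun_reindex hg (Sum.inl ∘ Sum.inl))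
        (definableFun_add' (definableFun_cexp (definableFun_proj_params _))
          (definableFun_cexp (definableFun_neg' (definableFun_proj_params _))))

/-- The **branch-parity set**: `e^z = 2 ∧ ∃ w (2w = z ∧ e^w = √2)` — an `∅`-definable subset of
the branches `{ln 2 + 2πik}` containing exactly the EVEN ones. -/
def branchParitySet : Set ℂ :=
  {z | Complex.exp z = 2 ∧ ∃ w : ℂ, w + w = z ∧ ∃ y : ℂ, y ∈ sqrtTwoSet ∧ Complex.exp w = y}

theorem definable₁_branchParitySet :
    Set.Definable₁ (∅ : Set ℂ) Language.expRing branchParitySet := by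
  unfold Set.Definable₁
  simp only [branchParitySet, Set.mem_setOf_eq]
  have h2 : (∅ : Set ℂ).DefinableFun Language.expRing (fun _ : Fin 1 → ℂ => (2 : ℂ)) := by
    simpa using definableFun_natCast' (A := (∅ : Set ℂ)) (α := Fin 1) 2
  refine definable_setOf_and_params ?_ ?_
  · exact definable_setOf_eq_params (definableFun_cexp (definableFun_proj_params _)) h2
  · refine definable_setOf_exists_params (definable_setOf_and_params ?_ ?_)
    · exact definable_setOf_eq_params (definableFun_add' (definableFun_proj_params _)
        (definableFun_proj_params _)) (definableFun_proj_params _)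
    · refine definable_setOf_exists_params (definable_setOf_and_params ?_ ?_)
      · exact definable_sqrtTwoSet (definableFun_proj_params _)
      · exact definable_setOf_eq_params (definableFun_cexp (definableFun_proj_params _))
          (definableFun_proj_params _)

theorem exp_log_two : Complex.exp (Real.log 2 : ℂ) = 2 := by
  rw [← Complex.ofReal_exp, Real.exp_log two_pos]; norm_num

theorem exp_half_log_two : Complex.exp ((Real.log 2 : ℂ) / 2) = (Real.sqrt 2 : ℂ) := by
  have : ((Real.log 2 : ℂ) / 2) = ((Real.log 2 / 2 : ℝ) : ℂ) := by push_cast; ring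
  rw [this, ← Complex.ofReal_exp, ← Real.log_sqrt (by norm_num : (0 : ℝ) ≤ 2),
    Real.exp_log (Real.sqrt_pos.2 two_pos)]

/-- The principal branch is in the parity set … -/
theorem log_two_mem_branchParitySet : (Real.log 2 : ℂ) ∈ branchParitySet :=
  ⟨exp_log_two, (Real.log 2 : ℂ) / 2, by ring, _, mem_sqrtTwoSet_iff.2 rfl, exp_half_log_two⟩

/-- … the next branch is not (`e^{(ln 2)/2 + πi} = −√2`). -/
theorem log_two_add_two_pi_I_not_mem_branchParitySet :
    (Real.log 2 : ℂ) + 2 * Real.pi * Complex.I ∉ branchParitySet := by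
  rintro ⟨-, w, hw, y, hy, hwy⟩
  rw [mem_sqrtTwoSet_iff.1 hy] at hwy
  have hw' : w = (Real.log 2 : ℂ) / 2 + Real.pi * Complex.I := by linear_combination hw / 2
  rw [hw', Complex.exp_add, exp_half_log_two, Complex.exp_pi_mul_I] at hwy
  have h0 : (Real.sqrt 2 : ℂ) = 0 := by linear_combination -hwy / 2
  have : Real.sqrt 2 = 0 := by exact_mod_cast h0
  simp at this

/-- "ℂ_exp does not know which logarithm is real", read as **`∅`-indiscernibility of the branches
of `log 2`** (every `∅`-definable set contains all branches of `log 2` or none). -/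
def BranchIndiscernibility : Prop :=
  ∀ s : Set ℂ, Set.Definable₁ (∅ : Set ℂ) Language.expRing s →
    ∀ z : ℂ, Complex.exp z = 2 → ∀ k : ℤ, (z ∈ s ↔ z + k * (2 * Real.pi * Complex.I) ∈ s)

/-- REFUTED (Kummer obstruction, index 2): the parity of the branch IS `∅`-definable, so the
route's slogan is false as branch indiscernibility; instance statements of type BI₂ must be made
modulo `4πi` (or in the reduct forgetting `√2 ∈ dcl(∅)`).  (A) itself is untouched: the parity
classes are infinite, no branch becomes `∅`-algebraic. -/
theorem not_branchIndiscernibility : ¬ BranchIndiscernibility := fun h => by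
  have h1 := (h _ definable₁_branchParitySet _ exp_log_two 1).1 log_two_mem_branchParitySet
  simp only [Int.cast_one, one_mul] at h1
  exact log_two_add_two_pi_I_not_mem_branchParitySet h1

end Parity


/-! ## §8 Tightness: `C_EA ⊆ acl(∅)` (the route's support item 0972) — so (A) ⟺ `acl(∅) = C_EA` -/

section Tightness

variable {α : Type*} {A : Set ℂ}

/-- A pointwise `∅`-definable constant is in `acl(∅)`. -/
theorem mem_expAcl_of_definableFun_const {a : ℂ}
    (h : (∅ : Set ℂ).DefinableFun Language.expRing (fun _ : Fin 1 → ℂ => a)) : a ∈ expAcl := by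
  refine ⟨{a}, Set.finite_singleton a, ?_, rfl⟩
  have hd := definable_setOf_eq_params (definableFun_proj_params (A := (∅ : Set ℂ)) (α := Fin 1) 0) h
  have e : {x : Fin 1 → ℂ | x 0 ∈ ({a} : Set ℂ)} = {v : Fin 1 → ℂ | v 0 = a} := by ext v; simp
  show Set.Definable₁ _ _ _
  unfold Set.Definable₁; rw [e]; exact hd

theorem natCast_mem_expAcl (n : ℕ) : (n : ℂ) ∈ expAcl :=
  mem_expAcl_of_definableFun_const (definableFun_natCast' n)

theorem intCast_mem_expAcl (n : ℤ) : (n : ℂ) ∈ expAcl :=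
  mem_expAcl_of_definableFun_const (definableFun_intCast' n)

/-- `acl(∅)` is closed under `exp`. -/
theorem exp_mem_expAcl {a : ℂ} (ha : a ∈ expAcl) : Complex.exp a ∈ expAcl := by
  obtain ⟨s, hs, hdef, has⟩ := ha
  refine ⟨(fun y => Complex.exp y) '' s, hs.image _, ?_, ⟨a, has, rfl⟩⟩
  have hd : (∅ : Set ℂ).Definable Language.expRing
      {v : Fin 1 → ℂ | ∃ y, y ∈ s ∧ v 0 = Complex.exp y} := by
    refine definable_setOf_exists_params (definable_setOf_and_params ?_ ?_)
    · exact definable_mem_of_definable₁ hdef (definableFun_proj_params _)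
    · exact definable_setOf_eq_params (definableFun_proj_params _)
        (definableFun_cexp (definableFun_proj_params _))
  have e : {x : Fin 1 → ℂ | x 0 ∈ (fun y => Complex.exp y) '' s} =
      {v : Fin 1 → ℂ | ∃ y, y ∈ s ∧ v 0 = Complex.exp y} := by
    ext v; simp [Set.mem_image, eq_comm]
  show Set.Definable₁ _ _ _
  unfold Set.Definable₁; rw [e]; exact hd

/-- `acl(∅)` is closed under negation. -/
theorem neg_mem_expAcl {a : ℂ} (ha : a ∈ expAcl) : -a ∈ expAcl := by
  obtain ⟨s, hs, hdef, has⟩ := ha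
  refine ⟨(fun y => -y) '' s, hs.image _, ?_, ⟨a, has, rfl⟩⟩
  have hd : (∅ : Set ℂ).Definable Language.expRing
      {v : Fin 1 → ℂ | ∃ y, y ∈ s ∧ v 0 = -y} := by
    refine definable_setOf_exists_params (definable_setOf_and_params ?_ ?_)
    · exact definable_mem_of_definable₁ hdef (definableFun_proj_params _)
    · exact definable_setOf_eq_params (definableFun_proj_params _)
        (definableFun_neg' (definableFun_proj_params _))
  have e : {x : Fin 1 → ℂ | x 0 ∈ (fun y => -y) '' s} =
      {v : Fin 1 → ℂ | ∃ y, y ∈ s ∧ v 0 = -y} := by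
    ext v; simp [eq_comm, neg_eq_iff_eq_neg]
  show Set.Definable₁ _ _ _
  unfold Set.Definable₁; rw [e]; exact hd

/-- `acl(∅)` is closed under addition. -/
theorem add_mem_expAcl {a b : ℂ} (ha : a ∈ expAcl) (hb : b ∈ expAcl) : a + b ∈ expAcl := by
  obtain ⟨s, hs, hsd, has⟩ := ha
  obtain ⟨t, ht, htd, hbt⟩ := hb
  refine ⟨Set.image2 (· + ·) s t, hs.image2 _ ht, ?_, ⟨a, has, b, hbt, rfl⟩⟩
  have hd : (∅ : Set ℂ).Definable Language.expRing
      {v : Fin 1 → ℂ | ∃ y, y ∈ s ∧ ∃ z, z ∈ t ∧ v 0 = y + z} := by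
    refine definable_setOf_exists_params (definable_setOf_and_params ?_ ?_)
    · exact definable_mem_of_definable₁ hsd (definableFun_proj_params _)
    · refine definable_setOf_exists_params (definable_setOf_and_params ?_ ?_)
      · exact definable_mem_of_definable₁ htd (definableFun_proj_params _)
      · exact definable_setOf_eq_params (definableFun_proj_params _)
          (definableFun_add' (definableFun_proj_params _) (definableFun_proj_params _))
  have e : {x : Fin 1 → ℂ | x 0 ∈ Set.image2 (· + ·) s t} =
      {v : Fin 1 → ℂ | ∃ y, y ∈ s ∧ ∃ z, z ∈ t ∧ v 0 = y + z} := by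
    ext v; simp only [Set.mem_setOf_eq, Set.mem_image2]
    constructor
    · rintro ⟨y, hy, z, hz, h⟩; exact ⟨y, hy, z, hz, h.symm⟩
    · rintro ⟨y, hy, z, hz, h⟩; exact ⟨y, hy, z, hz, h.symm⟩
  show Set.Definable₁ _ _ _
  unfold Set.Definable₁; rw [e]; exact hd

/-- `acl(∅)` is closed under multiplication. -/
theorem mul_mem_expAcl {a b : ℂ} (ha : a ∈ expAcl) (hb : b ∈ expAcl) : a * b ∈ expAcl := by
  obtain ⟨s, hs, hsd, has⟩ := ha
  obtain ⟨t, ht, htd, hbt⟩ := hb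
  refine ⟨Set.image2 (· * ·) s t, hs.image2 _ ht, ?_, ⟨a, has, b, hbt, rfl⟩⟩
  have hd : (∅ : Set ℂ).Definable Language.expRing
      {v : Fin 1 → ℂ | ∃ y, y ∈ s ∧ ∃ z, z ∈ t ∧ v 0 = y * z} := by
    refine definable_setOf_exists_params (definable_setOf_and_params ?_ ?_)
    · exact definable_mem_of_definable₁ hsd (definableFun_proj_params _)
    · refine definable_setOf_exists_params (definable_setOf_and_params ?_ ?_)
      · exact definable_mem_of_definable₁ htd (definableFun_proj_params _)
      · exact definable_setOf_eq_params (definableFun_proj_params _)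
          (definableFun_mul' (definableFun_proj_params _) (definableFun_proj_params _))
  have e : {x : Fin 1 → ℂ | x 0 ∈ Set.image2 (· * ·) s t} =
      {v : Fin 1 → ℂ | ∃ y, y ∈ s ∧ ∃ z, z ∈ t ∧ v 0 = y * z} := by
    ext v; simp only [Set.mem_setOf_eq, Set.mem_image2]
    constructor
    · rintro ⟨y, hy, z, hz, h⟩; exact ⟨y, hy, z, hz, h.symm⟩
    · rintro ⟨y, hy, z, hz, h⟩; exact ⟨y, hy, z, hz, h.symm⟩
  show Set.Definable₁ _ _ _
  unfold Set.Definable₁; rw [e]; exact hd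

/-- `acl(∅)` is closed under inverses. -/
theorem inv_mem_expAcl {a : ℂ} (ha : a ∈ expAcl) : a⁻¹ ∈ expAcl := by
  rcases eq_or_ne a 0 with rfl | ha0
  · simpa using natCast_mem_expAcl 0
  obtain ⟨s, hs, hsd, has⟩ := ha
  refine ⟨{x | ∃ y, y ∈ s ∧ x * y = 1}, ?_, ?_, ⟨a, has, inv_mul_cancel₀ ha0⟩⟩
  · refine (hs.image (fun y => y⁻¹)).subset ?_
    rintro x ⟨y, hy, hxy⟩
    exact ⟨y, hy, (eq_inv_of_mul_eq_one_left hxy).symm⟩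
  · have hd : (∅ : Set ℂ).Definable Language.expRing
        {v : Fin 1 → ℂ | ∃ y, y ∈ s ∧ v 0 * y = 1} := by
      refine definable_setOf_exists_params (definable_setOf_and_params ?_ ?_)
      · exact definable_mem_of_definable₁ hsd (definableFun_proj_params _)
      · exact definable_setOf_eq_params
          (definableFun_mul' (definableFun_proj_params _) (definableFun_proj_params _))
          definableFun_one'
    exact hd

/-- `acl^{ℂ_exp}(∅)` as a subfield of `ℂ`. -/
def expAclSubfield : Subfield ℂ where
  carrier := expAcl
  mul_mem' := mul_mem_expAcl
  one_mem' := by simpa using natCast_mem_expAcl 1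
  add_mem' := add_mem_expAcl
  zero_mem' := by simpa using natCast_mem_expAcl 0
  neg_mem' := neg_mem_expAcl
  inv_mem' := fun _ => inv_mem_expAcl

/-- `acl^{ℂ_exp}(∅)` as an intermediate field of `ℂ/ℚ`. -/
def expAclField : IntermediateField ℚ ℂ :=
  expAclSubfield.toIntermediateField fun q => by
    show ((q : ℚ) : ℂ) ∈ expAclSubfield
    rw [Rat.cast_def]
    exact div_mem (intCast_mem_expAcl q.num) (natCast_mem_expAcl q.den)

@[simp] theorem mem_expAclField {x : ℂ} : x ∈ expAclField ↔ x ∈ expAcl := Iff.rfl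

/-- Polynomial maps with integer coefficients (any finite set of variables) are `∅`-definable. -/
theorem definableFun_mvPolynomial_aeval' {σ : Type*} (Q : MvPolynomial σ ℤ) :
    (∅ : Set ℂ).DefinableFun Language.expRing (fun x : σ → ℂ => MvPolynomial.aeval x Q) := by
  induction Q using MvPolynomial.induction_on with
  | C a => simpa using definableFun_intCast' (A := (∅ : Set ℂ)) (α := σ) a
  | add p q hp hq => simpa using definableFun_add' hp hq
  | mul_X p i hp => simpa using definableFun_mul' hp (definableFun_proj_params i)

/-- **`acl(∅)` is relatively algebraically closed in `ℂ`**: a root of a non-zero polynomial whose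
coefficients lie in finite `∅`-definable sets lies in the finite `∅`-definable set of roots of
all non-degenerate polynomials with coefficients from those sets. -/
theorem expAcl_relAlgClosed : ∀ w : ℂ, IsAlgebraic expAclField w → w ∈ expAcl := by
  rintro w ⟨p, hp0, hpw⟩
  set d := p.natDegree with hd
  have hc : ∀ j : Fin (d + 1), ((p.coeff j : expAclField) : ℂ) ∈ expAcl := fun j => (p.coeff j).2
  choose s hs hsd hcs using hc
  -- the candidate finite definable set
  let S : Set ℂ := {x | ∃ y : Fin (d + 1) → ℂ, (∀ j, y j ∈ s j) ∧ y (Fin.last d) ≠ 0 ∧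
    ∑ j : Fin (d + 1), y j * x ^ (j : ℕ) = 0}
  -- the polynomial attached to a coefficient vector
  let P : (Fin (d + 1) → ℂ) → Polynomial ℂ := fun y =>
    ∑ j : Fin (d + 1), Polynomial.monomial (j : ℕ) (y j)
  have hPeval : ∀ y x, (P y).eval x = ∑ j : Fin (d + 1), y j * x ^ (j : ℕ) := by
    intro y x
    simp [P, Polynomial.eval_finsetSum, Polynomial.eval_monomial]
  have hPcoeff : ∀ y, (P y).coeff d = y (Fin.last d) := by
    intro y
    simp only [P, Polynomial.finsetSum_coeff, Polynomial.coeff_monomial]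
    rw [Finset.sum_eq_single (Fin.last d)]
    · simp
    · intro j _ hj
      have : (j : ℕ) ≠ d := fun h => hj (Fin.ext (by simpa using h))
      simp [this]
    · simp
  refine ⟨S, ?_, ?_, ?_⟩
  · -- finiteness
    have hsub : S ⊆ ⋃ y ∈ {f : Fin (d + 1) → ℂ | ∀ j, f j ∈ s j}, {x | P y ≠ 0 ∧ (P y).IsRoot x} := by
      rintro x ⟨y, hy, hyd, hsum⟩
      refine Set.mem_biUnion hy ⟨fun h0 => hyd ?_, ?_⟩
      · have := congrArg (fun q : Polynomial ℂ => q.coeff d) h0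
        simpa [hPcoeff] using this
      · show (P y).eval x = 0
        rw [hPeval]; exact hsum
    refine Set.Finite.subset ?_ hsub
    refine Set.Finite.biUnion (Set.Finite.pi' hs) fun y _ => ?_
    by_cases h : P y = 0
    · have : {x : ℂ | P y ≠ 0 ∧ (P y).IsRoot x} = ∅ := by ext x; simp [h]
      rw [this]; exact Set.finite_empty
    · exact (Polynomial.finite_setOf_isRoot h).subset fun x hx => hx.2
  · -- definability
    let T : Set (Fin 1 ⊕ Fin (d + 1) → ℂ) := {w | (∀ j, w (Sum.inr j) ∈ s j) ∧
      ¬ w (Sum.inr (Fin.last d)) = 0 ∧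
        ∑ j : Fin (d + 1), w (Sum.inr j) * w (Sum.inl 0) ^ (j : ℕ) = 0}
    have hT : (∅ : Set ℂ).Definable Language.expRing T := by
      refine definable_setOf_and_params ?_ (definable_setOf_and_params ?_ ?_)
      · have : {w : Fin 1 ⊕ Fin (d + 1) → ℂ | ∀ j, w (Sum.inr j) ∈ s j} =
            ⋂ j, {w | w (Sum.inr j) ∈ s j} := by ext w; simp
        rw [this]
        exact Set.definable_iInter_of_finite fun j =>
          definable_mem_of_definable₁ (hsd j) (definableFun_proj_params _)
      · exact definable_setOf_not_params
          (definable_setOf_eq_params (definableFun_proj_params _) definableFun_zero')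
      · let Q : MvPolynomial (Fin 1 ⊕ Fin (d + 1)) ℤ :=
          ∑ j : Fin (d + 1), MvPolynomial.X (Sum.inr j) * MvPolynomial.X (Sum.inl 0) ^ (j : ℕ)
        have hQ : (fun w : Fin 1 ⊕ Fin (d + 1) → ℂ =>
            ∑ j : Fin (d + 1), w (Sum.inr j) * w (Sum.inl 0) ^ (j : ℕ)) =
            fun w => MvPolynomial.aeval w Q := by
          funext w; simp [Q, map_sum]
        have hf := definableFun_mvPolynomial_aeval' Q
        rw [← hQ] at hf
        exact definable_setOf_eq_params hf definableFun_zero'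
    have h := hT.exists_of_finite
    have e : {x : Fin 1 → ℂ | x 0 ∈ S} = {v : Fin 1 → ℂ | ∃ u : Fin (d + 1) → ℂ, Sum.elim v u ∈ T} := by
      ext v; simp [S, T]
    show Set.Definable₁ _ _ _
    unfold Set.Definable₁; rw [e]; exact h
  · -- membership of `w`
    refine ⟨fun j => ((p.coeff j : expAclField) : ℂ), hcs, ?_, ?_⟩
    · have hlead : p.coeff d ≠ 0 := by
        rw [hd]; exact Polynomial.leadingCoeff_ne_zero.2 hp0
      intro h
      apply hlead
      have h' : ((p.coeff (Fin.last d : ℕ) : expAclField) : ℂ) = 0 := h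
      rw [Fin.val_last] at h'
      exact_mod_cast h'
    · have h1 := hpw
      rw [Polynomial.aeval_eq_sum_range, ← hd] at h1
      rw [← h1, ← Fin.sum_univ_eq_sum_range (fun i => p.coeff i • w ^ i) (d + 1)]
      refine Finset.sum_congr rfl fun j _ => ?_
      rw [Algebra.smul_def]
      rfl

/-- `acl(∅)` is a member of the family defining the core. -/
theorem expAclField_mem_coreFamily : expAclField ∈ coreFamily :=
  ⟨two_pi_I_mem_expAcl, fun _ hw => exp_mem_expAcl hw, expAcl_relAlgClosed⟩

/-- **Tightness of (A): `C_EA ⊆ acl^{ℂ_exp}(∅)`** — the route's support item 0972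
(`RigidCore.LogFreeCoreSubsetAcl`), proved. -/
theorem logFreeCore_subset_expAcl : (logFreeCore : Set ℂ) ⊆ expAcl := fun _ ha =>
  logFreeCore_le_of_mem expAclField_mem_coreFamily ha

/-- The support item 0972 verbatim. -/
theorem logFreeCoreSubsetAcl_holds :
    Summit.Schanuel.Schanuel.Theses.RigidCore.LogFreeCoreSubsetAcl := fun _ ha =>
  logFreeCore_subset_expAcl ha

/-- Hence the crux (A) is equivalent to EQUALITY `acl^{ℂ_exp}(∅) = C_EA`: the bound `C_EA` cannot
be improved. -/
theorem crux_iff_eq :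
    Summit.Schanuel.Schanuel.Theses.RigidCore.AclSubsetLogFreeCore ↔
      expAcl = (logFreeCore : Set ℂ) :=
  ⟨fun h => Set.Subset.antisymm h logFreeCore_subset_expAcl, fun h => h.le⟩

end Tightness


/-! ## §9 `acl` is idempotent: the admissible parameter sets of (A) are EXACTLY the subsets of `C_EA`;
(A) ⟺ `acl(C_EA) = C_EA` (landed: `Negative/AclIdempotent.lean`) -/

section ModelTheoreticAcl

universe u v

variable (L : FirstOrder.Language.{u, v}) {M : Type*} [L.Structure M]

/-- The **model-theoretic algebraic closure** `acl(A)` in an arbitrary structure: elements lying in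
some FINITE `A`-definable subset (Marker 2002, §1.3). -/
def modelAcl (A : Set M) : Set M :=
  {b : M | ∃ s : Set M, s.Finite ∧ A.Definable₁ L s ∧ b ∈ s}

variable {L}

/-- `acl` is extensive. -/
theorem subset_modelAcl (A : Set M) : A ⊆ modelAcl L A := fun a ha =>
  ⟨{a}, Set.finite_singleton a, Set.Definable.singleton_of_mem L ha, rfl⟩

/-- `acl` is monotone. -/
theorem modelAcl_mono {A B : Set M} (h : A ⊆ B) : modelAcl L A ⊆ modelAcl L B := by
  rintro b ⟨s, hs, hdef, hb⟩
  exact ⟨s, hs, Set.Definable.mono hdef h, hb⟩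

/-- `dcl(A) ⊆ acl(A)`. -/
theorem definableClosure_subset_modelAcl (A : Set M) :
    definableClosure L A ⊆ modelAcl L A := fun b hb =>
  ⟨{b}, Set.finite_singleton b, hb, rfl⟩

/-- **Elimination of one algebraic parameter.**  If `s` is a finite set definable over
`insert b A` (`A` finite) and `b` lies in a finite `A`-definable set `t`, then `s` is contained in
a finite `A`-definable set: writing `s = φ(M, b)` with `N = |s|`, take
`s' = {x | ∃ u ∈ t, φ(x, u) ∧ ¬∃ (N+1) distinct solutions of φ(·, u)}`. -/
theorem exists_finite_definable₁_superset_of_insert {A : Set M} (hA : A.Finite) {b : M}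
    {s t : Set M} (hs : (insert b A).Definable₁ L s) (hsfin : s.Finite)
    (ht : A.Definable₁ L t) (htfin : t.Finite) (hbt : b ∈ t) :
    ∃ s' : Set M, s ⊆ s' ∧ s'.Finite ∧ A.Definable₁ L s' := by
  classical
  haveI : Finite ↥(insert b A) := (hA.insert b).to_subtype
  -- a formula for `s`, with all parameters displayed as variables
  obtain ⟨φ, hφ⟩ := Set.definable_iff_exists_formula_sum.1 hs
  set F : Set (↥(insert b A) ⊕ Fin 1 → M) := setOf φ.Realize with hFdef
  have hF : A.Definable L F := (Set.empty_definable_iff.2 ⟨φ, rfl⟩).mono (empty_subset A)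
  -- plug the true parameters from `A` back in, keep a variable `u` in place of `b`:
  -- variables `Fin 1 ⊕ Fin 1` = `(x, u)`
  let Φ : (Fin 1 ⊕ Fin 1 → M) → (↥(insert b A) ⊕ Fin 1 → M) := fun w =>
    Sum.elim (fun p => if (p : M) = b then w (Sum.inr 0) else (p : M)) (fun _ => w (Sum.inl 0))
  have hΦ : A.DefinableMap L Φ := by
    intro i
    rcases i with p | j
    · by_cases hp : (p : M) = b
      · simp only [Φ, Sum.elim_inl, hp, if_true]
        exact definableFun_proj_params _
      · have hpA : (p : M) ∈ A := (Set.mem_insert_iff.1 p.2).resolve_left hp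
        simp only [Φ, Sum.elim_inl, hp, if_false]
        exact definableFun_const_params _ hpA
    · simp only [Φ, Sum.elim_inr]
      exact definableFun_proj_params _
  set G : Set (Fin 1 ⊕ Fin 1 → M) := Φ ⁻¹' F with hGdef
  have hG : A.Definable L G := hF.preimage_map hΦ
  -- `pt x u ∈ G` : "`x` satisfies `φ` with the parameter `b` replaced by `u`"
  let pt : M → M → (Fin 1 ⊕ Fin 1 → M) := fun x u => Sum.elim (fun _ => x) (fun _ => u)
  have hG_b : ∀ x, pt x b ∈ G ↔ x ∈ s := by
    intro x
    have hΦb : Φ (pt x b) = Sum.elim (fun p : ↥(insert b A) => (p : M)) (fun _ : Fin 1 => x) := by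
      funext i
      rcases i with p | j
      · simp only [Φ, pt, Sum.elim_inl, Sum.elim_inr]
        by_cases hp : (p : M) = b
        · rw [if_pos hp, hp]
        · rw [if_neg hp]
      · rfl
    have h1 := Set.ext_iff.1 hφ (fun _ => x)
    simp only [mem_setOf_eq] at h1
    rw [hGdef, mem_preimage, hΦb, hFdef, mem_setOf_eq]
    exact h1.symm
  -- counting: `Bad u` = "more than `N` solutions"
  set N := hsfin.toFinset.card with hN
  let Bad : Set M := {u | ∃ y : Fin (N + 1) → M, Function.Injective y ∧ ∀ j, pt (y j) u ∈ G}
  let S' : Set M := {x | ∃ u, (u ∈ t ∧ pt x u ∈ G) ∧ u ∉ Bad}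
  have hb_not_bad : b ∉ Bad := by
    rintro ⟨y, hy, hyG⟩
    have hys : ∀ j, y j ∈ hsfin.toFinset := fun j => hsfin.mem_toFinset.2 ((hG_b (y j)).1 (hyG j))
    have hcard := Finset.card_le_card_of_injOn (s := Finset.univ) (t := hsfin.toFinset) y
      (fun j _ => hys j) hy.injOn
    rw [Finset.card_univ, Fintype.card_fin] at hcard
    omega
  refine ⟨S', fun x hx => ⟨b, ⟨hbt, (hG_b x).2 hx⟩, hb_not_bad⟩, ?_, ?_⟩
  · -- finiteness: a finite union (over `u ∈ t`) of fibres with at most `N` elements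
    have hsub : S' ⊆ ⋃ u ∈ t, {x | pt x u ∈ G ∧ u ∉ Bad} := by
      rintro x ⟨u, ⟨hut, hxu⟩, hub⟩
      exact Set.mem_biUnion hut ⟨hxu, hub⟩
    refine (htfin.biUnion fun u _ => ?_).subset hsub
    by_contra hinf
    have hinf' : {x | pt x u ∈ G ∧ u ∉ Bad}.Infinite := hinf
    obtain ⟨x₀, hx₀⟩ := hinf'.nonempty
    refine hx₀.2 ⟨fun j => (hinf'.natEmbedding _ j.1 : M), ?_, fun j => (hinf'.natEmbedding _ j.1).2.1⟩
    intro j k hjk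
    exact Fin.ext ((hinf'.natEmbedding _).injective (Subtype.val_injective hjk))
  · -- definability
    -- variables `(x, u)`:
    let r : Fin 1 ⊕ Fin 1 → Fin 1 ⊕ Unit := Sum.map id (fun _ => ())
    -- variables `((x, u), y)`; `q j` reads off `(y j, u)`:
    let q : Fin (N + 1) → (Fin 1 ⊕ Fin 1) → ((Fin 1 ⊕ Unit) ⊕ Fin (N + 1)) := fun j =>
      Sum.elim (fun _ => Sum.inr j) (fun _ => Sum.inl (Sum.inr ()))
    have hT₁ : A.Definable L {w : Fin 1 ⊕ Unit → M | w (Sum.inr ()) ∈ t} :=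
      Set.Definable.preimage_comp (fun _ : Fin 1 => (Sum.inr () : Fin 1 ⊕ Unit)) ht
    have hT₂ : A.Definable L {w : Fin 1 ⊕ Unit → M | w ∘ r ∈ G} := hG.preimage_comp r
    have hInj : A.Definable L {z : (Fin 1 ⊕ Unit) ⊕ Fin (N + 1) → M |
        ∀ j k, z (Sum.inr j) = z (Sum.inr k) → j = k} := by
      have : {z : (Fin 1 ⊕ Unit) ⊕ Fin (N + 1) → M | ∀ j k, z (Sum.inr j) = z (Sum.inr k) → j = k} =
          ⋂ j, ⋂ k, {z | z (Sum.inr j) = z (Sum.inr k) → j = k} := by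
        ext z; simp [Set.mem_iInter]
      rw [this]
      refine Set.definable_iInter_of_finite fun j => Set.definable_iInter_of_finite fun k => ?_
      refine definable_setOf_imp_params (definable_setOf_eq_params (definableFun_proj_params _)
        (definableFun_proj_params _)) ?_
      by_cases hjk : j = k <;> simp [hjk]
    have hAll : A.Definable L {z : (Fin 1 ⊕ Unit) ⊕ Fin (N + 1) → M | ∀ j, z ∘ q j ∈ G} := by
      have : {z : (Fin 1 ⊕ Unit) ⊕ Fin (N + 1) → M | ∀ j, z ∘ q j ∈ G} = ⋂ j, {z | z ∘ q j ∈ G} := by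
        ext z; simp [Set.mem_iInter]
      rw [this]
      exact Set.definable_iInter_of_finite fun j => hG.preimage_comp (q j)
    have hT₃ : A.Definable L {w : Fin 1 ⊕ Unit → M | ∃ y : Fin (N + 1) → M,
        Sum.elim w y ∈ {z : (Fin 1 ⊕ Unit) ⊕ Fin (N + 1) → M |
          ∀ j k, z (Sum.inr j) = z (Sum.inr k) → j = k} ∩ {z | ∀ j, z ∘ q j ∈ G}} :=
      (hInj.inter hAll).exists_of_finite
    have hT := (hT₁.inter hT₂).inter hT₃.compl
    have hS₁ := hT.exists_of_finite (β := Unit)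
    -- identify with `{v | v 0 ∈ S'}`
    have key₁ : ∀ (v : Fin 1 → M) (u : Unit → M),
        Sum.elim v u ∘ r = pt (v 0) (u ()) := by
      intro v u; funext i
      rcases i with i | j
      · simp [r, pt, Fin.fin_one_eq_zero i]
      · simp [r, pt]
    have key₂ : ∀ (v : Fin 1 → M) (u : Unit → M) (y : Fin (N + 1) → M) (j : Fin (N + 1)),
        Sum.elim (Sum.elim v u) y ∘ q j = pt (y j) (u ()) := by
      intro v u y j; funext i
      rcases i with i | i <;> simp [q, pt]
    have e : {v : Fin 1 → M | v 0 ∈ S'} = {v : Fin 1 → M | ∃ u : Unit → M,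
        Sum.elim v u ∈ ({w : Fin 1 ⊕ Unit → M | w (Sum.inr ()) ∈ t} ∩ {w | w ∘ r ∈ G}) ∩
          {w : Fin 1 ⊕ Unit → M | ∃ y : Fin (N + 1) → M,
            Sum.elim w y ∈ {z : (Fin 1 ⊕ Unit) ⊕ Fin (N + 1) → M |
              ∀ j k, z (Sum.inr j) = z (Sum.inr k) → j = k} ∩ {z | ∀ j, z ∘ q j ∈ G}}ᶜ} := by
      ext v
      simp only [S', Bad, mem_setOf_eq, mem_inter_iff, mem_compl_iff, Sum.elim_inr, key₁, key₂]
      constructor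
      · rintro ⟨u, ⟨hut, hG'⟩, hbad⟩
        refine ⟨fun _ => u, ⟨hut, hG'⟩, ?_⟩
        rintro ⟨y, hyinj, hyG⟩
        exact hbad ⟨y, fun j k h => hyinj j k h, hyG⟩
      · rintro ⟨u, ⟨hut, hG'⟩, hbad⟩
        refine ⟨u (), ⟨hut, hG'⟩, ?_⟩
        rintro ⟨y, hyinj, hyG⟩
        exact hbad ⟨y, fun j k h => hyinj h, hyG⟩
    show A.Definable L {v : Fin 1 → M | v 0 ∈ S'}
    rw [e]; exact hS₁

/-- Induction on finitely many algebraic parameters (finite base). -/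
theorem exists_finite_definable₁_superset_aux {A₀ : Set M} (hA₀ : A₀.Finite) :
    ∀ T : Finset M, (↑T : Set M) ⊆ modelAcl L A₀ →
      ∀ s : Set M, s.Finite → (A₀ ∪ ↑T).Definable₁ L s →
        ∃ s' : Set M, s ⊆ s' ∧ s'.Finite ∧ A₀.Definable₁ L s' := by
  classical
  intro T
  induction T using Finset.induction_on with
  | empty =>
    intro _ s hs hdef
    exact ⟨s, subset_rfl, hs, by simpa using hdef⟩
  | @insert b T hbT ih =>
    intro hT s hs hdef
    have hb : b ∈ modelAcl L A₀ := hT (by simp)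
    have hT' : (↑T : Set M) ⊆ modelAcl L A₀ := fun z hz =>
      hT (by rw [Finset.coe_insert]; exact Set.mem_insert_of_mem _ hz)
    obtain ⟨t, htfin, htdef, hbt⟩ := hb
    have hfin : (A₀ ∪ ↑T : Set M).Finite := hA₀.union T.finite_toSet
    have hdef' : (insert b (A₀ ∪ ↑T)).Definable₁ L s := by
      have : insert b (A₀ ∪ ↑T) = A₀ ∪ (↑(insert b T) : Set M) := by
        rw [Finset.coe_insert, Set.union_insert]
      rw [this]; exact hdef
    obtain ⟨s₁, hss₁, hs₁fin, hs₁def⟩ := exists_finite_definable₁_superset_of_insert hfin hdef'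
      hs (Set.Definable.mono htdef subset_union_left) htfin hbt
    obtain ⟨s', hs₁s', hs'fin, hs'def⟩ := ih hT' s₁ hs₁fin hs₁def
    exact ⟨s', hss₁.trans hs₁s', hs'fin, hs'def⟩

/-- **`acl` is transitive**: parameters that are themselves algebraic over `A` can be eliminated
(Marker 2002, Exercise 1.4.11). -/
theorem modelAcl_subset_modelAcl_of_subset {A B : Set M} (hB : B ⊆ modelAcl L A) :
    modelAcl L B ⊆ modelAcl L A := by
  classical
  rintro c ⟨s, hsfin, hsdef, hcs⟩
  obtain ⟨B₀, hB₀B, hs₀⟩ := Set.definable_iff_finitely_definable.1 hsdef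
  have hpar : ∀ b ∈ B₀, ∃ A₁ : Finset M, (↑A₁ : Set M) ⊆ A ∧ b ∈ modelAcl L (↑A₁ : Set M) := by
    intro b hb
    obtain ⟨t, htfin, htdef, hbt⟩ := hB (hB₀B (Finset.mem_coe.2 hb))
    obtain ⟨A₁, hA₁A, ht₁⟩ := Set.definable_iff_finitely_definable.1 htdef
    exact ⟨A₁, hA₁A, t, htfin, ht₁, hbt⟩
  choose! Af hAfA hAf using hpar
  set A₀ : Finset M := B₀.biUnion Af with hA₀def
  have hA₀A : (↑A₀ : Set M) ⊆ A := by
    intro z hz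
    obtain ⟨b, hb, hzb⟩ := Finset.mem_biUnion.1 (Finset.mem_coe.1 hz)
    exact hAfA b hb (Finset.mem_coe.2 hzb)
  have hB₀acl : (↑B₀ : Set M) ⊆ modelAcl L (↑A₀ : Set M) := by
    intro b hb
    have hb' := Finset.mem_coe.1 hb
    refine modelAcl_mono ?_ (hAf b hb')
    intro z hz
    exact Finset.mem_coe.2 (Finset.mem_biUnion.2 ⟨b, hb', Finset.mem_coe.1 hz⟩)
  obtain ⟨s', hss', hs'fin, hs'def⟩ := exists_finite_definable₁_superset_aux A₀.finite_toSet B₀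
    hB₀acl s hsfin (Set.Definable.mono hs₀ subset_union_right)
  exact ⟨s', hs'fin, Set.Definable.mono hs'def hA₀A, hss' hcs⟩

/-- **`acl` is idempotent**: `acl(acl A) = acl A` (Marker 2002, Exercise 1.4.11). -/
theorem modelAcl_modelAcl (A : Set M) : modelAcl L (modelAcl L A) = modelAcl L A :=
  Set.Subset.antisymm (modelAcl_subset_modelAcl_of_subset subset_rfl) (subset_modelAcl _)

end ModelTheoreticAcl

/-- `acl^{ℂ_exp}(∅)` of the crux is the model-theoretic `acl` of `∅` in `(ℂ, +, ·, −, 0, 1, exp)`,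
and `WithParams P` (§4) is literally `acl(P) ⊆ C_EA`. -/
theorem expAcl_eq_modelAcl : expAcl = modelAcl Language.expRing (∅ : Set ℂ) := rfl

theorem withParams_iff_modelAcl {P : Set ℂ} :
    WithParams P ↔ modelAcl Language.expRing P ⊆ (logFreeCore : Set ℂ) := Iff.rfl

/-- Parameters from `acl(∅)` define no new finite sets: `acl(P) ⊆ acl(∅)` for `P ⊆ acl(∅)`;
in particular parameters from `C_EA ⊆ acl(∅)` (§8) are harmless for `acl`. -/
theorem modelAcl_subset_expAcl {P : Set ℂ} (hP : P ⊆ expAcl) :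
    modelAcl Language.expRing P ⊆ expAcl :=
  modelAcl_subset_modelAcl_of_subset hP

/-- **The exact price of parameters in (A)**: `acl(P) ⊆ C_EA ⟺ (A) ∧ P ⊆ C_EA`.  A parameter `p` is
fatal iff `p ∉ C_EA` (this is how `exists_not_withParams_singleton` of §4 arises) and free iff
`p ∈ C_EA` (given (A)). -/
theorem withParams_iff {P : Set ℂ} :
    WithParams P ↔
      (Summit.Schanuel.Schanuel.Theses.RigidCore.AclSubsetLogFreeCore ∧ P ⊆ (logFreeCore : Set ℂ)) := by
  constructor
  · intro h
    refine ⟨?_, subset_of_withParams h⟩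
    rw [crux_iff]
    exact (modelAcl_mono (Set.empty_subset P)).trans h
  · rintro ⟨hA, hP⟩
    rw [crux_iff] at hA
    exact (modelAcl_subset_expAcl (hP.trans logFreeCore_subset_expAcl)).trans hA

/-- **(A) is equivalent to its maximal parametric strengthening `acl(C_EA) ⊆ C_EA`**, -/
theorem crux_iff_withParams_logFreeCore :
    Summit.Schanuel.Schanuel.Theses.RigidCore.AclSubsetLogFreeCore ↔
      WithParams (logFreeCore : Set ℂ) := by
  rw [withParams_iff]; simp

/-- i.e. **(A) ⟺ `acl^{ℂ_exp}(C_EA) = C_EA`**: the crux says exactly that the log-free core is an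
algebraically closed SUBSTRUCTURE of `(ℂ, +, ·, exp)` in the model-theoretic sense (compare §8:
(A) ⟺ `acl(∅) = C_EA`). -/
theorem crux_iff_modelAcl_logFreeCore_eq :
    Summit.Schanuel.Schanuel.Theses.RigidCore.AclSubsetLogFreeCore ↔
      modelAcl Language.expRing (logFreeCore : Set ℂ) = (logFreeCore : Set ℂ) := by
  rw [crux_iff_withParams_logFreeCore, withParams_iff_modelAcl]
  exact ⟨fun h => Set.Subset.antisymm h (subset_modelAcl _), fun h => h.le⟩

/-- One parameter: `acl(p) ⊆ C_EA ⟺ (A) ∧ p ∈ C_EA`. -/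
theorem withParams_singleton_iff {p : ℂ} :
    WithParams {p} ↔
      (Summit.Schanuel.Schanuel.Theses.RigidCore.AclSubsetLogFreeCore ∧ p ∈ logFreeCore) := by
  rw [withParams_iff, Set.singleton_subset_iff]; rfl

/-- `π ∈ C_EA` (`π = 2πi / 2i`, `i` algebraic). -/
theorem pi_mem_logFreeCore : (Real.pi : ℂ) ∈ logFreeCore := by
  have hI : Complex.I ∈ logFreeCore := by
    refine logFreeCore_mem_coreFamily.2.2 _ ⟨Polynomial.X ^ 2 + 1, ?_, by simp⟩
    exact (Polynomial.monic_X_pow_add_C (1 : logFreeCore) two_ne_zero).ne_zero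
  have h2' : (2 : ℂ) ∈ logFreeCore := by simp
  have : (Real.pi : ℂ) = (2 * ↑Real.pi * Complex.I) / (2 * Complex.I) := by field_simp
  rw [this]
  exact div_mem two_pi_I_mem_logFreeCore (mul_mem h2' hI)

/-- So the period `π` (or `2πi`, `e`, `e^π`, any algebraic number, all of `ℤ`) is a FREE parameter:
`acl(π) ⊆ C_EA ⟺ (A)` — in contrast with `exists_not_withParams_singleton` (§4). -/
theorem withParams_pi_iff :
    WithParams {(Real.pi : ℂ)} ↔ Summit.Schanuel.Schanuel.Theses.RigidCore.AclSubsetLogFreeCore := by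
  rw [withParams_singleton_iff]
  exact ⟨fun h => h.1, fun h => ⟨h, pi_mem_logFreeCore⟩⟩

theorem withParams_int_iff :
    WithParams (Set.range (Int.cast : ℤ → ℂ)) ↔
      Summit.Schanuel.Schanuel.Theses.RigidCore.AclSubsetLogFreeCore := by
  rw [withParams_iff]
  refine ⟨fun h => h.1, fun h => ⟨h, ?_⟩⟩
  rintro _ ⟨n, rfl⟩
  exact intCast_mem logFreeCore n


/-! ## §10 The COUNTABLE variant of (A) makes `C_EA` log-closed: "finite" cannot be weakened to
"countable" (landed: `Negative/CountableVariant.lean`) -/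

/-- (A_ℵ₀): every COUNTABLE `∅`-definable set lies in `C_EA`.  (Under EAC the registered lines give
`countable ∅-definable ⊆ ecl ∅`; this is the tempting upgrade.) -/
def CountableVariant : Prop :=
  ∀ s : Set ℂ, s.Countable → Set.Definable₁ (∅ : Set ℂ) Language.expRing s → s ⊆ (logFreeCore : Set ℂ)

/-- A fibre of `exp` is countable. -/
theorem countable_exp_fibre (c : ℂ) : {z : ℂ | Complex.exp z = c}.Countable := by
  by_cases hc : ∃ z₀, Complex.exp z₀ = c
  · obtain ⟨z₀, rfl⟩ := hc
    have hsub : {z : ℂ | Complex.exp z = Complex.exp z₀} ⊆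
        Set.range (fun n : ℤ => z₀ + n * (2 * Real.pi * Complex.I)) := by
      intro z hz
      obtain ⟨n, hn⟩ := Complex.exp_eq_exp_iff_exists_int.1 hz
      exact ⟨n, hn.symm⟩
    exact (Set.countable_range _).mono hsub
  · have : {z : ℂ | Complex.exp z = c} = ∅ := by
      ext z; simp only [Set.mem_setOf_eq, Set.mem_empty_iff_false, iff_false]
      exact fun h => hc ⟨z, h⟩
    rw [this]; exact Set.countable_empty

/-- The preimage under `exp` of a finite set is countable … -/
theorem countable_exp_preimage {t : Set ℂ} (ht : t.Finite) :
    {z : ℂ | Complex.exp z ∈ t}.Countable := by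
  have : {z : ℂ | Complex.exp z ∈ t} = ⋃ c ∈ t, {z | Complex.exp z = c} := by
    ext z; simp
  rw [this]
  exact ht.countable.biUnion fun c _ => countable_exp_fibre c

/-- … and of an `∅`-definable set is `∅`-definable. -/
theorem definable₁_exp_preimage {t : Set ℂ} (ht : Set.Definable₁ (∅ : Set ℂ) Language.expRing t) :
    Set.Definable₁ (∅ : Set ℂ) Language.expRing {z : ℂ | Complex.exp z ∈ t} :=
  definable_mem_of_definable₁ ht (definableFun_cexp (definableFun_proj_params _))

/-- The set of ALL branches of `log 2` is a countable `∅`-definable set. -/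
theorem definable₁_log_two_fibre :
    Set.Definable₁ (∅ : Set ℂ) Language.expRing {z : ℂ | Complex.exp z = 2} := by
  have h2 : (∅ : Set ℂ).DefinableFun Language.expRing (fun _ : Fin 1 → ℂ => (2 : ℂ)) := by
    simpa using definableFun_natCast' (A := (∅ : Set ℂ)) (α := Fin 1) 2
  exact definable_setOf_eq_params (definableFun_cexp (definableFun_proj_params _)) h2

/-- **(A_ℵ₀) ⇒ `ln 2 ∈ C_EA`** — false under SC (`K_ω` is the FREE EA-closure of `ℚ(2πi)`). -/
theorem log_two_mem_logFreeCore_of_countableVariant (h : CountableVariant) :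
    (Real.log 2 : ℂ) ∈ logFreeCore :=
  h _ (countable_exp_fibre 2) definable₁_log_two_fibre exp_log_two

/-- **(A_ℵ₀) ⇒ `C_EA` is closed under ALL logarithms of its elements** (would be an ELA-field
containing `ln 2, ln 3, ln π, ln ln 2, …`; false under SC).  Uses the tightness `C_EA ⊆ acl(∅)` (§8):
`a ∈ C_EA` lies in a finite `∅`-definable `t`, and `exp⁻¹(t)` is countable and `∅`-definable.
Moral for provers: (A) must use finiteness BEYOND countability — a finite parameter-free definable
set must be shown to contain no branch of `log 2` although the set of all branches is definable. -/
theorem log_mem_logFreeCore_of_countableVariant (h : CountableVariant)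
    {a : ℂ} (ha : a ∈ logFreeCore) {z : ℂ} (hz : Complex.exp z = a) : z ∈ logFreeCore := by
  obtain ⟨t, htfin, htdef, hat⟩ := logFreeCore_subset_expAcl ha
  exact h _ (countable_exp_preimage htfin) (definable₁_exp_preimage htdef) (by simp [hz, hat])

/-- e.g. (A_ℵ₀) ⇒ `ln π + 2πik ∈ C_EA` for every `k`. -/
theorem log_pi_mem_logFreeCore_of_countableVariant (h : CountableVariant) (k : ℤ) :
    (Real.log Real.pi : ℂ) + k * (2 * Real.pi * Complex.I) ∈ logFreeCore := by
  refine log_mem_logFreeCore_of_countableVariant h pi_mem_logFreeCore ?_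
  rw [Complex.exp_add, Complex.exp_int_mul_two_pi_mul_I, mul_one, ← Complex.ofReal_exp,
    Real.exp_log Real.pi_pos]


/-! ## §11 Targets: the stubs of the registered lines `eac-homogeneity-collapse` /
`eac-extends-core-automorphisms` (landed: `Negative/CoreAutConj.lean`)

Both skeletons reduce (A) to EAC (`stub_eac` / `stub_expAlgClosed`, Zilber's conjecture minus SC —
open, external) + two provable-now plumbing stubs (dichotomy at `b = ∅`, twisted Karp) + the residue
"`Fix(Aut_E(C₀)) ⊆ C_EA`" (`stub_coreFixedLogFree` over `ExponentialRingEquiv C₀ C₀`, resp.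
`stub_coreFixedField_logFree` over `g : ℂ → ℂ` with `IsEIsoOn g (ecl ∅) (ecl ∅)`; `C₀ = ecl ∅`).
Attack log (this cycle):
* none of the four stubs is refutable today: the two middle stubs hold vacuously if EAC fails and are
  theorems of the tree's Γ-field algebra if it holds; the residue needs an element of `ecl ∅` PROVABLY
  outside `C_EA = K_ω` — none is known (same obstruction as `not_crux`);
* the residue is NOT the SC-false statement `ecl ∅ ⊆ C_EA` in disguise: `Aut_E(C₀) ∋ conj|_{C₀} ≠ id`
  in both presentations (`conjCore`, `isEIsoOn_conj_ecl_empty`, via functoriality of `ecl`);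
* consequently the fixed field of `Aut_E(C₀)` is REAL, and both residue stubs are equivalent to their
  restrictions to real elements of the core (`coreFixedLogFree_iff_real`,
  `coreFixedFieldLogFree_iff_real`) — the analogue of §5's `dcl(∅) ⊆ ℝ`; with `conj` the presently
  known part of `Aut_E(C₀)` is exhausted, so EVERY further instance needs a new automorphism of the
  countable E-field `C₀` (and one moving `ln 2` is already `π ⊥ ln 2`, support `EndomorphismMovingLogTwo`);
* `CountableVariant` (§10) is the warning sign for the line: `stub_definableDichotomy` puts countable
  definable sets inside `ecl ∅`, but the passage `ecl ∅ ↝ C_EA` is false for countable sets under SC —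
  the residue must use that orbits are FINITE, not merely countable. -/

section Targets

open Literature.NumberTheory.Transcendental

/-- Complex conjugation as an isomorphism of exponential rings `ℂ_exp ≃ ℂ_exp`. -/
def conjExpEquiv : ExponentialRingEquiv ℂ ℂ where
  toRingEquiv := starRingAut
  map_exp' x := by
    change star (Complex.exp x) = Complex.exp (star x)
    exact (Complex.exp_conj x).symm

@[simp] theorem conjExpEquiv_apply (z : ℂ) : conjExpEquiv z = (starRingEnd ℂ) z := rfl

/-- Conjugation maps the countable core `ecl ∅` onto itself (functoriality of `ecl`,
`Khovanskii.image_ecl_equiv`). -/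
theorem conj_image_ecl_empty : (starRingEnd ℂ) '' ecl (∅ : Set ℂ) = ecl (∅ : Set ℂ) := by
  have h := Khovanskii.image_ecl_equiv conjExpEquiv (∅ : Set ℂ)
  rw [Set.image_empty] at h
  have hc : (⇑conjExpEquiv : ℂ → ℂ) = (starRingEnd ℂ) := funext fun z => rfl
  rw [hc] at h
  exact h

/-- `ecl ∅` is `conj`-stable. -/
theorem conj_mem_ecl_empty {a : ℂ} (ha : a ∈ ecl (∅ : Set ℂ)) :
    (starRingEnd ℂ) a ∈ ecl (∅ : Set ℂ) := by
  rw [← conj_image_ecl_empty]; exact ⟨a, ha, rfl⟩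

/-- `conj|_{C₀} ∈ Aut_E(C₀)` in the presentation of line `eac-homogeneity-collapse`. -/
def conjCore : ExponentialRingEquiv (Khovanskii.eclSubfield (∅ : Set ℂ))
    (Khovanskii.eclSubfield (∅ : Set ℂ)) where
  toFun a := ⟨(starRingEnd ℂ) a, conj_mem_ecl_empty a.2⟩
  invFun a := ⟨(starRingEnd ℂ) a, conj_mem_ecl_empty a.2⟩
  left_inv a := Subtype.ext (Complex.conj_conj _)
  right_inv a := Subtype.ext (Complex.conj_conj _)
  map_mul' a b := Subtype.ext (map_mul (starRingEnd ℂ) _ _)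
  map_add' a b := Subtype.ext (map_add (starRingEnd ℂ) _ _)
  map_exp' a := Subtype.ext (by
    change (starRingEnd ℂ) (Complex.exp (a : ℂ)) = Complex.exp ((starRingEnd ℂ) (a : ℂ))
    exact (Complex.exp_conj _).symm)

@[simp] theorem coe_conjCore_apply (a : Khovanskii.eclSubfield (∅ : Set ℂ)) :
    ((conjCore a : Khovanskii.eclSubfield (∅ : Set ℂ)) : ℂ) = (starRingEnd ℂ) a := rfl

/-- **An element of `C₀` fixed by every E-automorphism of `C₀` is real.** -/
theorem exists_eq_ofReal_of_forall_equiv_fixed (a : Khovanskii.eclSubfield (∅ : Set ℂ))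
    (hfix : ∀ θ : ExponentialRingEquiv (Khovanskii.eclSubfield (∅ : Set ℂ))
      (Khovanskii.eclSubfield (∅ : Set ℂ)), θ a = a) :
    ∃ r : ℝ, (a : ℂ) = r := by
  have h := congrArg (fun x : Khovanskii.eclSubfield (∅ : Set ℂ) => (x : ℂ)) (hfix conjCore)
  simp only [coe_conjCore_apply] at h
  obtain ⟨r, hr⟩ := Complex.conj_eq_iff_real.1 h
  exact ⟨r, hr⟩

/-- `stub_coreFixedLogFree` (line `eac-homogeneity-collapse`) is equivalent to its restriction to
REAL elements of the core. -/
theorem coreFixedLogFree_iff_real :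
    (∀ a : Khovanskii.eclSubfield (∅ : Set ℂ),
      (∀ θ : ExponentialRingEquiv (Khovanskii.eclSubfield (∅ : Set ℂ))
        (Khovanskii.eclSubfield (∅ : Set ℂ)), θ a = a) → (a : ℂ) ∈ logFreeCore) ↔
    (∀ a : Khovanskii.eclSubfield (∅ : Set ℂ), (∃ r : ℝ, (a : ℂ) = r) →
      (∀ θ : ExponentialRingEquiv (Khovanskii.eclSubfield (∅ : Set ℂ))
        (Khovanskii.eclSubfield (∅ : Set ℂ)), θ a = a) → (a : ℂ) ∈ logFreeCore) :=
  ⟨fun h a _ hfix => h a hfix,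
    fun h a hfix => h a (exists_eq_ofReal_of_forall_equiv_fixed a hfix) hfix⟩

/-- `conj ∈ Aut_E(C₀)` in the presentation of line `eac-extends-core-automorphisms`. -/
theorem isEIsoOn_conj_ecl_empty :
    IsEIsoOn (starRingEnd ℂ) (ecl (∅ : Set ℂ)) (ecl (∅ : Set ℂ)) where
  bijOn := ⟨fun _ ha => conj_mem_ecl_empty ha, (starRingEnd ℂ).injective.injOn,
    fun b hb => ⟨_, conj_mem_ecl_empty hb, Complex.conj_conj b⟩⟩
  map_add := fun u v _ _ => map_add _ u v
  map_mul := fun u v _ _ => map_mul _ u v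
  map_exp := fun u _ => by
    change (starRingEnd ℂ) (Complex.exp u) = Complex.exp ((starRingEnd ℂ) u)
    exact (Complex.exp_conj u).symm

/-- **An element fixed by every `g` with `IsEIsoOn g (ecl ∅) (ecl ∅)` is real.** -/
theorem exists_eq_ofReal_of_forall_isEIsoOn_fixed {a : ℂ}
    (hfix : ∀ g : ℂ → ℂ, IsEIsoOn g (ecl (∅ : Set ℂ)) (ecl (∅ : Set ℂ)) → g a = a) :
    ∃ r : ℝ, a = r := by
  obtain ⟨r, hr⟩ := Complex.conj_eq_iff_real.1 (hfix _ isEIsoOn_conj_ecl_empty)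
  exact ⟨r, hr⟩

/-- `stub_coreFixedField_logFree` (line `eac-extends-core-automorphisms`) is equivalent to its
restriction to REAL elements of `ecl ∅`. -/
theorem coreFixedFieldLogFree_iff_real :
    (∀ a ∈ ecl (∅ : Set ℂ),
      (∀ g : ℂ → ℂ, IsEIsoOn g (ecl (∅ : Set ℂ)) (ecl (∅ : Set ℂ)) → g a = a) →
        a ∈ (logFreeCore : Set ℂ)) ↔
    (∀ a ∈ ecl (∅ : Set ℂ), (∃ r : ℝ, a = r) →
      (∀ g : ℂ → ℂ, IsEIsoOn g (ecl (∅ : Set ℂ)) (ecl (∅ : Set ℂ)) → g a = a) →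
        a ∈ (logFreeCore : Set ℂ)) :=
  ⟨fun h a ha _ hfix => h a ha hfix,
    fun h a ha hfix => h a ha (exists_eq_ofReal_of_forall_isEIsoOn_fixed hfix) hfix⟩

end Targets


/-! ## §12 Calibration: (A) is at least as hard as the parameter-free Koiran conjecture
(formal half landed: `Negative/RealDefinableCalibration.lean`) -/

/-- The real points of the `exp`-preimage of a finite set form a finite set (`exp` is injective on
`ℝ`). -/
theorem finite_real_exp_preimage {t : Set ℂ} (ht : t.Finite) :
    {z : ℂ | Complex.exp z ∈ t ∧ z ∈ Set.range ((↑) : ℝ → ℂ)}.Finite := by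
  refine Set.Finite.of_finite_image (f := Complex.exp) (ht.subset ?_) ?_
  · rintro _ ⟨z, hz, rfl⟩; exact hz.1
  · rintro z ⟨-, ⟨r, rfl⟩⟩ w ⟨-, ⟨s, rfl⟩⟩ h
    have h' : Real.exp r = Real.exp s := by
      apply Complex.ofReal_injective
      simpa [Complex.ofReal_exp] using h
    rw [Real.exp_eq_exp.1 h']

/-- If `ℝ` is `∅`-definable, so is the set of real points of the `exp`-preimage of an `∅`-definable
set. -/
theorem definable₁_real_exp_preimage
    (hR : Set.Definable₁ (∅ : Set ℂ) Language.expRing (Set.range ((↑) : ℝ → ℂ)))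
    {t : Set ℂ} (ht : Set.Definable₁ (∅ : Set ℂ) Language.expRing t) :
    Set.Definable₁ (∅ : Set ℂ) Language.expRing
      {z : ℂ | Complex.exp z ∈ t ∧ z ∈ Set.range ((↑) : ℝ → ℂ)} :=
  definable_setOf_and_params
    (definable_mem_of_definable₁ ht (definableFun_cexp (definableFun_proj_params _)))
    (definable_mem_of_definable₁ hR (definableFun_proj_params _))

/-- **FORMAL HALF OF THE CALIBRATION: (A) + `Def_∅(ℝ)` ⇒ `C_EA ∩ ℝ_{>0}` is closed under the real
logarithm** (tightness §8: `a ∈ C_EA` lies in a finite `∅`-definable `t`; `{z ∈ ℝ | e^z ∈ t}` is finite,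
`∅`-definable and contains `ln a`). -/
theorem log_mem_logFreeCore_of_real_definable
    (hA : Summit.Schanuel.Schanuel.Theses.RigidCore.AclSubsetLogFreeCore)
    (hR : Set.Definable₁ (∅ : Set ℂ) Language.expRing (Set.range ((↑) : ℝ → ℂ)))
    {a : ℝ} (ha0 : 0 < a) (ha : (a : ℂ) ∈ logFreeCore) :
    (Real.log a : ℂ) ∈ logFreeCore := by
  obtain ⟨t, htfin, htdef, hat⟩ := logFreeCore_subset_expAcl ha
  rw [crux_iff] at hA
  refine hA ⟨_, finite_real_exp_preimage htfin, definable₁_real_exp_preimage hR htdef, ?_, ⟨_, rfl⟩⟩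
  show Complex.exp (Real.log a : ℂ) ∈ t
  rwa [← Complex.ofReal_exp, Real.exp_log ha0]

/-- Hence **(A) + `Def_∅(ℝ)` ⇒ `ln 2, ln π, ln ln π ∈ C_EA = K_ω`**, each contradicting SC (`K_ω` is the
FREE EA-closure of `ℚ(2πi)`): **(A) ∧ SC ⇒ `ℝ` is not `∅`-definable in `ℂ_exp`** — the parameter-free
Koiran / Zilber–Wilkie (1993) question, open.  A proof of (A) is, modulo SC, a proof of that. -/
theorem log_two_mem_logFreeCore_of_real_definable
    (hA : Summit.Schanuel.Schanuel.Theses.RigidCore.AclSubsetLogFreeCore)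
    (hR : Set.Definable₁ (∅ : Set ℂ) Language.expRing (Set.range ((↑) : ℝ → ℂ))) :
    (Real.log 2 : ℂ) ∈ logFreeCore := by
  have h := log_mem_logFreeCore_of_real_definable hA hR (a := 2) two_pos (by simp)
  simpa using h

theorem log_pi_mem_logFreeCore_of_real_definable
    (hA : Summit.Schanuel.Schanuel.Theses.RigidCore.AclSubsetLogFreeCore)
    (hR : Set.Definable₁ (∅ : Set ℂ) Language.expRing (Set.range ((↑) : ℝ → ℂ))) :
    (Real.log Real.pi : ℂ) ∈ logFreeCore :=
  log_mem_logFreeCore_of_real_definable hA hR Real.pi_pos pi_mem_logFreeCore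

theorem log_log_pi_mem_logFreeCore_of_real_definable
    (hA : Summit.Schanuel.Schanuel.Theses.RigidCore.AclSubsetLogFreeCore)
    (hR : Set.Definable₁ (∅ : Set ℂ) Language.expRing (Set.range ((↑) : ℝ → ℂ))) :
    (Real.log (Real.log Real.pi) : ℂ) ∈ logFreeCore :=
  log_mem_logFreeCore_of_real_definable hA hR
    (Real.log_pos (by linarith [Real.pi_gt_three])) (log_pi_mem_logFreeCore_of_real_definable hA hR)


/-- **CALIBRATION (paper theorem; recorded `sorry`d — the Lean obstruction is infrastructural, not
mathematical).**  (A) implies that `ℝ` is NOT `∅`-definable in `ℂ_exp` (the parameter-free case of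
Koiran's conjecture / KMO 2012 p.2 "second main open question"; Wilkie 2024, *Model Theory* 3:3,
p.701: "If the set of reals was also definable then the situation would indeed be hopeless"), and by
§9 even that `ℝ` is not definable with parameters from `C_EA`.
Paper proof.  Suppose `ℝ = φ(ℂ)` for an `∅`-formula `φ`.  Then `<` (`y − x ∈ ℝ²`), `ℤ`
(`definable₁_int`) and `ℕ` (four squares) are `∅`-definable, so every real that is first-order
definable in `(ℝ, +, ·, <, ℤ)` is in `dcl^{ℂ_exp}(∅)`; that structure defines `n ↦ 2ⁿ` on `ℕ`
(Gödel β) and binary digits (`⌊2ⁿx⌋ mod 2`), hence the real `h = Σ_{n ∈ H} 2^{-n-1}` for the halting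
set `H` (Σ⁰₁ in `(ℕ, +, ·)`) is `∅`-definable: `h ∈ dcl^{ℂ_exp}(∅)`.  But every element of
`C_EA = K_ω` (§3) is a COMPUTABLE complex number (`2πi` is; computable numbers form a field closed
under `exp`; each root of a non-zero polynomial with computable coefficients is computable — Rice
1954), while `h` is not computable (`H` undecidable).  So `h ∈ dcl(∅) ∖ C_EA`, contradicting
`crux_iff_expDcl`.  ∎  Consequences: (i) any proof of (A) proves a 30-year-old open undefinability
statement about `ℂ_exp`; (ii) conversely `Def_∅(ℝ)` would refute (A) OUTRIGHT (no SC needed) — the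
only presently conceivable unconditional kill, and it is Koiran-hard.  Formalising needs a computable-
analysis library (computable reals/complexes closed under field operations, `exp` and polynomial
roots) plus the definability of a non-computable real in `(ℝ, +, ·, ℤ)`: thousands of lines, none in
the tree or Mathlib. -/
theorem crux_imp_real_not_definable :
    Summit.Schanuel.Schanuel.Theses.RigidCore.AclSubsetLogFreeCore →
      ¬ Set.Definable₁ (∅ : Set ℂ) Language.expRing (Set.range ((↑) : ℝ → ℂ)) := by
  sorry



/-! ## §13 (gen 4) The hub `ln 2 ∈ dcl^{ℂ_exp}(∅)` (landing: `Negative/LogTwoHub.lean`,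
`Negative/LogTwoBranchRelations.lean`)

Everything for or against (A) that is presently conceivable passes through ONE statement, the pointwise
`∅`-definability of the real logarithm of `2`.  (A) restricted to the branch set `T₂` IS the implication
`ln 2 ∈ dcl(∅) → ln 2 ∈ C_EA`; accidental algebraic relations between branches of `log 2` and `log 3`
(irrefutable today) would put `ln 2` in `dcl(∅)` (modulo the route's Baker-level support Theorem L), so
(A) implies "`ln 2 ∈ C_EA` or all-branch algebraic independence of `log 2, log 3`" — (A) is not soft;
and a refutation of (A) compatible with Zilber's EAC must exhibit an exponentially algebraic, pointwise
definable real outside `C_EA`, in particular prove `C₀ ⊄ C_EA`, which no known transcendence result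
yields.  Uses the lead's landed `RigidCore.expDcl_subset_ecl_of_eac` (stub 2 of the EAC line). -/

section Hub

open Literature.NumberTheory.Transcendental

/-! ### §13.1 The branch set `T₂` of logarithms of `2` -/

/-- `T₂ = {z | e^z = 2}`, the set of all complex logarithms of `2`. -/
def logTwoBranches : Set ℂ := {z | Complex.exp z = 2}

/-- `ln 2 ∈ T₂`. [folklore] -/
theorem log_two_mem_logTwoBranches : (Real.log 2 : ℂ) ∈ logTwoBranches := exp_log_two

/-- `T₂ = ln 2 + 2πiℤ`. [folklore] -/
theorem mem_logTwoBranches_iff {z : ℂ} :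
    z ∈ logTwoBranches ↔ ∃ k : ℤ, z = Real.log 2 + k * (2 * Real.pi * Complex.I) := by
  simp only [logTwoBranches, Set.mem_setOf_eq]
  conv_lhs => rw [← exp_log_two]
  exact Complex.exp_eq_exp_iff_exists_int

/-- `ln 2 + 2πik ∈ T₂`. [folklore] -/
theorem log_two_add_mem_logTwoBranches (k : ℤ) :
    (Real.log 2 : ℂ) + k * (2 * Real.pi * Complex.I) ∈ logTwoBranches :=
  mem_logTwoBranches_iff.2 ⟨k, rfl⟩

/-- Every logarithm of `2` has real part `ln 2`. [folklore] -/
theorem re_eq_log_two_of_mem {z : ℂ} (hz : z ∈ logTwoBranches) : z.re = Real.log 2 := by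
  obtain ⟨k, rfl⟩ := mem_logTwoBranches_iff.1 hz
  simp only [Complex.add_re, Complex.ofReal_re, Complex.mul_re, Complex.mul_im, Complex.intCast_re,
    Complex.intCast_im, Complex.I_re, Complex.I_im, Complex.ofReal_im, Complex.re_ofNat,
    Complex.im_ofNat]
  ring

/-- `T₂` is `∅`-definable (by the quantifier-free formula `e^z = 1 + 1`). [folklore] -/
theorem definable₁_logTwoBranches :
    Set.Definable₁ (∅ : Set ℂ) Language.expRing logTwoBranches := by
  unfold Set.Definable₁
  simp only [logTwoBranches, Set.mem_setOf_eq]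
  have h2 : (∅ : Set ℂ).DefinableFun Language.expRing (fun _ : Fin 1 → ℂ => (2 : ℂ)) := by
    simpa using definableFun_natCast' (A := (∅ : Set ℂ)) (α := Fin 1) 2
  exact definable_setOf_eq_params (definableFun_cexp (definableFun_proj_params _)) h2

/-- `ln 2 + 2πik ∈ C_EA ⟺ ln 2 ∈ C_EA` (`2πi ∈ C_EA`). -/
theorem branch_mem_logFreeCore_iff (k : ℤ) :
    (Real.log 2 : ℂ) + k * (2 * Real.pi * Complex.I) ∈ logFreeCore ↔
      (Real.log 2 : ℂ) ∈ logFreeCore := by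
  have hk : (k : ℂ) * (2 * Real.pi * Complex.I) ∈ logFreeCore :=
    mul_mem (intCast_mem logFreeCore k) two_pi_I_mem_logFreeCore
  refine ⟨fun h => ?_, fun h => add_mem h hk⟩
  have := sub_mem h hk
  rwa [add_sub_cancel_right] at this

/-! ### §13.2 Two closure properties of `dcl(∅)` -/

/-- `dcl(∅)` is closed under `c ↦ -c/n` (`n ≥ 1`). [folklore] -/
theorem neg_div_natCast_mem_expDcl {c : ℂ} (hc : c ∈ expDcl) {n : ℕ} (hn : n ≠ 0) :
    -c / (n : ℂ) ∈ expDcl := by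
  have hdef : Set.Definable₁ (∅ : Set ℂ) Language.expRing
      {y : ℂ | ∃ x : ℂ, x ∈ ({c} : Set ℂ) ∧ (n : ℂ) * y + x = 0} := by
    unfold Set.Definable₁
    simp only [Set.mem_setOf_eq]
    refine definable_setOf_exists_params (definable_setOf_and_params ?_ ?_)
    · exact definable_mem_of_definable₁ hc (definableFun_proj_params _)
    · exact definable_setOf_eq_params
        (definableFun_add' (definableFun_mul' (definableFun_natCast' n)
          (definableFun_proj_params _)) (definableFun_proj_params _)) definableFun_zero'
  have hn' : (n : ℂ) ≠ 0 := Nat.cast_ne_zero.2 hn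
  have heq : {y : ℂ | ∃ x : ℂ, x ∈ ({c} : Set ℂ) ∧ (n : ℂ) * y + x = 0} = {-c / (n : ℂ)} := by
    ext y
    simp only [Set.mem_setOf_eq, Set.mem_singleton_iff, exists_eq_left]
    constructor
    · intro h
      field_simp
      linear_combination h
    · rintro rfl
      field_simp
      ring
  show Set.Definable₁ _ _ _
  rw [← heq]
  exact hdef

/-- `dcl(∅)` is closed under `c ↦ e^{c/n}` (`n ≥ 1`). [folklore] -/
theorem exp_div_natCast_mem_expDcl {c : ℂ} (hc : c ∈ expDcl) {n : ℕ} (hn : n ≠ 0) :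
    Complex.exp (c / (n : ℂ)) ∈ expDcl := by
  have hdef : Set.Definable₁ (∅ : Set ℂ) Language.expRing
      {y : ℂ | ∃ u : ℂ, (n : ℂ) * u ∈ ({c} : Set ℂ) ∧ y = Complex.exp u} := by
    unfold Set.Definable₁
    simp only [Set.mem_setOf_eq]
    refine definable_setOf_exists_params (definable_setOf_and_params ?_ ?_)
    · exact definable_mem_of_definable₁ hc
        (definableFun_mul' (definableFun_natCast' n) (definableFun_proj_params _))
    · exact definable_setOf_eq_params (definableFun_proj_params _)
        (definableFun_cexp (definableFun_proj_params _))
  have hn' : (n : ℂ) ≠ 0 := Nat.cast_ne_zero.2 hn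
  have heq : {y : ℂ | ∃ u : ℂ, (n : ℂ) * u ∈ ({c} : Set ℂ) ∧ y = Complex.exp u} =
      {Complex.exp (c / (n : ℂ))} := by
    ext y
    simp only [Set.mem_setOf_eq, Set.mem_singleton_iff]
    constructor
    · rintro ⟨u, hu, rfl⟩
      have : u = c / (n : ℂ) := by
        rw [← hu]; field_simp
      rw [this]
    · rintro rfl
      exact ⟨c / (n : ℂ), by field_simp, rfl⟩
  show Set.Definable₁ _ _ _
  rw [← heq]
  exact hdef

/-! ### §13.3 Conjugation averaging: `T₂ ∩ acl(∅) ≠ ∅ ⟺ ln 2 ∈ dcl(∅)` -/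

/-- `conj` permutes every finite `∅`-definable set. [folklore] -/
theorem image_conj_toFinset_eq {F : Set ℂ} (hF : F.Finite)
    (hdef : Set.Definable₁ (∅ : Set ℂ) Language.expRing F) :
    hF.toFinset.image (starRingEnd ℂ) = hF.toFinset := by
  apply Finset.eq_of_subset_of_card_le
  · intro y hy
    obtain ⟨x, hx, rfl⟩ := Finset.mem_image.1 hy
    exact hF.mem_toFinset.2 (conj_mem_of_definable₁ hdef (hF.mem_toFinset.1 hx))
  · rw [Finset.card_image_of_injective _ (starRingEnd ℂ).injective]

/-- The sum of a finite `∅`-definable set is real. [folklore] -/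
theorem sum_im_eq_zero_of_definable {F : Set ℂ} (hF : F.Finite)
    (hdef : Set.Definable₁ (∅ : Set ℂ) Language.expRing F) :
    (∑ y ∈ hF.toFinset, y).im = 0 := by
  have h : ∑ y ∈ hF.toFinset, y = ∑ y ∈ hF.toFinset, (starRingEnd ℂ) y := by
    conv_lhs => rw [← image_conj_toFinset_eq hF hdef]
    rw [Finset.sum_image fun x _ y _ h => (starRingEnd ℂ).injective h]
  have h2 : (∑ y ∈ hF.toFinset, y).im = -(∑ y ∈ hF.toFinset, y).im := by
    conv_lhs => rw [h]
    rw [← map_sum, Complex.conj_im]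
  linarith

/-- **Conjugation averaging.** If a finite non-empty `∅`-definable set consists of logarithms of `2`,
then `ln 2` is pointwise `∅`-definable: the set is `conj`-stable, so its sum is `|F|·ln 2`, and the
sum is (minus) a coefficient of its root polynomial, an `∅`-definable point. -/
theorem log_two_mem_expDcl_of_finite_definable_subset {F : Set ℂ} (hF : F.Finite)
    (hdef : Set.Definable₁ (∅ : Set ℂ) Language.expRing F) (hsub : F ⊆ logTwoBranches)
    (hne : F.Nonempty) : (Real.log 2 : ℂ) ∈ expDcl := by
  have hNpos : 0 < hF.toFinset.card :=
    Finset.card_pos.2 ((Set.Finite.toFinset_nonempty hF).2 hne)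
  have hN' : (hF.toFinset.card : ℂ) ≠ 0 := Nat.cast_ne_zero.2 hNpos.ne'
  have hsum : ∑ y ∈ hF.toFinset, y = (hF.toFinset.card : ℂ) * Real.log 2 := by
    apply Complex.ext
    · rw [Complex.re_sum]
      have : ∀ y ∈ hF.toFinset, y.re = Real.log 2 := fun y hy =>
        re_eq_log_two_of_mem (hsub (hF.mem_toFinset.1 hy))
      rw [Finset.sum_congr rfl this, Finset.sum_const, nsmul_eq_mul]
      simp only [Complex.mul_re, Complex.natCast_re, Complex.natCast_im, Complex.ofReal_re,
        Complex.ofReal_im]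
      ring
    · rw [sum_im_eq_zero_of_definable hF hdef]
      simp only [Complex.mul_im, Complex.natCast_re, Complex.natCast_im, Complex.ofReal_re,
        Complex.ofReal_im]
      ring
  have hc : (∏ y ∈ hF.toFinset, (Polynomial.X - Polynomial.C y)).coeff (hF.toFinset.card - 1) =
      -((hF.toFinset.card : ℂ) * Real.log 2) := by
    have h := Polynomial.prod_X_sub_C_coeff_card_pred hF.toFinset (fun y : ℂ => y) hNpos
    rw [h, hsum]
  have hcoeff : -((hF.toFinset.card : ℂ) * Real.log 2) ∈ expDcl :=
    hc ▸ coeff_mem_expDcl hF hdef _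
  have h := neg_div_natCast_mem_expDcl hcoeff hNpos.ne'
  rwa [neg_neg, mul_div_cancel_left₀ _ hN'] at h

/-- **`ln 2 ∈ dcl(∅)` iff SOME branch `ln 2 + 2πik` is `∅`-algebraic** (lies in a finite `∅`-definable
set): intersect that set with `T₂` and average. -/
theorem log_two_mem_expDcl_iff_exists_branch_mem_expAcl :
    (Real.log 2 : ℂ) ∈ expDcl ↔
      ∃ k : ℤ, (Real.log 2 : ℂ) + k * (2 * Real.pi * Complex.I) ∈ expAcl := by
  constructor
  · intro h
    exact ⟨0, by simpa using expDcl_subset_expAcl h⟩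
  · rintro ⟨k, s, hs, hdef, hks⟩
    exact log_two_mem_expDcl_of_finite_definable_subset (F := s ∩ logTwoBranches)
      (hs.inter_of_left _) (hdef.inter definable₁_logTwoBranches) Set.inter_subset_right
      ⟨_, hks, log_two_add_mem_logTwoBranches k⟩

/-- For the real logarithm of `2`, `∅`-algebraic = `∅`-definable. -/
theorem log_two_mem_expAcl_iff_mem_expDcl :
    (Real.log 2 : ℂ) ∈ expAcl ↔ (Real.log 2 : ℂ) ∈ expDcl :=
  ⟨fun h => log_two_mem_expDcl_iff_exists_branch_mem_expAcl.2 ⟨0, by simpa using h⟩,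
    fun h => expDcl_subset_expAcl h⟩

/-- Every branch of `log 2` is `∅`-algebraic as soon as `ln 2` is `∅`-definable, and conversely. -/
theorem branch_mem_expAcl_iff (k : ℤ) :
    (Real.log 2 : ℂ) + k * (2 * Real.pi * Complex.I) ∈ expAcl ↔ (Real.log 2 : ℂ) ∈ expDcl := by
  refine ⟨fun h => log_two_mem_expDcl_iff_exists_branch_mem_expAcl.2 ⟨k, h⟩, fun h => ?_⟩
  exact add_mem_expAcl (expDcl_subset_expAcl h)
    (mul_mem_expAcl (intCast_mem_expAcl k) two_pi_I_mem_expAcl)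

/-! ### §13.4 (A) at the branch set -/

/-- **(A) restricted to `T₂`** is exactly the implication `ln 2 ∈ dcl(∅) → ln 2 ∈ C_EA`. -/
theorem aclSubsetLogFreeCore_at_branches_iff :
    (∀ k : ℤ, (Real.log 2 : ℂ) + k * (2 * Real.pi * Complex.I) ∈ expAcl →
        (Real.log 2 : ℂ) + k * (2 * Real.pi * Complex.I) ∈ logFreeCore) ↔
      ((Real.log 2 : ℂ) ∈ expDcl → (Real.log 2 : ℂ) ∈ logFreeCore) := by
  constructor
  · intro h hd
    have := h 0 ((branch_mem_expAcl_iff 0).2 hd)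
    simpa using this
  · intro h k hk
    exact (branch_mem_logFreeCore_iff k).2 (h ((branch_mem_expAcl_iff k).1 hk))

/-- (A) turns the hub `ln 2 ∈ dcl(∅)` into the SC-false `ln 2 ∈ C_EA`. -/
theorem log_two_mem_logFreeCore_of_crux
    (hA : Summit.Schanuel.Schanuel.Theses.RigidCore.AclSubsetLogFreeCore)
    (h : (Real.log 2 : ℂ) ∈ expDcl) : (Real.log 2 : ℂ) ∈ logFreeCore :=
  crux_iff.1 hA (expDcl_subset_expAcl h)

/-- **Dichotomy.** (A) ⇒ `ln 2 ∈ C_EA` (SC-false) ∨ no branch of `log 2` is `∅`-algebraic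
(`T₂ ∩ acl(∅) = ∅`: no parameter-free formula isolates a finite non-empty set of branches). -/
theorem logFree_or_branches_disjoint_acl_of_crux
    (hA : Summit.Schanuel.Schanuel.Theses.RigidCore.AclSubsetLogFreeCore) :
    (Real.log 2 : ℂ) ∈ logFreeCore ∨
      ∀ k : ℤ, (Real.log 2 : ℂ) + k * (2 * Real.pi * Complex.I) ∉ expAcl := by
  by_cases h : (Real.log 2 : ℂ) ∈ expDcl
  · exact Or.inl (log_two_mem_logFreeCore_of_crux hA h)
  · exact Or.inr fun k hk => h ((branch_mem_expAcl_iff k).1 hk)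

/-! ### §13.5 Accidental relations between branches of `log 2` and `log 3` feed the hub -/

/-- `e^{ln 3} = 3` in `ℂ`. [folklore] -/
theorem exp_log_three : Complex.exp (Real.log 3 : ℂ) = 3 := by
  rw [← Complex.ofReal_exp, Real.exp_log three_pos]; norm_num

/-- The set `s_R = {x | e^x = 2 ∧ ∃ w (e^w = 3 ∧ R(x, w) = 0)}` of branches of `log 2` algebraically
related (through `R ∈ ℤ[X, W]`) to some branch of `log 3`. -/
def branchRelationSet (R : MvPolynomial (Fin 2) ℤ) : Set ℂ :=
  {x | Complex.exp x = 2 ∧ ∃ w : ℂ, Complex.exp w = 3 ∧ MvPolynomial.aeval ![x, w] R = 0}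

/-- `s_R ⊆ T₂`. -/
theorem branchRelationSet_subset (R : MvPolynomial (Fin 2) ℤ) :
    branchRelationSet R ⊆ logTwoBranches := fun _ h => h.1

/-- Polynomial maps with integer coefficients in re-indexed variables are `∅`-definable. -/
theorem definableFun_aeval_comp {α : Type*} {n : ℕ} (Q : MvPolynomial (Fin n) ℤ) (ι : Fin n → α) :
    (∅ : Set ℂ).DefinableFun Language.expRing
      (fun w : α → ℂ => MvPolynomial.aeval (fun i => w (ι i)) Q) :=
  definableFun_reindex (definableFun_mvPolynomial_aeval Q) ι

/-- `s_R` is `∅`-definable (an `∃`-formula with integer coefficients). -/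
theorem definable₁_branchRelationSet (R : MvPolynomial (Fin 2) ℤ) :
    Set.Definable₁ (∅ : Set ℂ) Language.expRing (branchRelationSet R) := by
  unfold Set.Definable₁
  simp only [branchRelationSet, Set.mem_setOf_eq]
  have h2 : (∅ : Set ℂ).DefinableFun Language.expRing (fun _ : Fin 1 → ℂ => (2 : ℂ)) := by
    simpa using definableFun_natCast' (A := (∅ : Set ℂ)) (α := Fin 1) 2
  have h3 : (∅ : Set ℂ).DefinableFun Language.expRing (fun _ : Fin 1 ⊕ Unit → ℂ => (3 : ℂ)) := by
    simpa using definableFun_natCast' (A := (∅ : Set ℂ)) (α := Fin 1 ⊕ Unit) 3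
  have hR : (∅ : Set ℂ).DefinableFun Language.expRing
      (fun w : Fin 1 ⊕ Unit → ℂ => MvPolynomial.aeval ![w (Sum.inl 0), w (Sum.inr ())] R) := by
    have h := definableFun_aeval_comp R (![Sum.inl 0, Sum.inr ()] : Fin 2 → Fin 1 ⊕ Unit)
    convert h using 1
    funext w
    have hv : (![w (Sum.inl 0), w (Sum.inr ())] : Fin 2 → ℂ) =
        fun i => w ((![Sum.inl 0, Sum.inr ()] : Fin 2 → Fin 1 ⊕ Unit) i) := by
      ext i; fin_cases i <;> rfl
    rw [hv]
  refine definable_setOf_and_params ?_ ?_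
  · exact definable_setOf_eq_params (definableFun_cexp (definableFun_proj_params _)) h2
  · refine definable_setOf_exists_params (definable_setOf_and_params ?_ ?_)
    · exact definable_setOf_eq_params (definableFun_cexp (definableFun_proj_params _)) h3
    · exact definable_setOf_eq_params hR definableFun_zero'

/-- `ln 2, ln 3, 2πi` are `ℚ`-linearly independent (`2^a 3^b ≠ 1`). [folklore] -/
theorem linearIndependent_log_two_log_three_two_pi_I :
    LinearIndependent ℚ ![(Real.log 2 : ℂ), (Real.log 3 : ℂ), 2 * Real.pi * Complex.I] := by
  rw [Fintype.linearIndependent_iff]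
  intro g hg
  simp only [Fin.sum_univ_three, Matrix.cons_val_zero, Matrix.cons_val_one,
    Matrix.cons_val_two, Matrix.tail_cons, Matrix.head_cons, Rat.smul_def] at hg
  have him := congrArg Complex.im hg
  have hre := congrArg Complex.re hg
  simp only [Complex.add_im, Complex.mul_im, Complex.ratCast_re, Complex.ratCast_im,
    Complex.ofReal_re, Complex.ofReal_im, Complex.add_re, Complex.mul_re, Complex.I_re,
    Complex.I_im, Complex.re_ofNat, Complex.im_ofNat, Complex.zero_re, Complex.zero_im,
    mul_zero, zero_mul, sub_zero, add_zero, mul_one, zero_add] at him hre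
  -- him : g 2 * (2 * π) = 0 ;  hre : g 0 * log 2 + g 1 * log 3 = 0
  have h2 : g 2 = 0 := by
    have : (g 2 : ℝ) = 0 := by
      rcases mul_eq_zero.1 him with h | h
      · exact h
      · exfalso; linarith [Real.pi_pos]
    exact_mod_cast this
  -- the real equation
  have h01 : g 0 = 0 ∧ g 1 = 0 := by
    have hlog2 : Real.log 2 ≠ 0 := by positivity
    by_cases hb : g 1 = 0
    · refine ⟨?_, hb⟩
      rw [hb] at hre
      have : (g 0 : ℝ) * Real.log 2 = 0 := by simpa using hre
      rcases mul_eq_zero.1 this with h | h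
      · exact_mod_cast h
      · exact absurd h hlog2
    · exfalso
      -- ln 3 = q ln 2 with q = -g 0 / g 1, so 3 = 2 ^ q
      set q : ℚ := -g 0 / g 1 with hq
      have hb' : (g 1 : ℝ) ≠ 0 := by exact_mod_cast hb
      have hlog3 : Real.log 3 = (q : ℝ) * Real.log 2 := by
        rw [hq]; push_cast
        field_simp
        linear_combination hre
      have h3 : (3 : ℝ) = 2 ^ (q : ℝ) := by
        rw [Real.rpow_def_of_pos two_pos, mul_comm, ← hlog3, Real.exp_log three_pos]
      -- write q = n / d
      have hqnd : (q : ℝ) = (q.num : ℝ) / (q.den : ℝ) := by exact_mod_cast (Rat.num_div_den q).symm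
      have hdpos : 0 < q.den := q.den_pos
      have h3d : (3 : ℝ) ^ (q.den : ℕ) = (2 : ℝ) ^ (q.num : ℤ) := by
        have : ((2 : ℝ) ^ (q : ℝ)) ^ (q.den : ℕ) = (2 : ℝ) ^ (q.num : ℝ) := by
          rw [← Real.rpow_natCast, ← Real.rpow_mul two_pos.le, hqnd]
          congr 1
          field_simp
        rw [h3, this, Real.rpow_intCast]
      -- the exponent `q.num` is non-negative
      have hnum : 0 ≤ q.num := by
        by_contra hneg
        push Not at hneg
        have hlt : (2 : ℝ) ^ (q.num : ℤ) < 1 := zpow_lt_one_of_neg₀ (by norm_num) hneg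
        have hge : (1 : ℝ) ≤ (3 : ℝ) ^ (q.den : ℕ) := one_le_pow₀ (by norm_num)
        linarith
      obtain ⟨n, hn⟩ := Int.eq_ofNat_of_zero_le hnum
      rw [hn, zpow_natCast] at h3d
      have hnat : (3 : ℕ) ^ q.den = 2 ^ n := by exact_mod_cast h3d
      -- parity
      rcases Nat.eq_zero_or_pos n with hn0 | hnpos
      · rw [hn0, pow_zero] at hnat
        have : q.den = 0 := (Nat.pow_eq_one.1 hnat).resolve_left (by norm_num)
        omega
      · have h2dvd : 2 ∣ 3 ^ q.den := ⟨2 ^ (n - 1), by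
          rw [hnat, ← pow_succ', Nat.sub_add_cancel hnpos]⟩
        have := Nat.Prime.dvd_of_dvd_pow Nat.prime_two h2dvd
        omega
  intro i
  fin_cases i
  · exact h01.1
  · exact h01.2
  · exact h2

/-- Injective coefficient maps preserve the total degree. [folklore] -/
theorem totalDegree_map_of_injective {σ R S : Type*} [CommSemiring R] [CommSemiring S]
    {f : R →+* S} (hf : Function.Injective f) (p : MvPolynomial σ R) :
    (MvPolynomial.map f p).totalDegree = p.totalDegree := by
  simp only [MvPolynomial.totalDegree, MvPolynomial.support_map_of_injective p hf]

/-- **Theorem L (route support `TwoLogsBranchRelationFinite`, taken as a hypothesis) makes `s_R`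
finite** for non-constant `R`. -/
theorem finite_branchRelationSet
    (hL : Summit.Schanuel.Schanuel.Theses.RigidCore.TwoLogsBranchRelationFinite)
    (R : MvPolynomial (Fin 2) ℤ) (hR : 0 < R.totalDegree) :
    (branchRelationSet R).Finite := by
  set R' : MvPolynomial (Fin 2) (algebraicClosure ℚ ℂ) :=
    MvPolynomial.map (algebraMap ℤ (algebraicClosure ℚ ℂ)) R with hR'def
  have hR' : 0 < R'.totalDegree := by
    rwa [hR'def, totalDegree_map_of_injective (algebraMap ℤ (algebraicClosure ℚ ℂ)).injective_int]
  have halg2 : IsAlgebraic ℚ (Complex.exp (Real.log 2 : ℂ)) := by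
    rw [exp_log_two]; exact_mod_cast isAlgebraic_nat (R := ℚ) (A := ℂ) 2
  have halg3 : IsAlgebraic ℚ (Complex.exp (Real.log 3 : ℂ)) := by
    rw [exp_log_three]; exact_mod_cast isAlgebraic_nat (R := ℚ) (A := ℂ) 3
  have hfin := hL (Real.log 2) (Real.log 3) halg2 halg3
    linearIndependent_log_two_log_three_two_pi_I R' hR'
  refine (hfin.image fun p : ℤ × ℤ =>
    (Real.log 2 : ℂ) + 2 * Real.pi * Complex.I * (p.1 : ℂ)).subset ?_
  rintro x ⟨hx, w, hw, hrel⟩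
  obtain ⟨j, rfl⟩ := mem_logTwoBranches_iff.1 hx
  have hw' : ∃ k : ℤ, w = Real.log 3 + k * (2 * Real.pi * Complex.I) := by
    rw [← exp_log_three, Complex.exp_eq_exp_iff_exists_int] at hw
    exact hw
  obtain ⟨k, rfl⟩ := hw'
  refine ⟨(j, k), ?_, by push_cast; ring⟩
  show MvPolynomial.aeval
      ![(Real.log 2 : ℂ) + 2 * ↑Real.pi * Complex.I * ((j, k).1 : ℂ),
        (Real.log 3 : ℂ) + 2 * ↑Real.pi * Complex.I * ((j, k).2 : ℂ)] R' = 0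
  rw [hR'def, MvPolynomial.aeval_map_algebraMap]
  convert hrel using 2
  ext i
  fin_cases i
  · simp; ring
  · simp; ring

/-- **An accidental algebraic relation between a branch of `log 2` and a branch of `log 3` makes
`ln 2` pointwise `∅`-definable** (modulo Theorem L): `s_R` is then a finite non-empty `∅`-definable
set of branches of `log 2`. -/
theorem log_two_mem_expDcl_of_branchRelation
    (hL : Summit.Schanuel.Schanuel.Theses.RigidCore.TwoLogsBranchRelationFinite)
    {R : MvPolynomial (Fin 2) ℤ} (hR : 0 < R.totalDegree) {j k : ℤ}
    (hrel : MvPolynomial.aeval ![(Real.log 2 : ℂ) + j * (2 * Real.pi * Complex.I),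
      (Real.log 3 : ℂ) + k * (2 * Real.pi * Complex.I)] R = 0) :
    (Real.log 2 : ℂ) ∈ expDcl := by
  refine log_two_mem_expDcl_of_finite_definable_subset (finite_branchRelationSet hL R hR)
    (definable₁_branchRelationSet R) (branchRelationSet_subset R) ⟨_, log_two_add_mem_logTwoBranches j,
      (Real.log 3 : ℂ) + k * (2 * Real.pi * Complex.I), ?_, hrel⟩
  rw [Complex.exp_add, exp_log_three, Complex.exp_int_mul_two_pi_mul_I, mul_one]

/-- Hence **(A) ∧ Theorem L ∧ [one relation `R(ln 2 + 2πij, ln 3 + 2πik) = 0`] ⇒ `ln 2 ∈ C_EA`**: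
the `ℂ`-shadow of the failure of (A) in a Bays–Kirby field built on an accidental relation. -/
theorem log_two_mem_logFreeCore_of_crux_of_branchRelation
    (hA : Summit.Schanuel.Schanuel.Theses.RigidCore.AclSubsetLogFreeCore)
    (hL : Summit.Schanuel.Schanuel.Theses.RigidCore.TwoLogsBranchRelationFinite)
    {R : MvPolynomial (Fin 2) ℤ} (hR : 0 < R.totalDegree) {j k : ℤ}
    (hrel : MvPolynomial.aeval ![(Real.log 2 : ℂ) + j * (2 * Real.pi * Complex.I),
      (Real.log 3 : ℂ) + k * (2 * Real.pi * Complex.I)] R = 0) :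
    (Real.log 2 : ℂ) ∈ logFreeCore :=
  log_two_mem_logFreeCore_of_crux hA (log_two_mem_expDcl_of_branchRelation hL hR hrel)

/-- **CALIBRATION: (A) is not soft.**  Granting the route's Baker-level support item Theorem L,
(A) implies: `ln 2 ∈ C_EA` (false under Schanuel's conjecture) OR `log 2` and `log 3` are
algebraically independent over `ℚ` in every pair of branches (an open problem of transcendence
theory). -/
theorem logFree_or_allBranchIndep_of_crux
    (hL : Summit.Schanuel.Schanuel.Theses.RigidCore.TwoLogsBranchRelationFinite)
    (hA : Summit.Schanuel.Schanuel.Theses.RigidCore.AclSubsetLogFreeCore) :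
    (Real.log 2 : ℂ) ∈ logFreeCore ∨
      ∀ R : MvPolynomial (Fin 2) ℤ, 0 < R.totalDegree → ∀ j k : ℤ,
        MvPolynomial.aeval ![(Real.log 2 : ℂ) + j * (2 * Real.pi * Complex.I),
          (Real.log 3 : ℂ) + k * (2 * Real.pi * Complex.I)] R ≠ 0 := by
  by_cases h : (Real.log 2 : ℂ) ∈ logFreeCore
  · exact Or.inl h
  · exact Or.inr fun R hR j k hrel =>
      h (log_two_mem_logFreeCore_of_crux_of_branchRelation hA hL hR hrel)

/-! ### §13.6 The KMO hinge: `ln 2 ∈ dcl(∅)` makes every `2^{1/n}` pointwise definable -/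

/-- `ln 2 ∈ dcl(∅) ⇒ 2^{1/n} = e^{(ln 2)/n} ∈ dcl(∅)` (`n ≥ 1`); for `n = 3` this is an algebraic
number outside `ℚ^{ab}`, which Kirby–Macintyre–Onshuus expect NOT to be `∅`-definable in `ℂ_exp`. -/
theorem root_two_mem_expDcl_of_log_two_mem_expDcl (h : (Real.log 2 : ℂ) ∈ expDcl) {n : ℕ}
    (hn : n ≠ 0) : (((2 : ℝ) ^ ((n : ℝ)⁻¹) : ℝ) : ℂ) ∈ expDcl := by
  have key : (((2 : ℝ) ^ ((n : ℝ)⁻¹) : ℝ) : ℂ) = Complex.exp ((Real.log 2 : ℂ) / (n : ℂ)) := by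
    rw [Real.rpow_def_of_pos two_pos, Complex.ofReal_exp]
    push_cast
    ring_nf
  rw [key]
  exact exp_div_natCast_mem_expDcl h hn

/-- **Symmetry ⇒ transcendence through the hub.** Granting Theorem L: if some `2^{1/n}` (`n ≥ 1`) is
NOT pointwise `∅`-definable in `ℂ_exp`, then `log 2` and `log 3` are algebraically independent over
`ℚ` in all branches. -/
theorem allBranchIndep_of_root_two_not_mem_expDcl
    (hL : Summit.Schanuel.Schanuel.Theses.RigidCore.TwoLogsBranchRelationFinite)
    {n : ℕ} (hn : n ≠ 0) (h : (((2 : ℝ) ^ ((n : ℝ)⁻¹) : ℝ) : ℂ) ∉ expDcl)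
    (R : MvPolynomial (Fin 2) ℤ) (hR : 0 < R.totalDegree) (j k : ℤ) :
    MvPolynomial.aeval ![(Real.log 2 : ℂ) + j * (2 * Real.pi * Complex.I),
      (Real.log 3 : ℂ) + k * (2 * Real.pi * Complex.I)] R ≠ 0 := fun hrel =>
  h (root_two_mem_expDcl_of_log_two_mem_expDcl (log_two_mem_expDcl_of_branchRelation hL hR hrel) hn)

/-! ### §13.7 What a refutation of (A) must do, given EAC -/

/-- A refutation of (A) is a pointwise `∅`-definable real number outside `C_EA`. -/
theorem exists_real_mem_expDcl_not_mem_of_not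
    (h : ¬ Summit.Schanuel.Schanuel.Theses.RigidCore.AclSubsetLogFreeCore) :
    ∃ r : ℝ, (r : ℂ) ∈ expDcl ∧ (r : ℂ) ∉ logFreeCore := by
  rw [crux_iff_real] at h
  push Not at h
  exact h

/-- **`¬(A) ⇒ ¬EAC ∨ (some pointwise-definable, exponentially algebraic real is not log-free)`.**
Under Zilber's exponential-algebraic closedness `dcl(∅) ⊆ acl(∅) ⊆ ecl(∅)` (landed stub
`stub_aclSubsetEcl_of_eac`), so the witness of a refutation lies in `C₀ = ecl ∅`. -/
theorem not_eac_or_exists_of_not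
    (h : ¬ Summit.Schanuel.Schanuel.Theses.RigidCore.AclSubsetLogFreeCore) :
    ¬ IsExpAlgClosed ℂ ∨
      ∃ r : ℝ, (r : ℂ) ∈ expDcl ∧ (r : ℂ) ∈ ecl (∅ : Set ℂ) ∧ (r : ℂ) ∉ logFreeCore := by
  by_cases hE : IsExpAlgClosed ℂ
  · obtain ⟨r, hr, hn⟩ := exists_real_mem_expDcl_not_mem_of_not h
    exact Or.inr ⟨r, hr, Summit.Schanuel.Schanuel.Theorems.RigidCore.expDcl_subset_ecl_of_eac hE hr, hn⟩
  · exact Or.inl hE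

/-- Equivalently: **a refutation of (A) compatible with EAC proves `C₀ ⊄ C_EA`**, i.e. that some
exponentially algebraic number is not log-free — which no presently known transcendence theorem
provides for any explicit number (`CoreAutWild`: `C₀ ≠ C_EA` is only SC-true). -/
theorem not_ecl_subset_logFreeCore_of_not_of_eac
    (h : ¬ Summit.Schanuel.Schanuel.Theses.RigidCore.AclSubsetLogFreeCore)
    (hE : IsExpAlgClosed ℂ) : ¬ (ecl (∅ : Set ℂ) ⊆ (logFreeCore : Set ℂ)) := by
  intro hsub
  rcases not_eac_or_exists_of_not h with hne | ⟨r, -, hr, hn⟩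
  · exact hne hE
  · exact hn (hsub hr)


/-! ### §13.8 Automorphisms of `ℂ_exp` and the hub -/

/-- `∅`-definable sets of tuples are stable under every automorphism of `ℂ_exp`. [folklore] -/
theorem equiv_comp_mem_of_definable {α : Type*} {s : Set (α → ℂ)}
    (hs : (∅ : Set ℂ).Definable Language.expRing s) (σ : Language.expRing.Equiv ℂ ℂ)
    {v : α → ℂ} (hv : v ∈ s) : (σ ∘ v) ∈ s := by
  obtain ⟨φ, rfl⟩ := Set.empty_definable_iff.1 hs
  exact (FirstOrder.Language.StrongHomClass.realize_formula σ φ (v := v)).2 hv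

/-- `∅`-definable subsets of `ℂ` are stable under every automorphism of `ℂ_exp`. [folklore] -/
theorem equiv_mem_of_definable₁ {s : Set ℂ} (hs : Set.Definable₁ (∅ : Set ℂ) Language.expRing s)
    (σ : Language.expRing.Equiv ℂ ℂ) {a : ℂ} (ha : a ∈ s) : σ a ∈ s :=
  equiv_comp_mem_of_definable hs σ (v := fun _ : Fin 1 => a) ha

/-- Automorphisms of `ℂ_exp` fix `dcl(∅)` pointwise. [folklore] -/
theorem equiv_apply_eq_of_mem_expDcl {a : ℂ} (ha : a ∈ expDcl) (σ : Language.expRing.Equiv ℂ ℂ) :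
    σ a = a :=
  equiv_mem_of_definable₁ ha σ rfl

/-- `∅`-algebraic numbers have finite `Aut(ℂ_exp)`-orbits. [folklore] -/
theorem finite_orbit_of_mem_expAcl {a : ℂ} (ha : a ∈ expAcl) :
    (Set.range fun σ : Language.expRing.Equiv ℂ ℂ => σ a).Finite := by
  obtain ⟨s, hs, hdef, has⟩ := ha
  exact hs.subset (by rintro _ ⟨σ, rfl⟩; exact equiv_mem_of_definable₁ hdef σ has)

/-- ONE automorphism of `ℂ_exp` moving `ln 2` denies the hub … -/
theorem log_two_not_mem_expDcl_of_equiv_apply_ne (σ : Language.expRing.Equiv ℂ ℂ)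
    (h : σ (Real.log 2 : ℂ) ≠ Real.log 2) : (Real.log 2 : ℂ) ∉ expDcl :=
  fun hd => h (equiv_apply_eq_of_mem_expDcl hd σ)

/-- … hence settles the instance (A)|_{T₂} (vacuously: then NO branch of `log 2` is `∅`-algebraic) … -/
theorem branch_not_mem_expAcl_of_equiv_apply_ne (σ : Language.expRing.Equiv ℂ ℂ)
    (h : σ (Real.log 2 : ℂ) ≠ Real.log 2) (k : ℤ) :
    (Real.log 2 : ℂ) + k * (2 * Real.pi * Complex.I) ∉ expAcl :=
  fun hk => log_two_not_mem_expDcl_of_equiv_apply_ne σ h ((branch_mem_expAcl_iff k).1 hk)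

/-- … and, modulo Theorem L, proves the all-branch algebraic independence of `log 2` and `log 3`
(compare the route's support `EndomorphismMovingLogTwo`: an endomorphism moving `ln 2` gives
`π ⊥ ln 2` by Lindemann alone). -/
theorem allBranchIndep_of_equiv_apply_ne
    (hL : Summit.Schanuel.Schanuel.Theses.RigidCore.TwoLogsBranchRelationFinite)
    (σ : Language.expRing.Equiv ℂ ℂ) (h : σ (Real.log 2 : ℂ) ≠ Real.log 2)
    (R : MvPolynomial (Fin 2) ℤ) (hR : 0 < R.totalDegree) (j k : ℤ) :
    MvPolynomial.aeval ![(Real.log 2 : ℂ) + j * (2 * Real.pi * Complex.I),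
      (Real.log 3 : ℂ) + k * (2 * Real.pi * Complex.I)] R ≠ 0 := fun hrel =>
  log_two_not_mem_expDcl_of_equiv_apply_ne σ h (log_two_mem_expDcl_of_branchRelation hL hR hrel)

/-- **What a refutation of (A) does to the symmetric programme**: it produces a real number outside
`C_EA` that is fixed by EVERY automorphism of `ℂ_exp` — so `Aut(ℂ_exp)` would NOT move every
non-log-free number, against what Zilber's conjecture (homogeneity of `𝔹` over the kernel, plus
L1 `acl^𝔹(∅) = EA(SK)`) predicts. -/
theorem exists_fixed_real_not_mem_of_not
    (h : ¬ Summit.Schanuel.Schanuel.Theses.RigidCore.AclSubsetLogFreeCore) :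
    ∃ r : ℝ, (r : ℂ) ∉ logFreeCore ∧ ∀ σ : Language.expRing.Equiv ℂ ℂ, σ (r : ℂ) = r := by
  obtain ⟨r, hr, hn⟩ := exists_real_mem_expDcl_not_mem_of_not h
  exact ⟨r, hn, fun σ => equiv_apply_eq_of_mem_expDcl hr σ⟩



/-! ### §13.9 Polynomial relations feed the hub UNCONDITIONALLY (landing: `Negative/LogTwoPolynomialRelations.lean`)

For POLYNOMIAL relations `ln 3 + 2πik = S(ln 2 + 2πij)`, `S ∈ ℤ[X]`, the finiteness of the relation set
needs no Baker input: `{x | e^x = 2 ∧ e^{S(x)} = 3}` is finite for every `S` (`finite_polyRelationSet`,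
from Hermite–Lindemann via Taylor coefficients along the line `ln 2 + 2πiT`).  Hence, UNCONDITIONALLY,
(A) ⇒ `ln 2 ∈ C_EA` ∨ no branch of `log 3` is an integer polynomial in a branch of `log 2`
(`logFree_or_noPolyRelation_of_crux`), and one automorphism of `ℂ_exp` moving `ln 2` proves
`ln 3 + 2πik ∉ ℤ[ln 2 + 2πij]` (`noPolyRelation_of_equiv_apply_ne`). -/

section PolyRelations

open Polynomial

/-! #### Transcendence inputs (Hermite–Lindemann only) -/

/-- `ln 2` is transcendental: otherwise `2 = e^{ln 2}` would be transcendental. [cite: BakerTNT1975, Ch. 1 Thm 1.4] -/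
theorem transcendental_log_two : Transcendental ℚ (Real.log 2 : ℂ) := by
  intro halg
  have hne : (Real.log 2 : ℂ) ≠ 0 := by exact_mod_cast (Real.log_pos one_lt_two).ne'
  refine Literature.NumberTheory.Transcendental.transcendental_exp_holds halg hne ?_
  rw [exp_log_two]
  exact_mod_cast isAlgebraic_nat (R := ℚ) (A := ℂ) 2

/-- `ln 2` is irrational. [folklore] -/
theorem log_two_ne_ratCast (q : ℚ) : Real.log 2 ≠ (q : ℝ) := by
  intro h
  apply transcendental_log_two
  rw [show ((Real.log 2 : ℝ) : ℂ) = ((q : ℝ) : ℂ) by rw [h], Complex.ofReal_ratCast]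
  simpa using isAlgebraic_algebraMap (R := ℚ) (A := ℂ) q

/-- `3 ≠ 2^a` for rational `a` (`3^q` is odd). [folklore] -/
theorem three_ne_two_rpow_ratCast (a : ℚ) : (3 : ℝ) ≠ (2 : ℝ) ^ (a : ℝ) := by
  intro h3
  have hand : (a : ℝ) = (a.num : ℝ) / (a.den : ℝ) := by exact_mod_cast (Rat.num_div_den a).symm
  have hdpos : 0 < a.den := a.den_pos
  have h3d : (3 : ℝ) ^ (a.den : ℕ) = (2 : ℝ) ^ (a.num : ℤ) := by
    have : ((2 : ℝ) ^ (a : ℝ)) ^ (a.den : ℕ) = (2 : ℝ) ^ (a.num : ℝ) := by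
      rw [← Real.rpow_natCast, ← Real.rpow_mul two_pos.le, hand]
      congr 1
      field_simp
    rw [h3, this, Real.rpow_intCast]
  have hnum : 0 ≤ a.num := by
    by_contra hneg
    push Not at hneg
    have hlt : (2 : ℝ) ^ (a.num : ℤ) < 1 := zpow_lt_one_of_neg₀ (by norm_num) hneg
    have hge : (1 : ℝ) ≤ (3 : ℝ) ^ (a.den : ℕ) := one_le_pow₀ (by norm_num)
    linarith
  obtain ⟨n, hn⟩ := Int.eq_ofNat_of_zero_le hnum
  rw [hn, zpow_natCast] at h3d
  have hnat : (3 : ℕ) ^ a.den = 2 ^ n := by exact_mod_cast h3d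
  rcases Nat.eq_zero_or_pos n with hn0 | hnpos
  · rw [hn0, pow_zero] at hnat
    have : a.den = 0 := (Nat.pow_eq_one.1 hnat).resolve_left (by norm_num)
    omega
  · have h2dvd : 2 ∣ 3 ^ a.den := ⟨2 ^ (n - 1), by
      rw [hnat, ← pow_succ', Nat.sub_add_cancel hnpos]⟩
    have := Nat.Prime.dvd_of_dvd_pow Nat.prime_two h2dvd
    omega

/-- `2^a` is algebraic for rational `a`. [folklore] -/
theorem isAlgebraic_two_rpow_ratCast (a : ℚ) : IsAlgebraic ℚ ((2 : ℝ) ^ (a : ℝ)) := by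
  have hdpos : 0 < a.den := a.den_pos
  refine IsAlgebraic.of_pow hdpos ?_
  have hand : (a : ℝ) = (a.num : ℝ) / (a.den : ℝ) := by exact_mod_cast (Rat.num_div_den a).symm
  have : ((2 : ℝ) ^ (a : ℝ)) ^ (a.den : ℕ) = (((2 : ℚ) ^ (a.num : ℤ) : ℚ) : ℝ) := by
    rw [← Real.rpow_natCast, ← Real.rpow_mul two_pos.le, hand]
    have : (a.num : ℝ) / (a.den : ℝ) * (a.den : ℕ) = (a.num : ℤ) := by
      field_simp
    rw [this, Real.rpow_intCast]
    push_cast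
    rfl
  rw [this]
  exact isAlgebraic_algebraMap _

/-- **`ln 3 ≠ a·ln 2 + b` for rational `a, b`**: for `b ≠ 0` the number `e^b = 3·2^{-a}` would be
algebraic, against Hermite–Lindemann; for `b = 0`, `3 = 2^a` is impossible. [cite: BakerTNT1975, Ch. 1 Thm 1.4] -/
theorem log_three_ne_rat_mul_log_two_add (a b : ℚ) :
    Real.log 3 ≠ (a : ℝ) * Real.log 2 + (b : ℝ) := by
  intro h
  by_cases hb : b = 0
  · apply three_ne_two_rpow_ratCast a
    rw [Real.rpow_def_of_pos two_pos, mul_comm, ← Real.exp_log three_pos, h, hb]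
    push_cast
    ring_nf
  · have hexp : Real.exp b = 3 * ((2 : ℝ) ^ (a : ℝ))⁻¹ := by
      rw [Real.rpow_def_of_pos two_pos, ← Real.exp_neg, ← Real.exp_log three_pos, ← Real.exp_add]
      congr 1
      linarith
    have halg : IsAlgebraic ℚ (Real.exp b) := by
      rw [hexp]
      exact (isAlgebraic_nat 3).mul (isAlgebraic_two_rpow_ratCast a).inv
    have halgC : IsAlgebraic ℚ (Complex.exp (b : ℂ)) := by
      have hb' : Complex.exp (b : ℂ) = ((Real.exp b : ℝ) : ℂ) := by
        rw [Complex.ofReal_exp]; push_cast; rfl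
      rw [hb']
      exact halg.algebraMap
    have hbalg : IsAlgebraic ℚ (b : ℂ) := by
      simpa using isAlgebraic_algebraMap (R := ℚ) (A := ℂ) b
    have hbne : (b : ℂ) ≠ 0 := by exact_mod_cast hb
    exact Literature.NumberTheory.Transcendental.transcendental_exp_holds hbalg hbne halgC

/-! #### Polynomial bookkeeping: Taylor coefficients along a line -/

/-- `(p ∘ (aX))_k = a^k p_k`. [folklore] -/
theorem coeff_comp_C_mul_X {R : Type*} [CommSemiring R] (p : R[X]) (a : R) (k : ℕ) :
    (p.comp (C a * X)).coeff k = a ^ k * p.coeff k := by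
  induction p using Polynomial.induction_on' with
  | add p q hp hq => simp only [add_comp, coeff_add, hp, hq, mul_add]
  | monomial n b =>
    rw [← C_mul_X_pow_eq_monomial, mul_comp, C_comp, X_pow_comp, mul_pow, ← C_pow, ← mul_assoc,
      ← C_mul, coeff_C_mul_X_pow, coeff_C_mul_X_pow]
    split_ifs with h
    · subst h; ring
    · simp

/-- **Taylor along the line `c + dT`**: `(f(c + dT))_k = d^k · (H_k f)(c)` (Hasse derivative). [folklore] -/
theorem coeff_comp_line {R : Type*} [CommRing R] (f : R[X]) (c d : R) (k : ℕ) :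
    (f.comp (C c + C d * X)).coeff k = d ^ k * (hasseDeriv k f).eval c := by
  have h : f.comp (C c + C d * X) = (taylor c f).comp (C d * X) := by
    rw [taylor_apply, comp_assoc, add_comp, X_comp, C_comp, add_comm]
  rw [h, coeff_comp_C_mul_X, taylor_coeff]

/-- The value `(H_m f)(c)` when `deg f = m + 1`: `f_m + (m+1) f_{m+1} c`. [folklore] -/
theorem hasseDeriv_eval_of_natDegree_eq_succ {R : Type*} [CommRing R] (f : R[X]) {m : ℕ}
    (hf : f.natDegree = m + 1) (c : R) :
    (hasseDeriv m f).eval c = f.coeff m + (m + 1 : ℕ) * f.coeff (m + 1) * c := by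
  have hdeg : (hasseDeriv m f).natDegree < 2 := by
    have := natDegree_hasseDeriv_le f m
    omega
  rw [eval_eq_sum_range' hdeg, Finset.sum_range_succ, Finset.sum_range_one, hasseDeriv_coeff,
    hasseDeriv_coeff, zero_add, Nat.choose_self, add_comm 1 m, Nat.choose_succ_self_right]
  push_cast
  ring

/-! #### Finiteness of the polynomial relation sets -/

/-- Conjugation commutes with evaluation of an integer polynomial. [folklore] -/
theorem conj_eval_map_int (S : ℤ[X]) (z : ℂ) :
    (starRingEnd ℂ) ((S.map (Int.castRingHom ℂ)).eval z) =
      (S.map (Int.castRingHom ℂ)).eval ((starRingEnd ℂ) z) := by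
  rw [eval_map, eval_map, hom_eval₂]
  congr 1
  exact RingHom.ext_int _ _

/-- `aeval x S = (S.map ℤ→ℂ).eval x`. [folklore] -/
theorem aeval_eq_eval_map_int (S : ℤ[X]) (x : ℂ) :
    Polynomial.aeval x S = (S.map (Int.castRingHom ℂ)).eval x := by
  rw [eval_map, aeval_def, algebraMap_int_eq]

/-- The reflected line polynomial `E(T) = p(T) + p(-T) − 2ℓ`, `p(T) = f(c + dT)`: its value. -/
theorem eval_linePoly_add_reflect (f : ℂ[X]) (c d ℓ t : ℂ) :
    (f.comp (C c + C d * X) + (f.comp (C c + C d * X)).comp (C (-1) * X) - C (2 * ℓ)).eval t =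
      f.eval (c + d * t) + f.eval (c - d * t) - 2 * ℓ := by
  simp only [eval_sub, eval_add, eval_comp, eval_mul, eval_C, eval_X]
  ring_nf

/-- Its coefficients: `E_k = (1 + (-1)^k) d^k (H_k f)(c) − [k = 0]·2ℓ`. -/
theorem coeff_linePoly_add_reflect (f : ℂ[X]) (c d ℓ : ℂ) (k : ℕ) :
    (f.comp (C c + C d * X) + (f.comp (C c + C d * X)).comp (C (-1) * X) - C (2 * ℓ)).coeff k =
      (1 + (-1) ^ k) * (d ^ k * (hasseDeriv k f).eval c) - if k = 0 then 2 * ℓ else 0 := by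
  rw [coeff_sub, coeff_add, coeff_comp_C_mul_X, coeff_comp_line, coeff_C]
  ring

/-- **The key non-vanishing.**  For `S ∈ ℤ[X]`, `c = ln 2`, `d = 2πi`, `ℓ = ln 3`, the polynomial
`E(T) = S(c + dT) + S(c − dT) − 2ℓ` is not zero.  (`E = 0` forces `(H_k S)(ln 2) = 0` for even
`k ≥ 2` and `S(ln 2) = ln 3`: even degree kills the leading coefficient, odd degree `≥ 3` makes
`ln 2` rational, degree `≤ 1` contradicts `log_three_ne_rat_mul_log_two_add`.) -/
theorem linePoly_add_reflect_ne_zero (S : ℤ[X]) :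
    (S.map (Int.castRingHom ℂ)).comp (C (Real.log 2 : ℂ) + C (2 * Real.pi * Complex.I) * X) +
        ((S.map (Int.castRingHom ℂ)).comp (C (Real.log 2 : ℂ) + C (2 * Real.pi * Complex.I) * X)).comp
          (C (-1) * X) - C (2 * (Real.log 3 : ℂ)) ≠ 0 := by
  set f : ℂ[X] := S.map (Int.castRingHom ℂ) with hfdef
  set c : ℂ := (Real.log 2 : ℂ)
  set d : ℂ := 2 * Real.pi * Complex.I with hddef
  set ℓ : ℂ := (Real.log 3 : ℂ)
  intro hE
  have hcoeff : ∀ k, (1 + (-1 : ℂ) ^ k) * (d ^ k * (hasseDeriv k f).eval c) -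
      (if k = 0 then 2 * ℓ else 0) = 0 := fun k => by
    rw [← coeff_linePoly_add_reflect f c d ℓ k, hE, coeff_zero]
  have hd : d ≠ 0 := by
    rw [hddef]; exact two_pi_I_ne_zero'
  have hfdeg : f.natDegree = S.natDegree := by
    rw [hfdef, natDegree_map_eq_of_injective (Int.castRingHom ℂ).injective_int]
  have hfcoeff : ∀ k, f.coeff k = (S.coeff k : ℂ) := fun k => by
    rw [hfdef, coeff_map]; rfl
  -- the constant coefficient: S(c) = ℓ
  have h0 : f.eval c = ℓ := by
    have := hcoeff 0
    simp only [pow_zero, hasseDeriv_zero', one_mul, if_true] at this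
    linear_combination this / 2
  -- even coefficients k ≥ 2 vanish
  have heven : ∀ k, k ≠ 0 → Even k → (hasseDeriv k f).eval c = 0 := by
    intro k hk hke
    have := hcoeff k
    rw [if_neg hk, sub_zero, hke.neg_one_pow] at this
    have h2 : (1 + 1 : ℂ) * d ^ k ≠ 0 := mul_ne_zero (by norm_num) (pow_ne_zero _ hd)
    have : ((1 + 1 : ℂ) * d ^ k) * (hasseDeriv k f).eval c = 0 := by
      linear_combination this
    exact (mul_eq_zero.1 this).resolve_left h2
  -- case analysis on the degree
  rcases Nat.lt_or_ge S.natDegree 2 with hlt | hge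
  · -- degree ≤ 1 : S(c) = a₀ + a₁ c = ℓ
    have hdeg : f.natDegree < 2 := by rw [hfdeg]; exact hlt
    have heval : f.eval c = (S.coeff 0 : ℂ) + (S.coeff 1 : ℂ) * c := by
      rw [eval_eq_sum_range' hdeg, Finset.sum_range_succ, Finset.sum_range_one, hfcoeff, hfcoeff]
      ring
    apply log_three_ne_rat_mul_log_two_add (S.coeff 1 : ℚ) (S.coeff 0 : ℚ)
    have h' : ℓ = (S.coeff 0 : ℂ) + (S.coeff 1 : ℂ) * c := h0 ▸ heval
    apply Complex.ofReal_injective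
    push_cast
    linear_combination h'
  · rcases Nat.even_or_odd S.natDegree with hev | hodd
    · -- even degree ≥ 2 : leading coefficient dies
      have hk := heven S.natDegree (by omega) hev
      rw [← hfdeg, hasseDeriv_natDegree_eq_C, eval_C, leadingCoeff_eq_zero] at hk
      have : f.natDegree = 0 := by rw [hk, natDegree_zero]
      omega
    · -- odd degree n = m + 1 ≥ 3 : (H_m f)(c) = a_m + (m+1) a_{m+1} c = 0 makes c rational
      obtain ⟨m, hm⟩ : ∃ m, S.natDegree = m + 1 := ⟨S.natDegree - 1, by omega⟩
      have hmeven : Even m := by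
        rcases hodd with ⟨r, hr⟩; exact ⟨r, by omega⟩
      have hm0 : m ≠ 0 := by omega
      have hk := heven m hm0 hmeven
      rw [hasseDeriv_eval_of_natDegree_eq_succ f (hfdeg.trans hm) c, hfcoeff, hfcoeff] at hk
      have hlead : (S.coeff (m + 1) : ℂ) ≠ 0 := by
        have : S.coeff (m + 1) ≠ 0 := by
          rw [← hm]; exact leadingCoeff_ne_zero.2 (by rintro rfl; simp at hm)
        exact_mod_cast this
      have hmne : ((m + 1 : ℕ) : ℂ) ≠ 0 := Nat.cast_ne_zero.2 (Nat.succ_ne_zero m)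
      -- c = - a_m / ((m+1) a_{m+1})
      have hmne' : (m : ℂ) + 1 ≠ 0 := by exact_mod_cast Nat.succ_ne_zero m
      apply log_two_ne_ratCast (-(S.coeff m : ℚ) / ((m + 1 : ℕ) * (S.coeff (m + 1) : ℚ)))
      apply Complex.ofReal_injective
      push_cast at hk ⊢
      field_simp
      linear_combination hk

/-- **Finiteness, unconditionally.** For every `S ∈ ℤ[X]`, only finitely many `x` with `e^x = 2`
have `e^{S(x)} = 3`. [cite: BakerTNT1975, Ch. 1 Thm 1.4 (the only transcendence input)] -/
theorem finite_polyRelationSet (S : ℤ[X]) :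
    {x : ℂ | Complex.exp x = 2 ∧ Complex.exp (Polynomial.aeval x S) = 3}.Finite := by
  set f : ℂ[X] := S.map (Int.castRingHom ℂ) with hfdef
  set c : ℂ := (Real.log 2 : ℂ) with hcdef
  set d : ℂ := 2 * Real.pi * Complex.I with hddef
  set ℓ : ℂ := (Real.log 3 : ℂ) with hℓdef
  set E : ℂ[X] := f.comp (C c + C d * X) + (f.comp (C c + C d * X)).comp (C (-1) * X) - C (2 * ℓ)
    with hEdef
  have hE : E ≠ 0 := linePoly_add_reflect_ne_zero S
  refine ((E.finite_setOf_isRoot hE).image fun t : ℂ => c + d * t).subset ?_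
  rintro x ⟨hx, hS⟩
  obtain ⟨j, rfl⟩ := mem_logTwoBranches_iff.1 hx
  refine ⟨(j : ℂ), ?_, by rw [hcdef, hddef]; ring⟩
  -- `S(x_j) = ℓ + k d`
  have hS' : ∃ k : ℤ, Polynomial.aeval ((Real.log 2 : ℂ) + j * (2 * Real.pi * Complex.I)) S =
      ℓ + k * (2 * Real.pi * Complex.I) := by
    rw [← exp_log_three, Complex.exp_eq_exp_iff_exists_int] at hS
    exact hS
  obtain ⟨k, hk⟩ := hS'
  rw [aeval_eq_eval_map_int] at hk
  have hxj : (Real.log 2 : ℂ) + j * (2 * Real.pi * Complex.I) = c + d * j := by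
    rw [hcdef, hddef]; ring
  rw [hxj] at hk
  -- conjugate: `S(c - d j) = ℓ - k d`
  have hconj : f.eval (c - d * j) = ℓ - k * d := by
    have h1 := conj_eval_map_int S (c + d * j)
    rw [← hfdef, hk] at h1
    have hcz : (starRingEnd ℂ) (c + d * j) = c - d * j := by
      rw [hcdef, hddef]
      simp only [map_add, map_mul, Complex.conj_ofReal, Complex.conj_I, map_intCast, map_ofNat]
      ring
    have hcl : (starRingEnd ℂ) (ℓ + k * (2 * Real.pi * Complex.I)) = ℓ - k * d := by
      rw [hℓdef, hddef]
      simp only [map_add, map_mul, Complex.conj_ofReal, Complex.conj_I, map_intCast, map_ofNat]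
      ring
    rw [hcz, hcl] at h1
    exact h1.symm
  show E.IsRoot (j : ℂ)
  rw [IsRoot.def, hEdef, eval_linePoly_add_reflect, hk, hconj, hddef]
  ring

/-! #### Wiring to the hub: polynomial relations make `ln 2` definable, unconditionally -/

/-- One-variable integer polynomial maps are `∅`-definable functions of any coordinate. [folklore] -/
theorem definableFun_polynomial_aeval {α : Type*} (S : ℤ[X]) (i : α) :
    (∅ : Set ℂ).DefinableFun Language.expRing (fun v : α → ℂ => Polynomial.aeval (v i) S) := by
  induction S using Polynomial.induction_on' with
  | add p q hp hq => simpa using definableFun_add' hp hq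
  | monomial n a =>
    have hpow : ∀ m : ℕ, (∅ : Set ℂ).DefinableFun Language.expRing (fun v : α → ℂ => v i ^ m) := by
      intro m
      induction m with
      | zero => simpa using (definableFun_one' (A := (∅ : Set ℂ)) (α := α))
      | succ m ih => simpa [pow_succ] using definableFun_mul' ih (definableFun_proj_params i)
    simpa [Polynomial.aeval_monomial] using definableFun_mul' (definableFun_intCast' a) (hpow n)

/-- The polynomial relation set `{x | e^x = 2 ∧ e^{S(x)} = 3}` is `∅`-definable. -/
theorem definable₁_polyRelationSet (S : ℤ[X]) :
    Set.Definable₁ (∅ : Set ℂ) Language.expRing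
      {x : ℂ | Complex.exp x = 2 ∧ Complex.exp (Polynomial.aeval x S) = 3} := by
  unfold Set.Definable₁
  simp only [Set.mem_setOf_eq]
  have h2 : (∅ : Set ℂ).DefinableFun Language.expRing (fun _ : Fin 1 → ℂ => (2 : ℂ)) := by
    simpa using definableFun_natCast' (A := (∅ : Set ℂ)) (α := Fin 1) 2
  have h3 : (∅ : Set ℂ).DefinableFun Language.expRing (fun _ : Fin 1 → ℂ => (3 : ℂ)) := by
    simpa using definableFun_natCast' (A := (∅ : Set ℂ)) (α := Fin 1) 3
  refine definable_setOf_and_params ?_ ?_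
  · exact definable_setOf_eq_params (definableFun_cexp (definableFun_proj_params _)) h2
  · exact definable_setOf_eq_params (definableFun_cexp (definableFun_polynomial_aeval S 0)) h3

/-- **A polynomial relation `S(ln 2 + 2πij) = ln 3 + 2πik` makes `ln 2` pointwise `∅`-definable —
unconditionally** (finiteness §3 + conjugation averaging). -/
theorem log_two_mem_expDcl_of_polyRelation (S : ℤ[X]) {j k : ℤ}
    (hrel : Polynomial.aeval ((Real.log 2 : ℂ) + j * (2 * Real.pi * Complex.I)) S =
      (Real.log 3 : ℂ) + k * (2 * Real.pi * Complex.I)) :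
    (Real.log 2 : ℂ) ∈ expDcl := by
  refine log_two_mem_expDcl_of_finite_definable_subset (finite_polyRelationSet S)
    (definable₁_polyRelationSet S) (fun _ h => h.1) ⟨_, log_two_add_mem_logTwoBranches j, ?_⟩
  show Complex.exp (Polynomial.aeval ((Real.log 2 : ℂ) + j * (2 * Real.pi * Complex.I)) S) = 3
  rw [hrel, Complex.exp_add, exp_log_three, Complex.exp_int_mul_two_pi_mul_I, mul_one]

/-- Hence (A) and one polynomial relation force `ln 2 ∈ C_EA`. -/
theorem log_two_mem_logFreeCore_of_crux_of_polyRelation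
    (hA : Summit.Schanuel.Schanuel.Theses.RigidCore.AclSubsetLogFreeCore) (S : ℤ[X]) {j k : ℤ}
    (hrel : Polynomial.aeval ((Real.log 2 : ℂ) + j * (2 * Real.pi * Complex.I)) S =
      (Real.log 3 : ℂ) + k * (2 * Real.pi * Complex.I)) :
    (Real.log 2 : ℂ) ∈ logFreeCore :=
  log_two_mem_logFreeCore_of_crux hA (log_two_mem_expDcl_of_polyRelation S hrel)

/-- **UNCONDITIONAL CALIBRATION: (A) is not soft.**  (A) implies: `ln 2 ∈ C_EA` (false under
Schanuel's conjecture) OR no branch of `log 3` is an integer polynomial in a branch of `log 2`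
(open: already `ln 3 ∉ {m ln²2 + r}` is unknown).  No Baker / Theorem L input. -/
theorem logFree_or_noPolyRelation_of_crux
    (hA : Summit.Schanuel.Schanuel.Theses.RigidCore.AclSubsetLogFreeCore) :
    (Real.log 2 : ℂ) ∈ logFreeCore ∨
      ∀ (S : ℤ[X]) (j k : ℤ),
        Polynomial.aeval ((Real.log 2 : ℂ) + j * (2 * Real.pi * Complex.I)) S ≠
          (Real.log 3 : ℂ) + k * (2 * Real.pi * Complex.I) := by
  by_cases h : (Real.log 2 : ℂ) ∈ logFreeCore
  · exact Or.inl h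
  · exact Or.inr fun S j k hrel => h (log_two_mem_logFreeCore_of_crux_of_polyRelation hA S hrel)

/-- **Symmetry ⇒ transcendence, unconditionally:** one automorphism of `ℂ_exp` moving `ln 2`
implies `ln 3 + 2πik ∉ ℤ[ln 2 + 2πij]` for all `j, k` — a statement about two logarithms of
algebraic numbers beyond Baker's linear forms. -/
theorem noPolyRelation_of_equiv_apply_ne (σ : Language.expRing.Equiv ℂ ℂ)
    (h : σ (Real.log 2 : ℂ) ≠ Real.log 2) (S : ℤ[X]) (j k : ℤ) :
    Polynomial.aeval ((Real.log 2 : ℂ) + j * (2 * Real.pi * Complex.I)) S ≠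
      (Real.log 3 : ℂ) + k * (2 * Real.pi * Complex.I) := fun hrel =>
  log_two_not_mem_expDcl_of_equiv_apply_ne σ h (log_two_mem_expDcl_of_polyRelation S hrel)

/-- The KMO form: if some `2^{1/n}` (`n ≥ 1`) is not pointwise `∅`-definable in `ℂ_exp`, then no
branch of `log 3` is an integer polynomial in a branch of `log 2` — unconditionally. -/
theorem noPolyRelation_of_root_two_not_mem_expDcl {n : ℕ} (hn : n ≠ 0)
    (h : (((2 : ℝ) ^ ((n : ℝ)⁻¹) : ℝ) : ℂ) ∉ expDcl) (S : ℤ[X]) (j k : ℤ) :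
    Polynomial.aeval ((Real.log 2 : ℂ) + j * (2 * Real.pi * Complex.I)) S ≠
      (Real.log 3 : ℂ) + k * (2 * Real.pi * Complex.I) := fun hrel =>
  h (root_two_mem_expDcl_of_log_two_mem_expDcl (log_two_mem_expDcl_of_polyRelation S hrel) hn)


end PolyRelations

end Hub

/-! ## §14 (gen 5) The standard-kernel axioms do not force (A)
(landing: `Negative/StandardKernelTwistLinear.lean`, `Negative/StandardKernelTwistBases.lean`,
`Negative/StandardKernelTwist.lean`; the 750-line construction of the twist `Φ` lives there and is
not duplicated in this work file — only the self-contained statements are re-checked here, and the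
main theorem is quoted with its landed name). -/

namespace StdKernel

/-- `(A)[E]`: the crux with `Complex.exp` replaced by the E-ring exponential `E` in BOTH occurrences. -/
def AclSubsetCoreOf (E : ExponentialRing ℂ) : Prop :=
  ∀ a : ℂ, (∃ s : Set ℂ, s.Finite ∧
      @Set.Definable₁ ℂ (∅ : Set ℂ) Language.expRing
        (@Language.expRing.instStructure ℂ _ E) s ∧ a ∈ s) →
    a ∈ (sInf {K : IntermediateField ℚ ℂ | (2 * ↑Real.pi * Complex.I : ℂ) ∈ K ∧
      (∀ w ∈ K, @ExponentialRing.exp ℂ _ E w ∈ K) ∧ ∀ w : ℂ, IsAlgebraic K w → w ∈ K} :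
        IntermediateField ℚ ℂ)

/-- `(A)[Complex.exp]` is the crux, definitionally. -/
theorem aclSubsetCoreOf_complexExp_iff :
    AclSubsetCoreOf Complex.instExponentialRing ↔
      Summit.Schanuel.Schanuel.Theses.RigidCore.AclSubsetLogFreeCore := Iff.rfl

/-- The three algebraic axioms of `Complex.exp` that the twisted model shares. -/
def IsStdKernelExp (E : ExponentialRing ℂ) : Prop :=
  (∀ z : ℂ, @ExponentialRing.exp ℂ _ E z = 1 ↔ ∃ k : ℤ, z = k * (2 * ↑Real.pi * Complex.I)) ∧
  (∀ w : ℂ, w ≠ 0 → ∃ z : ℂ, @ExponentialRing.exp ℂ _ E z = w) ∧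
  (∀ q : ℚ, @ExponentialRing.exp ℂ _ E (q • (2 * ↑Real.pi * Complex.I)) =
    Complex.exp (q • (2 * ↑Real.pi * Complex.I)))

/-- `Complex.exp` has them. -/
theorem isStdKernelExp_complexExp : IsStdKernelExp Complex.instExponentialRing :=
  ⟨fun _ => Complex.exp_eq_one_iff, fun w hw => ⟨Complex.log w, Complex.exp_log hw⟩, fun _ => rfl⟩

/-- `{x | E x = 2 ∧ E (x·x) = 3}` is `∅`-definable in ANY exponential ring (quantifier-free). -/
theorem definable₁_twoThreeSet (M : Type*) [Ring M] [ExponentialRing M] :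
    Set.Definable₁ (∅ : Set M) Language.expRing
      {x : M | ExponentialRing.exp x = 2 ∧ ExponentialRing.exp (x * x) = 3} := by
  unfold Set.Definable₁
  simp only [Set.mem_setOf_eq]
  have h1 : (∅ : Set M).DefinableFun Language.expRing
      (fun v : Fin 1 → M => ExponentialRing.exp (v 0)) := by
    have := (Language.expRing.termExp (Term.var (0 : Fin 1)) :
      Language.expRing.Term (Fin 1)).definableFun_realize (M := M)
    simpa using this
  have h2 : (∅ : Set M).DefinableFun Language.expRing
      (fun v : Fin 1 → M => ExponentialRing.exp (v 0 * v 0)) := by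
    have := (Language.expRing.termExp (Term.var (0 : Fin 1) * Term.var 0) :
      Language.expRing.Term (Fin 1)).definableFun_realize (M := M)
    simpa using this
  have h3 : (∅ : Set M).DefinableFun Language.expRing (fun _ : Fin 1 → M => (2 : M)) := by
    have := ((1 + 1 : Language.expRing.Term (Fin 1))).definableFun_realize (M := M)
    simpa [one_add_one_eq_two] using this
  have h4 : (∅ : Set M).DefinableFun Language.expRing (fun _ : Fin 1 → M => (3 : M)) := by
    have := ((1 + 1 + 1 : Language.expRing.Term (Fin 1))).definableFun_realize (M := M)
    have e : (1 : M) + 1 + 1 = 3 := by norm_num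
    simpa [e] using this
  exact (h1.setOf_eq h3).inter (h2.setOf_eq h4)

/-- In `ℂ_exp` the formula `exp(x) = 2 ∧ exp(x·x) = 3` defines `∅` (unconditionally: `ln 2 ∉ ℚ`,
`ln² 2 < ln 3`); (A) holds vacuously on it — whereas in the twisted standard-kernel field `(ℂ, E)` the
same formula defines `{e^π} ⊄ core_E`. -/
theorem twoThreeSet_complexExp_eq_empty :
    {x : ℂ | Complex.exp x = 2 ∧ Complex.exp (x * x) = 3} = ∅ := by
  ext x
  simp only [Set.mem_setOf_eq, Set.mem_empty_iff_false, iff_false, not_and]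
  intro h2 h3
  have e2 : Complex.exp x = Complex.exp (Real.log 2 : ℂ) := by rw [h2, exp_log_two]
  obtain ⟨n, hn⟩ := Complex.exp_eq_exp_iff_exists_int.1 e2
  have e3 : Complex.exp (x * x) = Complex.exp (Real.log 3 : ℂ) := by rw [h3, exp_log_three]
  obtain ⟨m, hm⟩ := Complex.exp_eq_exp_iff_exists_int.1 e3
  rw [hn] at hm
  have hL : ((Real.log 2 : ℂ) + n * (2 * ↑Real.pi * Complex.I)) *
      ((Real.log 2 : ℂ) + n * (2 * ↑Real.pi * Complex.I)) =
      ((Real.log 2 ^ 2 - 4 * Real.pi ^ 2 * n ^ 2 : ℝ) : ℂ) +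
        ((4 * Real.pi * n * Real.log 2 : ℝ) : ℂ) * Complex.I := by
    push_cast
    linear_combination (4 * (Real.pi : ℂ) ^ 2 * (n : ℂ) ^ 2) * Complex.I_sq
  have hR : (Real.log 3 : ℂ) + m * (2 * ↑Real.pi * Complex.I) =
      ((Real.log 3 : ℝ) : ℂ) + ((2 * Real.pi * m : ℝ) : ℂ) * Complex.I := by
    push_cast; ring
  rw [hL, hR, Complex.ext_iff] at hm
  simp only [Complex.add_re, Complex.ofReal_re, Complex.mul_re, Complex.I_re, mul_zero,
    Complex.ofReal_im, Complex.I_im, sub_zero, add_zero, Complex.add_im,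
    Complex.mul_im, mul_one, zero_add] at hm
  obtain ⟨hre, him⟩ := hm
  by_cases hn0 : n = 0
  · subst hn0
    norm_num at hre
    have h2l : Real.log 2 < 0.6931471808 := Real.log_two_lt_d9
    have h2g : 0.6931471803 < Real.log 2 := Real.log_two_gt_d9
    have h23 : Real.log 2 < Real.log 3 := Real.log_lt_log (by norm_num) (by norm_num)
    nlinarith
  · have hn' : (n : ℝ) ≠ 0 := Int.cast_ne_zero.2 hn0
    have him' : 2 * Real.pi * (2 * n * Real.log 2) = 2 * Real.pi * m := by
      linear_combination him
    have him'' := mul_left_cancel₀ (by positivity : (2 * Real.pi) ≠ 0) him'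
    apply log_two_ne_ratCast (m / (2 * n))
    push_cast
    field_simp
    linear_combination him''

/-- **THE STANDARD-KERNEL AXIOMS DO NOT FORCE (A)** (gen 5; PROVED sorry-free in
`Negative/StandardKernelTwist.lean` as
`Summit.Schanuel.Schanuel.Theorems.AclSubsetLogFreeCore.Negative.StandardKernelTwist.exists_stdKernelExp_not_aclSubsetCore`,
axioms `propext/Classical.choice/Quot.sound`; quoted here by `sorry` ONLY because this work file does not import
the three new `Negative/StandardKernelTwist*` modules until they are merged — replace by
`exact StandardKernelTwist.exists_stdKernelExp_not_aclSubsetCore` then).  Construction: `E = exp ∘ Φ`,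
`Φ : ℂ ≃ₗ[ℚ] ℂ` with `Φ(2πi) = 2πi`, `Φ(e^π) = ln 2`, `Φ(e^{2π}) = ln 3`, `Φ(ℚ(π)^{ralg}) ⊆ exp⁻¹(ℚ(π)^{ralg})`
(bases of `ℚ(π)^{ralg}` through `2πi` and of `𝓛` through `{2πi, ln 2, ln 3}`, both countably infinite —
powers of `π`, logs of primes — glued and extended through Hamel bases of `ℂ`); then
`{x | E x = 2 ∧ E(x·x) = 3} = {e^π}` and `ℚ(π)^{ralg}` is an `E`-closed relatively algebraically closed field
`∋ 2πi` missing `e^π` (Nesterenko). -/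
theorem exists_stdKernelExp_not_aclSubsetCore :
    ∃ E : ExponentialRing ℂ, IsStdKernelExp E ∧ ¬ AclSubsetCoreOf E := by
  sorry

end StdKernel

/-! ## §15 (gen 5) The Kummer ladder: rung `n` (`T₂(n) = ln 2 + 2πi·nℤ` is `∅`-definable) ⟺ `2^{1/n} ∈ dcl(∅)`
(landing: `Negative/KummerLadder.lean`, with the power map / roots of unity lemmas). -/

namespace Ladder

/-- **Rung `n` ⟺ `2^{1/n} ∈ dcl(∅)`** (`n ≥ 1`). [folklore] -/
theorem definable₁_branchClass_iff {n : ℕ} (hn : n ≠ 0) :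
    Set.Definable₁ (∅ : Set ℂ) Language.expRing
        {x : ℂ | ∃ k : ℤ, x = Real.log 2 + n * k * (2 * Real.pi * Complex.I)} ↔
      Complex.exp ((Real.log 2 : ℂ) / n) ∈ expDcl := by
  have hn' : (n : ℂ) ≠ 0 := Nat.cast_ne_zero.2 hn
  have h2 : ∀ {α : Type}, (∅ : Set ℂ).DefinableFun Language.expRing (fun _ : α → ℂ => (2 : ℂ)) :=
    fun {α} => by simpa using definableFun_natCast' (A := (∅ : Set ℂ)) (α := α) 2
  set S : Set ℂ := {x : ℂ | ∃ k : ℤ, x = Real.log 2 + n * k * (2 * Real.pi * Complex.I)} with hS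
  set c : ℂ := Complex.exp ((Real.log 2 : ℂ) / n) with hc
  constructor
  · intro hdefS
    have hdef : Set.Definable₁ (∅ : Set ℂ) Language.expRing
        {y : ℂ | ∃ u : ℂ, (n : ℂ) * u ∈ S ∧ y = Complex.exp u} := by
      unfold Set.Definable₁
      simp only [Set.mem_setOf_eq]
      refine definable_setOf_exists_params (definable_setOf_and_params ?_ ?_)
      · exact definable_mem_of_definable₁ hdefS
          (definableFun_mul' (definableFun_natCast' n) (definableFun_proj_params _))
      · exact definable_setOf_eq_params (definableFun_proj_params _)
          (definableFun_cexp (definableFun_proj_params _))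
    have heq : {y : ℂ | ∃ u : ℂ, (n : ℂ) * u ∈ S ∧ y = Complex.exp u} = {c} := by
      ext y
      simp only [Set.mem_setOf_eq, Set.mem_singleton_iff, hS]
      constructor
      · rintro ⟨u, ⟨k, hk⟩, rfl⟩
        have hu : u = (Real.log 2 : ℂ) / n + k * (2 * Real.pi * Complex.I) := by
          field_simp
          linear_combination hk
        rw [hu, Complex.exp_add, Complex.exp_int_mul_two_pi_mul_I, mul_one]
      · rintro rfl
        exact ⟨(Real.log 2 : ℂ) / n, ⟨0, by field_simp; ring⟩, rfl⟩
    show Set.Definable₁ _ _ _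
    rw [← heq]
    exact hdef
  · intro hcdef
    have hdef : Set.Definable₁ (∅ : Set ℂ) Language.expRing
        {x : ℂ | Complex.exp x = 2 ∧ ∃ u : ℂ, (n : ℂ) * u = x ∧ Complex.exp u ∈ ({c} : Set ℂ)} := by
      unfold Set.Definable₁
      simp only [Set.mem_setOf_eq]
      refine definable_setOf_and_params
        (definable_setOf_eq_params (definableFun_cexp (definableFun_proj_params _)) h2) ?_
      refine definable_setOf_exists_params (definable_setOf_and_params ?_ ?_)
      · exact definable_setOf_eq_params
          (definableFun_mul' (definableFun_natCast' n) (definableFun_proj_params _))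
          (definableFun_proj_params _)
      · exact definable_mem_of_definable₁ hcdef (definableFun_cexp (definableFun_proj_params _))
    have heq : {x : ℂ | Complex.exp x = 2 ∧
        ∃ u : ℂ, (n : ℂ) * u = x ∧ Complex.exp u ∈ ({c} : Set ℂ)} = S := by
      ext x
      simp only [Set.mem_setOf_eq, Set.mem_singleton_iff, hS]
      constructor
      · rintro ⟨-, u, hux, hu⟩
        obtain ⟨k, hk⟩ := Complex.exp_eq_exp_iff_exists_int.1 hu
        refine ⟨k, ?_⟩
        rw [← hux, hk]
        field_simp
      · rintro ⟨k, rfl⟩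
        refine ⟨?_, (Real.log 2 : ℂ) / n + k * (2 * Real.pi * Complex.I), ?_, ?_⟩
        · rw [show (Real.log 2 : ℂ) + n * k * (2 * Real.pi * Complex.I) =
              (Real.log 2 : ℂ) + ((n : ℤ) * k : ℤ) * (2 * Real.pi * Complex.I) by push_cast; ring,
            Complex.exp_add, Complex.exp_int_mul_two_pi_mul_I, mul_one, exp_log_two]
        · field_simp
        · rw [Complex.exp_add, Complex.exp_int_mul_two_pi_mul_I, mul_one]
    rw [← heq]
    exact hdef

/-- The hub implies every rung. -/
theorem definable₁_branchClass_of_log_two_mem_expDcl (h : (Real.log 2 : ℂ) ∈ expDcl) {n : ℕ}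
    (hn : n ≠ 0) :
    Set.Definable₁ (∅ : Set ℂ) Language.expRing
      {x : ℂ | ∃ k : ℤ, x = Real.log 2 + n * k * (2 * Real.pi * Complex.I)} :=
  (definable₁_branchClass_iff hn).2 (exp_div_natCast_mem_expDcl h hn)

/-- `√2 ∈ dcl(∅)` (§7). -/
theorem sqrt_two_mem_expDcl : (Real.sqrt 2 : ℂ) ∈ expDcl := by
  have hdef : Set.Definable₁ (∅ : Set ℂ) Language.expRing sqrtTwoSet := by
    unfold Set.Definable₁
    exact definable_sqrtTwoSet (definableFun_proj_params _)
  have heq : sqrtTwoSet = {(Real.sqrt 2 : ℂ)} := Set.ext fun _ => mem_sqrtTwoSet_iff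
  show Set.Definable₁ _ _ _
  rw [← heq]
  exact hdef

/-- Rung 2 holds (even branches: the refuted branch indiscernibility of §7). -/
theorem definable₁_branchClass_two :
    Set.Definable₁ (∅ : Set ℂ) Language.expRing
      {x : ℂ | ∃ k : ℤ, x = Real.log 2 + (2 : ℕ) * k * (2 * Real.pi * Complex.I)} := by
  refine (definable₁_branchClass_iff two_ne_zero).2 ?_
  rw [Nat.cast_ofNat, exp_half_log_two]
  exact sqrt_two_mem_expDcl

/-- Rung 3 ⟺ `2^{1/3} ∈ dcl^{ℂ_exp}(∅)` — KMO's open question (conjecturally false). -/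
theorem definable₁_branchClass_three_iff :
    Set.Definable₁ (∅ : Set ℂ) Language.expRing
        {x : ℂ | ∃ k : ℤ, x = Real.log 2 + (3 : ℕ) * k * (2 * Real.pi * Complex.I)} ↔
      Complex.exp ((Real.log 2 : ℂ) / 3) ∈ expDcl := by
  rw [definable₁_branchClass_iff three_ne_zero]; norm_num

end Ladder



end Summit.Schanuel.Schanuel.Cruxes.AclSubsetLogFreeCore.Disproof
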